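import Literature.Barriers.CriticalPhenomena.LaceExpansionGaussianDeconvolutionLem29
import Literature.Barriers.CriticalPhenomena.LaceExpansionGaussianDeconvolutionProofs
import Literature.Barriers.CriticalPhenomena.LaceExpansionKernelTaylor
import Literature.Barriers.CriticalPhenomena.LaceExpansionLatticeFTHigherDeriv
import Literature.Barriers.CriticalPhenomena.LaceExpansionIsingDeconvolutionPartsInfrared
import Literature.Analysis.FunctionSpaces.TorusTrigPoly
import Literature.Analysis.FunctionSpaces.TorusMollifier
import Mathlib.Analysis.SpecialFunctions.Pow.Integral
import HarnessLib

/-!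
# Liu–Slade 2024, Proposition 2.4 — Part 1: torus and lattice analysis
# (dyadic `L^q` Fourier limits, weak-derivative toolkit, Lemma 2.2, the constants `λ, μ`)

Barrier catalogue `Literature/Barriers/CriticalPhenomena/` (D-0021). First of the two files that
DISCHARGE the named fact `LiuSlade2024_prop24` (Liu–Slade 2024, Proposition 2.4 with the `L¹`
bounds of its proof) of `LaceExpansionGaussianDeconvolution.lean`; the theorem
`LiuSlade2024_prop24_holds` and the description of the whole argument are in
`LaceExpansionGaussianDeconvolutionProp24.lean`, which imports this file. Everything here is
proved (no named facts) and lives in the sub-namespace `LiuSlade2024Prop24` of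
`Literature.Barriers.CriticalPhenomena.SpreadOutIsing` (self-contained helpers of one discharge,
kept out of the shared namespace). Setting: Mathlib's `UnitAddTorus (Fin d) = (ℝ/ℤ)^d` with Haar
probability measure, coordinate `t = k/2π`, the tree's `latticeFourier`, `trigPoly`, `mFourier`,
`Torus.IsSmooth`/`Torus.partialDeriv`, `HasTorusWeakDeriv` (Definition A.1). Contents:

* classical calculus of smooth complex functions on the torus (`isSmooth_mul/inv`,
  `partialDeriv_mul/inv`); sup and `L^q` bounds for scalar trigonometric polynomials;
* boxes `{‖x‖_∞ ≤ m}` (the tree's `LatticeModels.box`) and dyadic shells, and **Lemma 2.6 (ii) /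
  Lemma A.4 without Hausdorff–Young**: for `|c(x)| ≤ K⟦x⟧^{-b}`, `b > d/2`, the transform `ĉ`
  is the a.e. limit `dFT c` of the dyadic box partial sums `dyadicSum c N`
  (`ae_tendsto_dyadicSum`), with `‖ĉ‖_q ≤ (3^d + 8^d/(1 - 2^{-θ}))K` and `L^q` convergence for
  `2 ≤ q`, `θ = d/q - (d - b) > 0` (`eLpNorm_dFT_le`, `tendsto_eLpNorm_dFT_sub_dyadicSum`; each
  shell is interpolated between its sup bound and Parseval, `eLpNorm_trigPoly_shell_le`), and
  `∂ⱼĉ = (2πi xⱼ c)^` weakly (`hasWeakPartialDeriv_dFT`);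
* the weak-derivative toolkit: weak derivatives pass to `L¹` limits
  (`hasWeakPartialDeriv_of_tendsto`), a.e. modification, words `l ++ [i]`
  (`HasTorusWeakDeriv.append_singleton`), smooth functions (`hasWeakPartialDeriv_of_isSmooth`);
* the modulus `ϱ(t) = (Σ‖tᵢ‖²)^{1/2}` (`tnorm`) and `ϱ^{-s} ∈ L^p` for `sp < d`
  (`memLp_tnorm_rpow_neg`: the fundamental cube `(-1/2,1/2]^d` lies in a ball, and the tree's
  `integrableOn_ball_of_norm_le_rpow`); Hölder's inequality for finite products and continuity of
  finite products in `L^p` (`eLpNorm_finset_prod_le`, `tendsto_eLpNorm_finset_prod_sub`);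
* multi-index words and the coefficient families `(2πi x)^w h(x)` (`coefW`), the bridge to the
  cube-side transform `latticeFT` (`dFT_coefW_nil = latticeFourier`), the first-derivative bound
  `|ĥ_j| ≤ 4π² M₂(h) ϱ` for symmetric `h`, `D_nn` and `A_μ = δ - μD_nn` (`latticeFourier_lsA`);
* the infrared bounds `Re F̂ ≥ K₂ϱ²` ((1.10)) and `Re Â_μ ≥ (8μ/d)ϱ²` for `0 ≤ μ ≤ 1` ((1.26),
  from `1 - cos(2πs) ≥ 8s²` for `|s| ≤ 1/2`) (`re_latticeFourier_ge`, `re_latticeFourier_lsA_ge`);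
* **Lemma 2.2** on the torus (`lemma22`): for symmetric `E` with `|E(x)| ≤ K⟦x⟧^{-(d+2+ρ)}`,
  `Σ E = Σ |x|²E = 0`, `0 < σ < ρ`, `σ ≤ 2` and `|β| < 2 + σ`:
  `|Ê_β(t)| ≤ 128π⁷ (Σ_x |x|^{2+σ}|E(x)|) ϱ(t)^{2+σ-|β|}` — the source's four cases
  `|β| = 0, 1, 2, 3`, with the Taylor remainders in Hölder form `|1 - cos u - u²/2| ≤ |u|^{2+σ}`
  etc. and symmetrisation under `x ↦ -x`;
* (1.10) forces `F'' = -Σ|x|²F ≥ dK₂/(2π²)` (`ls24Fpp_ge_of_assumption`), whence the constants of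
  (1.12) obey `0 < λ ≤ 2π²/(dK₂)`, `0 < μ ≤ 1`, `μ ≥ μ₀(d,K₁,K₂,ρ) > 0` and `E = A_μ - λF`
  (`ls24E`) is symmetric with `Σ E = Σ |x|²E = 0` and `|E(x)| ≤ (1 + |μ| + |λ|K₁)⟦x⟧^{-(d+2+ρ)}`
  (`ls24Lambda_pos_and_le`, `ls24Mu_pos_le_one`, `ls24Mu_ge`, `tsum_ls24E`, `tsum_sq_mul_ls24E`);
* the generic **factor package** (`factor_package`): a numerator bounded/convergent in `L^{1/s₁}`
  times a weight dominated by `C ϱ^{-a}` and convergent a.e., `a < d s₂`, is bounded and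
  convergent in `L^{1/s}` for `s₁ + s₂ ≤ s` (Hölder + dominated convergence) — the form in which
  Lemma 2.5 is used factor by factor in Part 2.

## References

* Y. Liu, G. Slade, *Gaussian deconvolution and the lace expansion*, Probab. Theory Related
  Fields 195 (2024), arXiv:2310.07635: §1.1 (Assumption 1.1, (1.10), (1.12)), §1.4.2
  ((1.26)–(1.30)), §2.1 (Lemma 2.2 and its proof), §2.2.2 (Lemma 2.6), Appendix A
  (Definition A.1, Lemma A.4) [LiuSlade2024].
-/

noncomputable section

namespace Literature.Barriers.CriticalPhenomena.SpreadOutIsing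

open Filter UnitAddTorus Literature.Probability.LatticeModels Real
open Literature.Analysis.FunctionSpaces Literature.Analysis.FunctionSpaces.Torus
open _root_.MeasureTheory _root_.Topology
open scoped ENNReal

variable {d : ℕ}

local notation "𝕋" d => UnitAddTorus (Fin d)

namespace LiuSlade2024Prop24

/-! ### Classical calculus for smooth complex functions on the torus -/

/-- Products of smooth complex functions are smooth. [folklore] -/
theorem isSmooth_mul {f g : (𝕋 d) → ℂ} (hf : Torus.IsSmooth f) (hg : Torus.IsSmooth g) :
    Torus.IsSmooth (fun t => f t * g t) :=
  ContDiff.mul hf hg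

/-- Reciprocals of nonvanishing smooth complex functions are smooth. [folklore] -/
theorem isSmooth_inv {g : (𝕋 d) → ℂ} (hg : Torus.IsSmooth g) (h0 : ∀ t, g t ≠ 0) :
    Torus.IsSmooth (fun t => (g t)⁻¹) :=
  ContDiff.inv hg (fun _ => h0 _)

/-- Leibniz rule for `∂ⱼ` on smooth complex functions. [folklore] -/
theorem partialDeriv_mul {f g : (𝕋 d) → ℂ} (hf : Torus.IsSmooth f) (hg : Torus.IsSmooth g)
    (j : Fin d) (t : 𝕋 d) :
    Torus.partialDeriv j (fun s => f s * g s) t =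
      Torus.partialDeriv j f t * g t + f t * Torus.partialDeriv j g t := by
  have h := ((hf.hasDerivAt_line_zero j t).mul (hg.hasDerivAt_line_zero j t)).deriv
  simp only [zero_smul, proj_zero, add_zero] at h
  exact h

/-- Reciprocal rule for `∂ⱼ` on nonvanishing smooth complex functions. [folklore] -/
theorem partialDeriv_inv {g : (𝕋 d) → ℂ} (hg : Torus.IsSmooth g) (h0 : ∀ t, g t ≠ 0)
    (j : Fin d) (t : 𝕋 d) :
    Torus.partialDeriv j (fun s => (g s)⁻¹) t = -(Torus.partialDeriv j g t) / (g t) ^ 2 := by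
  have hl := hg.hasDerivAt_line_zero j t
  have e0 : t + proj ((0 : ℝ) • EuclideanSpace.single j (1 : ℝ)) = t := by simp [proj_zero]
  have hinv : HasDerivAt (fun y : ℂ => y⁻¹) (-(g t ^ 2)⁻¹)
      (g (t + proj ((0 : ℝ) • EuclideanSpace.single j (1 : ℝ)))) := by
    rw [e0]; exact hasDerivAt_inv (h0 t)
  have h := (hinv.comp (0 : ℝ) hl).deriv
  rw [Torus.partialDeriv, Torus.lineDeriv]
  rw [show (fun s : ℝ => (g (t + proj (s • EuclideanSpace.single j (1 : ℝ))))⁻¹) =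
    (fun y : ℂ => y⁻¹) ∘ (fun s : ℝ => g (t + proj (s • EuclideanSpace.single j (1 : ℝ)))) from rfl, h]
  field_simp


/-! ### Scalar trigonometric polynomials: sup and `L^q` bounds -/

/-- `|Σ_{k∈S} e_k(t) c_k| ≤ Σ_{k∈S} |c_k|`. [folklore] -/
theorem norm_trigPoly_le (S : Finset (Site d)) (c : Site d → ℂ) (t : 𝕋 d) :
    ‖trigPoly S c t‖ ≤ ∑ k ∈ S, ‖c k‖ := by
  rw [trigPoly_apply]
  refine (norm_sum_le _ _).trans (Finset.sum_le_sum fun k _ => ?_)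
  rw [norm_smul, norm_mFourier_apply k t, one_mul]

/-- `L^q` bound for a scalar trigonometric polynomial from its sup and `L²` norms (`q ≥ 2`):
`‖T‖_q ≤ ((Σ|c_k|)^{q-2} Σ|c_k|²)^{1/q}`. [folklore] -/
theorem eLpNorm_trigPoly_le (S : Finset (Site d)) (c : Site d → ℂ) {q : ℝ} (hq : 2 ≤ q) :
    eLpNorm (trigPoly S c) (ENNReal.ofReal q) volume ≤
      ENNReal.ofReal (((∑ k ∈ S, ‖c k‖) ^ (q - 2) * ∑ k ∈ S, ‖c k‖ ^ 2) ^ (1 / q)) := by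
  set M : ℝ := ∑ k ∈ S, ‖c k‖ with hM
  set S2 : ℝ := ∑ k ∈ S, ‖c k‖ ^ 2 with hS2
  have hq0 : 0 < q := by linarith
  have hM0 : 0 ≤ M := Finset.sum_nonneg fun k _ => norm_nonneg _
  have hS20 : 0 ≤ S2 := Finset.sum_nonneg fun k _ => sq_nonneg _
  have hp0 : ENNReal.ofReal q ≠ 0 := by simpa using hq0
  have hpt : ENNReal.ofReal q ≠ ∞ := ENNReal.ofReal_ne_top
  have htr : (ENNReal.ofReal q).toReal = q := ENNReal.toReal_ofReal hq0.le
  rw [eLpNorm_eq_lintegral_rpow_enorm_toReal hp0 hpt, htr]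
  -- pointwise bound `‖T t‖^q ≤ M^{q-2} ‖T t‖²`
  have hpt' : ∀ t, ‖trigPoly S c t‖ₑ ^ q ≤ ENNReal.ofReal (M ^ (q - 2) * ‖trigPoly S c t‖ ^ 2) := by
    intro t
    have hn : 0 ≤ ‖trigPoly S c t‖ := norm_nonneg _
    rw [← ofReal_norm, ENNReal.ofReal_rpow_of_nonneg hn hq0.le]
    refine ENNReal.ofReal_le_ofReal ?_
    have hle : ‖trigPoly S c t‖ ≤ M := norm_trigPoly_le S c t
    calc ‖trigPoly S c t‖ ^ q = ‖trigPoly S c t‖ ^ (q - 2) * ‖trigPoly S c t‖ ^ (2 : ℝ) := by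
          rw [← Real.rpow_add' hn (by linarith)]; ring_nf
      _ ≤ M ^ (q - 2) * ‖trigPoly S c t‖ ^ (2 : ℝ) := by
          gcongr
      _ = M ^ (q - 2) * ‖trigPoly S c t‖ ^ 2 := by norm_cast
  have hint : Integrable (fun t => M ^ (q - 2) * ‖trigPoly S c t‖ ^ 2) volume :=
    ((continuous_trigPoly S c).norm.pow 2).integrable_unitAddTorus.const_mul _
  have hnn : 0 ≤ᵐ[volume] fun t => M ^ (q - 2) * ‖trigPoly S c t‖ ^ 2 :=
    ae_of_all _ fun t => by positivity
  calc (∫⁻ t, ‖trigPoly S c t‖ₑ ^ q) ^ (1 / q)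
      ≤ (∫⁻ t, ENNReal.ofReal (M ^ (q - 2) * ‖trigPoly S c t‖ ^ 2)) ^ (1 / q) := by
        gcongr
        exact hpt' _
    _ = (ENNReal.ofReal (M ^ (q - 2) * S2)) ^ (1 / q) := by
        rw [← ofReal_integral_eq_lintegral_ofReal hint hnn, integral_const_mul,
          integral_norm_sq_trigPoly]
    _ = ENNReal.ofReal ((M ^ (q - 2) * S2) ^ (1 / q)) := by
        rw [ENNReal.ofReal_rpow_of_nonneg (by positivity) (by positivity)]

/-! ### Boxes (the tree's `LatticeModels.box d m = {-m,…,m}^d`) and dyadic shells in `ℤ^d` -/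

/-- Membership in the box through `|xᵢ| ≤ m`. [folklore] -/
theorem mem_box_iff_abs {m : ℕ} {x : Site d} : x ∈ box d m ↔ ∀ i, |x i| ≤ m := by
  simp [mem_box, abs_le]

/-- Every finite set of sites lies in some box; the boxes exhaust `ℤ^d`. [folklore] -/
theorem tendsto_box_atTop : Tendsto (box d) atTop atTop := by
  refine Monotone.tendsto_atTop_atTop (box_mono d) fun s => ?_
  classical
  have : ∀ x : Site d, ∃ m : ℕ, x ∈ box d m := fun x => by
    refine ⟨Finset.univ.sup fun i => (x i).natAbs, mem_box_iff_abs.2 fun i => ?_⟩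
    have h : (x i).natAbs ≤ Finset.univ.sup fun i => (x i).natAbs :=
      Finset.le_sup (f := fun i => (x i).natAbs) (Finset.mem_univ i)
    calc |x i| = ((x i).natAbs : ℤ) := (Int.natCast_natAbs (x i)).symm
      _ ≤ _ := by exact_mod_cast h
  choose m hm using this
  exact ⟨s.sup m, fun x hx => box_mono d (Finset.le_sup hx) (hm x)⟩

/-- Off the box of size `m`, `|x| ≥ m + 1`. [folklore] -/
theorem lt_euclidNorm_of_not_mem_box {m : ℕ} {x : Site d} (hx : x ∉ box d m) :
    (m : ℝ) + 1 ≤ euclidNorm x := by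
  rw [mem_box_iff_abs, not_forall] at hx
  obtain ⟨i, hi⟩ := hx
  rw [not_le] at hi
  have h1 : (m : ℤ) + 1 ≤ |x i| := hi
  have h2 : (m : ℝ) + 1 ≤ |(x i : ℝ)| := by
    rw [← Int.cast_abs]; exact_mod_cast h1
  exact h2.trans (abs_apply_le_euclidNorm x i)

/-- The dyadic shell `box (2^{n+1}) \ box (2^n)`. [folklore] -/
def shell (d n : ℕ) : Finset (Site d) := box d (2 ^ (n + 1)) \ box d (2 ^ n)

/-- `{‖x‖_∞ ≤ 2^{n+1}}` is `{‖x‖_∞ ≤ 2^n}` together with the `n`-th dyadic shell. [folklore] -/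
theorem box_pow_succ (n : ℕ) : box d (2 ^ (n + 1)) = box d (2 ^ n) ∪ shell d n := by
  rw [shell, Finset.union_sdiff_of_subset (box_mono d (Nat.pow_le_pow_right two_pos n.le_succ))]

/-- The `n`-th dyadic shell is disjoint from `{‖x‖_∞ ≤ 2^n}`. [folklore] -/
theorem disjoint_box_shell (n : ℕ) : Disjoint (box d (2 ^ n)) (shell d n) :=
  Finset.disjoint_sdiff

/-- The `n`-th dyadic shell has at most `8^d 2^{nd}` points. [folklore] -/
theorem card_shell_le (n : ℕ) : ((shell d n).card : ℝ) ≤ 8 ^ d * 2 ^ (n * d) := by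
  have h1 : (shell d n).card ≤ (box d (2 ^ (n + 1))).card := Finset.card_le_card Finset.sdiff_subset
  rw [card_box] at h1
  have h2 : (2 * 2 ^ (n + 1) + 1 : ℕ) ≤ 8 * 2 ^ n := by
    have : 0 < 2 ^ n := Nat.two_pow_pos n
    rw [pow_succ]; omega
  calc ((shell d n).card : ℝ) ≤ ((2 * 2 ^ (n + 1) + 1) ^ d : ℕ) := by exact_mod_cast h1
    _ ≤ ((8 * 2 ^ n) ^ d : ℕ) := by exact_mod_cast Nat.pow_le_pow_left h2 d
    _ = 8 ^ d * 2 ^ (n * d) := by push_cast; rw [mul_pow, ← pow_mul]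

/-- On the `n`-th dyadic shell, `|x| ≥ ‖x‖_∞ ≥ 2^n + 1`. [folklore] -/
theorem le_euclidNorm_of_mem_shell {n : ℕ} {x : Site d} (hx : x ∈ shell d n) :
    (2 : ℝ) ^ n + 1 ≤ euclidNorm x := by
  have h := lt_euclidNorm_of_not_mem_box (Finset.mem_sdiff.1 hx).2
  exact_mod_cast h

/-- Splitting a partial sum over `{‖x‖_∞ ≤ 2^{n+1}}` into the previous box and the shell. [folklore] -/
theorem trigPoly_box_pow_succ (c : Site d → ℂ) (n : ℕ) :
    trigPoly (box d (2 ^ (n + 1))) c = trigPoly (box d (2 ^ n)) c + trigPoly (shell d n) c := by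
  funext t
  simp only [trigPoly_apply, Pi.add_apply]
  rw [box_pow_succ, Finset.sum_union (disjoint_box_shell n)]

/-- The dyadic partial sum is the unit box plus the sum of the shells. [folklore] -/
theorem trigPoly_box_pow_eq_add_sum (c : Site d → ℂ) (N : ℕ) :
    trigPoly (box d (2 ^ N)) c = trigPoly (box d 1) c + ∑ n ∈ Finset.range N, trigPoly (shell d n) c := by
  induction N with
  | zero => simp
  | succ N ih => rw [trigPoly_box_pow_succ, ih, Finset.sum_range_succ, add_assoc]

/-- `L^q` bound for a trigonometric polynomial with at most `n₀`... coefficients each of size `≤ ε₀`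
(`q ≥ 2`): `‖T‖_q ≤ (#S)^{1-1/q} ε₀`. [folklore] -/
theorem eLpNorm_trigPoly_le_card (S : Finset (Site d)) (c : Site d → ℂ) {ε₀ : ℝ} (hε : 0 ≤ ε₀)
    (hc : ∀ k ∈ S, ‖c k‖ ≤ ε₀) {q : ℝ} (hq : 2 ≤ q) :
    eLpNorm (trigPoly S c) (ENNReal.ofReal q) volume ≤
      ENNReal.ofReal ((S.card : ℝ) ^ (1 - 1 / q) * ε₀) := by
  refine (eLpNorm_trigPoly_le S c hq).trans (ENNReal.ofReal_le_ofReal ?_)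
  have hq0 : 0 < q := by linarith
  have h1 : ∑ k ∈ S, ‖c k‖ ≤ S.card * ε₀ := by
    calc ∑ k ∈ S, ‖c k‖ ≤ ∑ _k ∈ S, ε₀ := Finset.sum_le_sum hc
      _ = S.card * ε₀ := by rw [Finset.sum_const, nsmul_eq_mul]
  have h2 : ∑ k ∈ S, ‖c k‖ ^ 2 ≤ S.card * ε₀ ^ 2 := by
    calc ∑ k ∈ S, ‖c k‖ ^ 2 ≤ ∑ _k ∈ S, ε₀ ^ 2 :=
          Finset.sum_le_sum fun k hk => pow_le_pow_left₀ (norm_nonneg _) (hc k hk) 2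
      _ = S.card * ε₀ ^ 2 := by rw [Finset.sum_const, nsmul_eq_mul]
  have hM0 : 0 ≤ ∑ k ∈ S, ‖c k‖ := Finset.sum_nonneg fun k _ => norm_nonneg _
  have hcard : (0 : ℝ) ≤ S.card := Nat.cast_nonneg _
  calc ((∑ k ∈ S, ‖c k‖) ^ (q - 2) * ∑ k ∈ S, ‖c k‖ ^ 2) ^ (1 / q)
      ≤ ((S.card * ε₀) ^ (q - 2) * (S.card * ε₀ ^ 2)) ^ (1 / q) := by
        refine Real.rpow_le_rpow (by positivity) ?_ (by positivity)
        gcongr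
    _ = (S.card : ℝ) ^ (1 - 1 / q) * ε₀ := by
        have e1 : (S.card * ε₀ : ℝ) ^ (q - 2) * (S.card * ε₀ ^ 2) =
            (S.card : ℝ) ^ (q - 1) * ε₀ ^ q := by
          rw [Real.mul_rpow hcard hε]
          have h3 : (S.card : ℝ) ^ (q - 2) * S.card = (S.card : ℝ) ^ (q - 1) := by
            rw [← Real.rpow_add_one' hcard (by linarith)]; ring_nf
          have h4 : ε₀ ^ (q - 2) * ε₀ ^ 2 = ε₀ ^ q := by
            rw [← Real.rpow_natCast, ← Real.rpow_add' hε (by push_cast; linarith)]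
            push_cast; ring_nf
          calc (S.card : ℝ) ^ (q - 2) * ε₀ ^ (q - 2) * (S.card * ε₀ ^ 2)
              = ((S.card : ℝ) ^ (q - 2) * S.card) * (ε₀ ^ (q - 2) * ε₀ ^ 2) := by ring
            _ = _ := by rw [h3, h4]
        rw [e1, Real.mul_rpow (by positivity) (by positivity), ← Real.rpow_mul hcard,
          ← Real.rpow_mul hε]
        have h5 : (q - 1) * (1 / q) = 1 - 1 / q := by field_simp
        have h6 : q * (1 / q) = 1 := by field_simp
        rw [h5, h6, Real.rpow_one]

/-- On the `n`-th dyadic shell a `K⟦x⟧^{-b}`-decaying family is `≤ K 2^{-nb}`. [folklore] -/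
theorem norm_le_of_mem_shell {c : Site d → ℂ} {K b : ℝ} (hc : ∀ x, ‖c x‖ ≤ K / jnorm x ^ b)
    (hb : 0 ≤ b) {n : ℕ} {x : Site d} (hx : x ∈ shell d n) :
    ‖c x‖ ≤ K * (2 : ℝ) ^ (-(n * b)) := by
  have hK : 0 ≤ K := by
    have h := (norm_nonneg _).trans (hc 0)
    simpa [jnorm, euclidNorm] using h
  have h2n : (2 : ℝ) ^ n ≤ jnorm x :=
    le_trans (by linarith [le_euclidNorm_of_mem_shell hx]) (euclidNorm_le_jnorm x)
  have hpos : (0 : ℝ) < (2 : ℝ) ^ n := by positivity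
  calc ‖c x‖ ≤ K / jnorm x ^ b := hc x
    _ ≤ K / ((2 : ℝ) ^ n) ^ b := by
        gcongr
    _ = K * (2 : ℝ) ^ (-(n * b)) := by
        rw [← Real.rpow_natCast, ← Real.rpow_mul (by norm_num), Real.rpow_neg (by norm_num),
          div_eq_mul_inv]

/-- **Shell estimate**: for `‖c x‖ ≤ K⟦x⟧^{-b}` and `q ≥ 2`, the trigonometric polynomial over the
`n`-th dyadic shell has `‖·‖_q ≤ 8^d K 2^{-nθ}`, `θ = d/q - (d - b)`. [cite: LiuSlade2024, Lemma 2.6 (proof, via Hausdorff–Young); here by interpolating sup and L² bounds] -/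
theorem eLpNorm_trigPoly_shell_le {c : Site d → ℂ} {K b : ℝ} (hc : ∀ x, ‖c x‖ ≤ K / jnorm x ^ b)
    (hb : 0 ≤ b) {q : ℝ} (hq : 2 ≤ q) (n : ℕ) :
    eLpNorm (trigPoly (shell d n) c) (ENNReal.ofReal q) volume ≤
      ENNReal.ofReal (8 ^ d * K * (2 : ℝ) ^ (-(n * (d / q - (d - b))))) := by
  have hK : 0 ≤ K := by
    have h := (norm_nonneg _).trans (hc 0)
    simpa [jnorm, euclidNorm] using h
  have hq0 : 0 < q := by linarith
  have h1q : 0 ≤ 1 - 1 / q := by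
    rw [sub_nonneg, div_le_one hq0]; linarith
  refine (eLpNorm_trigPoly_le_card (shell d n) c (by positivity)
    (fun k hk => norm_le_of_mem_shell hc hb hk) hq).trans (ENNReal.ofReal_le_ofReal ?_)
  calc ((shell d n).card : ℝ) ^ (1 - 1 / q) * (K * (2 : ℝ) ^ (-(n * b)))
      ≤ (8 ^ d * 2 ^ (n * d) : ℝ) ^ (1 - 1 / q) * (K * (2 : ℝ) ^ (-(n * b))) := by
        gcongr
        exact card_shell_le n
    _ ≤ (8 ^ d * (2 ^ (n * d) : ℝ) ^ (1 - 1 / q)) * (K * (2 : ℝ) ^ (-(n * b))) := by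
        gcongr
        rw [Real.mul_rpow (by positivity) (by positivity)]
        gcongr
        · calc (8 ^ d : ℝ) ^ (1 - 1 / q) ≤ (8 ^ d : ℝ) ^ (1 : ℝ) :=
              Real.rpow_le_rpow_of_exponent_le (one_le_pow₀ (by norm_num)) (by linarith [one_div_pos.2 hq0])
            _ = 8 ^ d := Real.rpow_one _
    _ = 8 ^ d * K * (2 : ℝ) ^ (-(n * (d / q - (d - b)))) := by
        rw [← Real.rpow_natCast (2 : ℝ) (n * d), ← Real.rpow_mul (by norm_num)]
        have e : (2 : ℝ) ^ ((n * d : ℕ) * (1 - 1 / q)) * (2 : ℝ) ^ (-(n * b : ℝ)) =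
            (2 : ℝ) ^ (-(n * (d / q - (d - b)))) := by
          rw [← Real.rpow_add (by norm_num)]
          congr 1
          push_cast
          ring
        calc 8 ^ d * (2 : ℝ) ^ ((n * d : ℕ) * (1 - 1 / q)) * (K * (2 : ℝ) ^ (-(n * b : ℝ)))
            = 8 ^ d * K * ((2 : ℝ) ^ ((n * d : ℕ) * (1 - 1 / q)) * (2 : ℝ) ^ (-(n * b : ℝ))) := by ring
          _ = _ := by rw [e]

/-! ### The `L^q` limit of the dyadic partial sums (Liu–Slade 2024, Lemma 2.6 (ii) / Lemma A.4) -/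

/-- Dyadic partial sums `P_N = Σ_{‖x‖∞ ≤ 2^N} e_x c_x`. [folklore] -/
def dyadicSum (c : Site d → ℂ) (N : ℕ) : (𝕋 d) → ℂ := trigPoly (box d (2 ^ N)) c

/-- The (a.e. and `L^q`) limit of the dyadic partial sums: `ĉ = lim_N P_N` (pointwise `limUnder`,
which is the limit wherever the sequence converges — almost everywhere under the decay hypotheses
below, everywhere for summable `c`). [cite: LiuSlade2024, Appendix A, Lemma A.4 (the L² Fourier transform 𝓕[(ix)^α f])] -/
def dFT (c : Site d → ℂ) (t : 𝕋 d) : ℂ := limUnder atTop fun N => dyadicSum c N t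

/-- `P_N = P_{box 1} + Σ_{n<N} P_{shell n}`. [folklore] -/
theorem dyadicSum_eq_add_sum (c : Site d → ℂ) (N : ℕ) :
    dyadicSum c N = trigPoly (box d 1) c + ∑ n ∈ Finset.range N, trigPoly (shell d n) c :=
  trigPoly_box_pow_eq_add_sum c N

/-- Dyadic partial sums are continuous. [folklore] -/
theorem continuous_dyadicSum (c : Site d → ℂ) (N : ℕ) : Continuous (dyadicSum c N) :=
  continuous_trigPoly _ _

/-- The dyadic limit `ĉ` is (strongly) measurable, as a pointwise `limUnder`. [folklore] -/
theorem stronglyMeasurable_dFT (c : Site d → ℂ) : StronglyMeasurable (dFT c) :=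
  StronglyMeasurable.limUnder fun N => (continuous_dyadicSum c N).stronglyMeasurable

/-- `P_{N'} - P_N` is the sum of the shells `N ≤ n < N'`. [folklore] -/
theorem dyadicSum_sub_dyadicSum (c : Site d → ℂ) {N N' : ℕ} (h : N ≤ N') :
    dyadicSum c N' - dyadicSum c N = ∑ n ∈ Finset.Ico N N', trigPoly (shell d n) c := by
  rw [dyadicSum_eq_add_sum, dyadicSum_eq_add_sum, add_sub_add_left_eq_sub, Finset.sum_Ico_eq_sub _ h]

/-- `2^{-nθ} = (2^{-θ})^n`. [folklore] -/
theorem two_rpow_neg_mul (n : ℕ) (θ : ℝ) : (2 : ℝ) ^ (-(n * θ)) = ((2 : ℝ) ^ (-θ)) ^ n := by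
  rw [← Real.rpow_natCast ((2 : ℝ) ^ (-θ)) n, ← Real.rpow_mul (by norm_num)]; ring_nf

/-- Geometric tail: `Σ_{N ≤ n < N'} 2^{-nθ} ≤ 2^{-Nθ}/(1 - 2^{-θ})`. [folklore] -/
theorem sum_Ico_two_rpow_neg_le {θ : ℝ} (hθ : 0 < θ) (N N' : ℕ) :
    ∑ n ∈ Finset.Ico N N', (2 : ℝ) ^ (-(n * θ)) ≤ (2 : ℝ) ^ (-(N * θ)) / (1 - (2 : ℝ) ^ (-θ)) := by
  have hr0 : 0 ≤ (2 : ℝ) ^ (-θ) := by positivity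
  have hr1 : (2 : ℝ) ^ (-θ) < 1 := Real.rpow_lt_one_of_one_lt_of_neg (by norm_num) (by linarith)
  simp_rw [two_rpow_neg_mul]
  rw [Finset.sum_Ico_eq_sum_range]
  simp_rw [pow_add]
  rw [← Finset.mul_sum, div_eq_mul_inv]
  refine mul_le_mul_of_nonneg_left ?_ (by positivity)
  rw [← tsum_geometric_of_lt_one hr0 hr1]
  exact (summable_geometric_of_lt_one hr0 hr1).sum_le_tsum _ (fun n _ => by positivity)

/-- `L^q`-Cauchy estimate for the dyadic partial sums. [cite: LiuSlade2024, Lemma 2.6 (ii)] -/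
theorem eLpNorm_dyadicSum_sub_le {c : Site d → ℂ} {K b : ℝ} (hc : ∀ x, ‖c x‖ ≤ K / jnorm x ^ b)
    (hb : 0 ≤ b) {q : ℝ} (hq : 2 ≤ q) (hθ : 0 < d / q - (d - b)) {N N' : ℕ} (h : N ≤ N') :
    eLpNorm (dyadicSum c N' - dyadicSum c N) (ENNReal.ofReal q) volume ≤
      ENNReal.ofReal (8 ^ d * K * (2 : ℝ) ^ (-(N * (d / q - (d - b)))) / (1 - (2 : ℝ) ^ (-(d / q - (d - b))))) := by
  have hK : 0 ≤ K := by
    have h := (norm_nonneg _).trans (hc 0)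
    simpa [jnorm, euclidNorm] using h
  have hq1 : (1 : ℝ≥0∞) ≤ ENNReal.ofReal q := by
    rw [← ENNReal.ofReal_one]; exact ENNReal.ofReal_le_ofReal (by linarith)
  rw [dyadicSum_sub_dyadicSum c h]
  refine (eLpNorm_sum_le (fun n _ => (continuous_trigPoly _ _).aestronglyMeasurable) hq1).trans ?_
  refine (Finset.sum_le_sum fun n _ => eLpNorm_trigPoly_shell_le hc hb hq n).trans ?_
  rw [← ENNReal.ofReal_sum_of_nonneg (fun n _ => by positivity)]
  refine ENNReal.ofReal_le_ofReal ?_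
  rw [← Finset.mul_sum, mul_div_assoc]
  exact mul_le_mul_of_nonneg_left (sum_Ico_two_rpow_neg_le hθ N N') (by positivity)

/-- The dyadic partial sums converge almost everywhere (indeed `Σ_n |shell_n(t)| < ∞` a.e., since
`Σ_n ‖shell_n‖₁ ≤ Σ_n ‖shell_n‖₂ < ∞` for `b > d/2`). [cite: LiuSlade2024, Lemma 2.6 (ii)] -/
theorem ae_tendsto_dyadicSum {c : Site d → ℂ} {K b : ℝ} (hc : ∀ x, ‖c x‖ ≤ K / jnorm x ^ b)
    (hb : (d : ℝ) / 2 < b) :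
    ∀ᵐ t ∂volume, Tendsto (fun N => dyadicSum c N t) atTop (𝓝 (dFT c t)) := by
  have hb0 : 0 ≤ b := le_trans (by positivity) hb.le
  have hK : 0 ≤ K := by
    have h := (norm_nonneg _).trans (hc 0)
    simpa [jnorm, euclidNorm] using h
  set θ : ℝ := d / 2 - (d - b) with hθ
  have hθ0 : 0 < θ := by rw [hθ]; linarith
  -- `∫⁻ Σ_n ‖shell_n‖ₑ < ∞`
  set g : ℕ → (𝕋 d) → ℂ := fun n => trigPoly (shell d n) c with hg
  have hgm : ∀ n, AEStronglyMeasurable (g n) volume := fun n => (continuous_trigPoly _ _).aestronglyMeasurable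
  have h1 : ∀ n, ∫⁻ t, ‖g n t‖ₑ ≤ ENNReal.ofReal (8 ^ d * K * (2 : ℝ) ^ (-(n * θ))) := by
    intro n
    rw [← eLpNorm_one_eq_lintegral_enorm]
    calc eLpNorm (g n) 1 volume ≤ eLpNorm (g n) (ENNReal.ofReal 2) volume :=
          eLpNorm_le_eLpNorm_of_exponent_le (by rw [← ENNReal.ofReal_one]; exact ENNReal.ofReal_le_ofReal one_le_two) (hgm n)
      _ ≤ _ := eLpNorm_trigPoly_shell_le hc hb0 le_rfl n
  have h2 : ∫⁻ t, ∑' n, ‖g n t‖ₑ ≠ ∞ := by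
    rw [lintegral_tsum fun n => (hgm n).enorm]
    refine ne_top_of_le_ne_top (b := ∑' n : ℕ, ENNReal.ofReal (8 ^ d * K * (2 : ℝ) ^ (-((n : ℝ) * θ)))) ?_
      (ENNReal.tsum_le_tsum h1)
    rw [← ENNReal.ofReal_tsum_of_nonneg (fun n => by positivity)]
    · exact ENNReal.ofReal_ne_top
    · simp_rw [two_rpow_neg_mul]
      refine Summable.mul_left _ (summable_geometric_of_lt_one (by positivity) ?_)
      exact Real.rpow_lt_one_of_one_lt_of_neg (by norm_num) (by linarith)
  have h3 : ∀ᵐ t ∂volume, ∑' n, ‖g n t‖ₑ < ∞ :=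
    ae_lt_top' (AEMeasurable.tsum fun n => (hgm n).enorm) h2
  filter_upwards [h3] with t ht
  -- at such `t` the shell series converges absolutely
  have hs : Summable fun n => g n t := by
    refine Summable.of_norm ?_
    have : Summable fun n => ‖g n t‖₊ := by
      rw [← ENNReal.tsum_coe_ne_top_iff_summable]
      simpa only [enorm_eq_nnnorm] using ht.ne
    simpa only [coe_nnnorm] using NNReal.summable_coe.2 this
  refine tendsto_nhds_limUnder ⟨trigPoly (box d 1) c t + ∑' n, g n t, ?_⟩
  have e : ∀ N, dyadicSum c N t = trigPoly (box d 1) c t + ∑ n ∈ Finset.range N, g n t := by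
    intro N
    rw [dyadicSum_eq_add_sum]
    simp [Finset.sum_apply, hg]
  simp_rw [e]
  exact (hs.hasSum.tendsto_sum_nat).const_add _

/-- **`L^q` convergence of the dyadic partial sums** (`q ≥ 2`, `θ = d/q - (d-b) > 0`):
`‖ĉ - P_N‖_q ≤ 8^d K 2^{-Nθ}/(1 - 2^{-θ})`. [cite: LiuSlade2024, Lemma 2.6 (ii)] -/
theorem eLpNorm_dFT_sub_dyadicSum_le {c : Site d → ℂ} {K b : ℝ} (hc : ∀ x, ‖c x‖ ≤ K / jnorm x ^ b)
    (hb : (d : ℝ) / 2 < b) {q : ℝ} (hq : 2 ≤ q) (hθ : 0 < d / q - (d - b)) (N : ℕ) :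
    eLpNorm (dFT c - dyadicSum c N) (ENNReal.ofReal q) volume ≤
      ENNReal.ofReal (8 ^ d * K * (2 : ℝ) ^ (-(N * (d / q - (d - b)))) / (1 - (2 : ℝ) ^ (-(d / q - (d - b))))) := by
  have hb0 : 0 ≤ b := le_trans (by positivity) hb.le
  refine Lp.eLpNorm_le_of_ae_tendsto (u := atTop) (f := fun N' => dyadicSum c N' - dyadicSum c N)
    ?_ (fun N' => ((continuous_dyadicSum c N').sub (continuous_dyadicSum c N)).aestronglyMeasurable) ?_
  · filter_upwards [eventually_ge_atTop N] with N' hN'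
    exact eLpNorm_dyadicSum_sub_le hc hb0 hq hθ hN'
  · filter_upwards [ae_tendsto_dyadicSum hc hb] with t ht
    exact ht.sub_const _

/-- The limit is in `L^q` with an explicit bound: `‖ĉ‖_q ≤ 3^d K + 8^d K/(1 - 2^{-θ})`.
[cite: LiuSlade2024, Lemma 2.6 (ii) (‖ĥ‖_q ≤ c_{d,b,q} K)] -/
theorem eLpNorm_dFT_le {c : Site d → ℂ} {K b : ℝ} (hc : ∀ x, ‖c x‖ ≤ K / jnorm x ^ b)
    (hb : (d : ℝ) / 2 < b) {q : ℝ} (hq : 2 ≤ q) (hθ : 0 < d / q - (d - b)) :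
    eLpNorm (dFT c) (ENNReal.ofReal q) volume ≤
      ENNReal.ofReal (3 ^ d * K + 8 ^ d * K / (1 - (2 : ℝ) ^ (-(d / q - (d - b))))) := by
  have hK : 0 ≤ K := by
    have h := (norm_nonneg _).trans (hc 0)
    simpa [jnorm, euclidNorm] using h
  have hb0 : 0 ≤ b := le_trans (by positivity) hb.le
  have hq1 : (1 : ℝ≥0∞) ≤ ENNReal.ofReal q := by
    rw [← ENNReal.ofReal_one]; exact ENNReal.ofReal_le_ofReal (by linarith)
  have hr1 : (2 : ℝ) ^ (-(d / q - (d - b))) < 1 :=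
    Real.rpow_lt_one_of_one_lt_of_neg (by norm_num) (by linarith)
  have hsplit : dFT c = (dFT c - dyadicSum c 0) + dyadicSum c 0 := by abel
  rw [hsplit]
  refine (eLpNorm_add_le ((stronglyMeasurable_dFT c).aestronglyMeasurable.sub
    (continuous_dyadicSum c 0).aestronglyMeasurable) (continuous_dyadicSum c 0).aestronglyMeasurable hq1).trans ?_
  have h1 := eLpNorm_dFT_sub_dyadicSum_le hc hb hq hθ 0
  simp only [Nat.cast_zero, zero_mul, neg_zero, Real.rpow_zero, mul_one] at h1
  -- the first box: sup bound `Σ_{box 1} |c| ≤ 3^d K`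
  have h2 : eLpNorm (dyadicSum c 0) (ENNReal.ofReal q) volume ≤ ENNReal.ofReal (3 ^ d * K) := by
    have hbound : ∀ t, ‖dyadicSum c 0 t‖ ≤ 3 ^ d * K := by
      intro t
      refine (norm_trigPoly_le _ _ t).trans ?_
      calc ∑ k ∈ box d (2 ^ 0), ‖c k‖ ≤ ∑ _k ∈ box d (2 ^ 0), K := Finset.sum_le_sum fun k _ => by
              calc ‖c k‖ ≤ K / jnorm k ^ b := hc k
                _ ≤ K / 1 := by
                    gcongr
                    exact Real.one_le_rpow (one_le_jnorm k) hb0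
                _ = K := div_one K
        _ = 3 ^ d * K := by
            rw [Finset.sum_const, nsmul_eq_mul, card_box]; norm_num
    refine (eLpNorm_le_of_ae_bound (C := 3 ^ d * K) (ae_of_all _ hbound)).trans ?_
    simp
  calc eLpNorm (dFT c - dyadicSum c 0) (ENNReal.ofReal q) volume + eLpNorm (dyadicSum c 0) (ENNReal.ofReal q) volume
      ≤ ENNReal.ofReal (8 ^ d * K / (1 - (2 : ℝ) ^ (-(d / q - (d - b))))) + ENNReal.ofReal (3 ^ d * K) :=
        add_le_add h1 h2
    _ = _ := by
        rw [← ENNReal.ofReal_add (div_nonneg (by positivity) (by linarith)) (by positivity), add_comm]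

/-- `ĉ ∈ L^q`. [cite: LiuSlade2024, Lemma 2.6 (ii)] -/
theorem memLp_dFT {c : Site d → ℂ} {K b : ℝ} (hc : ∀ x, ‖c x‖ ≤ K / jnorm x ^ b)
    (hb : (d : ℝ) / 2 < b) {q : ℝ} (hq : 2 ≤ q) (hθ : 0 < d / q - (d - b)) :
    MemLp (dFT c) (ENNReal.ofReal q) volume :=
  ⟨(stronglyMeasurable_dFT c).aestronglyMeasurable,
    (eLpNorm_dFT_le hc hb hq hθ).trans_lt ENNReal.ofReal_lt_top⟩

/-- `P_N → ĉ` in `L^q`. [cite: LiuSlade2024, Lemma 2.6 (ii)] -/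
theorem tendsto_eLpNorm_dFT_sub_dyadicSum {c : Site d → ℂ} {K b : ℝ} (hc : ∀ x, ‖c x‖ ≤ K / jnorm x ^ b)
    (hb : (d : ℝ) / 2 < b) {q : ℝ} (hq : 2 ≤ q) (hθ : 0 < d / q - (d - b)) :
    Tendsto (fun N => eLpNorm (dFT c - dyadicSum c N) (ENNReal.ofReal q) volume) atTop (𝓝 0) := by
  have hK : 0 ≤ K := by
    have h := (norm_nonneg _).trans (hc 0)
    simpa [jnorm, euclidNorm] using h
  set θ := d / q - (d - b) with hθdef
  have hr1 : (2 : ℝ) ^ (-θ) < 1 := Real.rpow_lt_one_of_one_lt_of_neg (by norm_num) (by linarith)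
  have hlim : Tendsto (fun N : ℕ => ENNReal.ofReal (8 ^ d * K * (2 : ℝ) ^ (-(N * θ)) / (1 - (2 : ℝ) ^ (-θ))))
      atTop (𝓝 0) := by
    rw [← ENNReal.ofReal_zero]
    refine ENNReal.tendsto_ofReal ?_
    have e : ∀ N : ℕ, 8 ^ d * K * (2 : ℝ) ^ (-(N * θ)) / (1 - (2 : ℝ) ^ (-θ)) =
        (8 ^ d * K / (1 - (2 : ℝ) ^ (-θ))) * ((2 : ℝ) ^ (-θ)) ^ N := fun N => by
      rw [two_rpow_neg_mul]; ring
    simp_rw [e]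
    rw [← mul_zero (8 ^ d * K / (1 - (2 : ℝ) ^ (-θ)))]
    exact (tendsto_pow_atTop_nhds_zero_of_lt_one (by positivity) hr1).const_mul _
  refine tendsto_of_tendsto_of_tendsto_of_le_of_le tendsto_const_nhds hlim (fun _ => bot_le) fun N => ?_
  exact eLpNorm_dFT_sub_dyadicSum_le hc hb hq hθ N

/-- For an absolutely summable family the limit is the sum of the Fourier series, everywhere.
[folklore] -/
theorem dFT_eq_tsum {c : Site d → ℂ} (hc : Summable fun x => ‖c x‖) (t : 𝕋 d) :
    dFT c t = ∑' x, mFourier x t * c x := by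
  have hs : Summable fun x => mFourier x t * c x :=
    Summable.of_norm (hc.congr fun x => by rw [norm_mul, norm_mFourier_apply, one_mul])
  have h2 : Tendsto (fun N : ℕ => box d (2 ^ N)) atTop atTop :=
    tendsto_box_atTop.comp (tendsto_pow_atTop_atTop_of_one_lt one_lt_two)
  have h3 : Tendsto (fun N => dyadicSum c N t) atTop (𝓝 (∑' x, mFourier x t * c x)) := by
    have := hs.hasSum.comp h2
    simpa only [dyadicSum, trigPoly_apply, smul_eq_mul, Function.comp_def] using this
  exact h3.limUnder_eq

/-- Sup bound in the summable case: `|ĉ(t)| ≤ Σ_x |c_x|`. [cite: LiuSlade2024, Lemma 2.6 (i)] -/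
theorem norm_dFT_le_tsum {c : Site d → ℂ} (hc : Summable fun x => ‖c x‖) (t : 𝕋 d) :
    ‖dFT c t‖ ≤ ∑' x, ‖c x‖ := by
  rw [dFT_eq_tsum hc t]
  refine (norm_tsum_le_tsum_norm ?_).trans (le_of_eq (tsum_congr fun x => ?_))
  · exact hc.congr fun x => by rw [norm_mul, norm_mFourier_apply, one_mul]
  · rw [norm_mul, norm_mFourier_apply, one_mul]

/-- In the summable case the dyadic partial sums converge uniformly:
`|ĉ(t) - P_N(t)| ≤ Σ_{x ∉ box 2^N} |c_x|`. [folklore] -/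
theorem norm_dFT_sub_dyadicSum_le {c : Site d → ℂ} (hc : Summable fun x => ‖c x‖) (t : 𝕋 d) (N : ℕ) :
    ‖dFT c t - dyadicSum c N t‖ ≤ ∑' x : {x // x ∉ box d (2 ^ N)}, ‖c x‖ := by
  have hs : Summable fun x => mFourier x t * c x :=
    Summable.of_norm (hc.congr fun x => by rw [norm_mul, norm_mFourier_apply, one_mul])
  rw [dFT_eq_tsum hc t, dyadicSum, trigPoly_apply]
  simp only [smul_eq_mul]
  rw [← Summable.sum_add_tsum_compl (s := box d (2 ^ N)) hs, add_sub_cancel_left]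
  refine (norm_tsum_le_tsum_norm ?_).trans (le_of_eq (tsum_congr fun x => ?_))
  · exact (hc.subtype _).congr fun x => by rw [Function.comp_apply, norm_mul, norm_mFourier_apply, one_mul]
  · rw [norm_mul, norm_mFourier_apply, one_mul]

/-! ### Weak derivatives: limits, characters, words -/

/-- A continuous real weight times an `L¹`-convergent sequence: `∫ ψ • u_N → ∫ ψ • u`. [folklore] -/
theorem tendsto_integral_smul_of_eLpNorm {ψ : (𝕋 d) → ℝ} (hψ : Continuous ψ) {us : ℕ → (𝕋 d) → ℂ}
    {u : (𝕋 d) → ℂ} (hus : ∀ N, Integrable (us N)) (hu : Integrable u)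
    (h : Tendsto (fun N => eLpNorm (us N - u) 1 volume) atTop (𝓝 0)) :
    Tendsto (fun N => ∫ t, ψ t • us N t) atTop (𝓝 (∫ t, ψ t • u t)) := by
  obtain ⟨C, hC⟩ := isCompact_univ.exists_bound_of_continuousOn hψ.continuousOn
  have hC0 : 0 ≤ C := (norm_nonneg _).trans (hC 0 (Set.mem_univ _))
  have hψm : AEStronglyMeasurable ψ volume := hψ.aestronglyMeasurable
  refine tendsto_integral_of_L1' (fun t => ψ t • u t) (hψm.smul hu.1)
    (Eventually.of_forall fun N => Integrable.smul_of_top_right (hus N)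
      (memLp_top_of_bound hψm C (ae_of_all _ fun t => hC t (Set.mem_univ t)))) ?_
  have hle : ∀ N, eLpNorm ((fun t => ψ t • us N t) - fun t => ψ t • u t) 1 volume ≤
      ENNReal.ofReal C * eLpNorm (us N - u) 1 volume := by
    intro N
    have e : ((fun t => ψ t • us N t) - fun t => ψ t • u t) = fun t => ψ t • (us N - u) t := by
      funext t; simp [smul_sub]
    rw [e]
    refine (eLpNorm_smul_le_eLpNorm_top_mul_eLpNorm 1 ((hus N).sub hu).1 ψ).trans ?_
    gcongr
    refine (eLpNorm_le_of_ae_bound (C := C) (ae_of_all _ fun t => hC t (Set.mem_univ t))).trans ?_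
    simp
  refine tendsto_of_tendsto_of_tendsto_of_le_of_le tendsto_const_nhds ?_ (fun _ => bot_le) hle
  rw [← mul_zero (ENNReal.ofReal C)]
  exact ENNReal.Tendsto.const_mul h (Or.inr ENNReal.ofReal_ne_top)

/-- **Weak derivatives pass to `L¹` limits**: if `∂ⱼ u_N = a_N` weakly for large `N`, `u_N → u` and
`a_N → a` in `L¹`, then `∂ⱼ u = a` weakly. [cite: LiuSlade2024, Appendix A, proof of Lemma A.2 (limit in the integration-by-parts identity)] -/
theorem hasWeakPartialDeriv_of_tendsto {j : Fin d} {us as : ℕ → (𝕋 d) → ℂ} {u a : (𝕋 d) → ℂ}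
    (h : ∀ᶠ N in atTop, HasWeakPartialDeriv j (us N) (as N))
    (hus : ∀ N, Integrable (us N)) (has : ∀ N, Integrable (as N)) (hu : Integrable u) (ha : Integrable a)
    (hut : Tendsto (fun N => eLpNorm (us N - u) 1 volume) atTop (𝓝 0))
    (hat : Tendsto (fun N => eLpNorm (as N - a) 1 volume) atTop (𝓝 0)) :
    HasWeakPartialDeriv j u a := by
  intro φ hφ
  have h1 := tendsto_integral_smul_of_eLpNorm (hφ.partialDeriv j).continuous hus hu hut
  have h2 := (tendsto_integral_smul_of_eLpNorm hφ.continuous has ha hat).neg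
  refine tendsto_nhds_unique h1 (h2.congr' ?_)
  filter_upwards [h] with N hN
  exact (hN φ hφ).symm

/-- Weak derivatives are insensitive to a.e. modification of either function. [folklore] -/
theorem HasWeakPartialDeriv.congr_ae {j : Fin d} {u u' a a' : (𝕋 d) → ℂ}
    (h : HasWeakPartialDeriv j u a) (hu : u =ᵐ[volume] u') (ha : a =ᵐ[volume] a') :
    HasWeakPartialDeriv j u' a' := by
  intro φ hφ
  have e1 : ∫ t, Torus.partialDeriv j φ t • u' t = ∫ t, Torus.partialDeriv j φ t • u t :=
    integral_congr_ae (by filter_upwards [hu] with t ht; rw [ht])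
  have e2 : ∫ t, φ t • a' t = ∫ t, φ t • a t :=
    integral_congr_ae (by filter_upwards [ha] with t ht; rw [ht])
  rw [e1, e2]
  exact h φ hφ

/-- Weak derivatives of all orders are insensitive to a.e. modification. [folklore] -/
theorem HasTorusWeakDeriv.congr_ae {u u' v v' : (𝕋 d) → ℂ} {l : List (Fin d)}
    (h : HasTorusWeakDeriv u l v) (hu : u =ᵐ[volume] u') (hv : v =ᵐ[volume] v') :
    HasTorusWeakDeriv u' l v' := by
  refine ⟨h.1.congr hu, h.2.1.congr hv, fun φ hφ => ?_⟩
  have e1 : ∫ t, iterPartialDeriv l φ t • u' t = ∫ t, iterPartialDeriv l φ t • u t :=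
    integral_congr_ae (by filter_upwards [hu] with t ht; rw [ht])
  have e2 : ∫ t, φ t • v' t = ∫ t, φ t • v t :=
    integral_congr_ae (by filter_upwards [hv] with t ht; rw [ht])
  rw [e1, e2]
  exact h.2.2 φ hφ

/-- `∇^{l ++ [i]} φ = ∇^l (∂ᵢ φ)`. [folklore] -/
theorem iterPartialDeriv_append_singleton (l : List (Fin d)) (i : Fin d) (φ : (𝕋 d) → ℝ) :
    iterPartialDeriv (l ++ [i]) φ = iterPartialDeriv l (Torus.partialDeriv i φ) := by
  simp [iterPartialDeriv, List.foldr_append]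

/-- **Words**: an `l`-th weak derivative `v` of `u` with a weak `∂ᵢ v = w` gives the
`(l ++ [i])`-th weak derivative `w` of `u` (`∫ ∇^l(∂ᵢφ) u = (-1)^{|l|} ∫ (∂ᵢφ) v = (-1)^{|l|+1} ∫ φ w`).
[cite: LiuSlade2024, Appendix A, Definition A.1] -/
theorem HasTorusWeakDeriv.append_singleton {u v w : (𝕋 d) → ℂ} {l : List (Fin d)} {i : Fin d}
    (h : HasTorusWeakDeriv u l v) (hvw : HasWeakPartialDeriv i v w) (hw : Integrable w) :
    HasTorusWeakDeriv u (l ++ [i]) w := by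
  refine ⟨h.1, hw, fun φ hφ => ?_⟩
  rw [iterPartialDeriv_append_singleton, h.2.2 _ (hφ.partialDeriv i), hvw φ hφ, List.length_append,
    List.length_singleton, pow_succ]
  ring

/-- Smooth functions have their classical partial derivatives as weak derivatives
(complex-valued case of the tree's `IsSmooth.hasWeakPartialDeriv`). [folklore] -/
theorem hasWeakPartialDeriv_of_isSmooth {u : (𝕋 d) → ℂ} (hu : Torus.IsSmooth u) (j : Fin d) :
    HasWeakPartialDeriv j u (Torus.partialDeriv j u) :=
  hu.hasWeakPartialDeriv integral_partialDeriv_eq_zero_holds j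

/-- The coefficient family of `∂ⱼ`: `c ↦ (2πi xⱼ) c`. [folklore] -/
def derivCoeff (j : Fin d) (c : Site d → ℂ) (x : Site d) : ℂ := (2 * π * Complex.I * (x j : ℂ)) * c x

/-- `∂ⱼ` of a dyadic partial sum is the partial sum of `(2πi xⱼ) c`. [cite: LiuSlade2024, Appendix A, Lemma A.4 (i) (finite sums are differentiated termwise)] -/
theorem partialDeriv_dyadicSum (c : Site d → ℂ) (j : Fin d) (N : ℕ) :
    Torus.partialDeriv j (dyadicSum c N) = dyadicSum (derivCoeff j c) N := by
  rw [dyadicSum, partialDeriv_trigPoly']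
  rfl

/-- Decay of the derivative coefficients: `|(2πi xⱼ) c_x| ≤ 2πK ⟦x⟧^{-(b-1)}`. [folklore] -/
theorem norm_derivCoeff_le {c : Site d → ℂ} {K b : ℝ} (hc : ∀ x, ‖c x‖ ≤ K / jnorm x ^ b)
    (j : Fin d) (x : Site d) : ‖derivCoeff j c x‖ ≤ 2 * π * K / jnorm x ^ (b - 1) := by
  have hK : 0 ≤ K := by
    have h := (norm_nonneg _).trans (hc 0)
    simpa [jnorm, euclidNorm] using h
  have hj := jnorm_pos x
  rw [derivCoeff, norm_mul]
  have h1 : ‖(2 * π * Complex.I * (x j : ℂ))‖ ≤ 2 * π * jnorm x := by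
    rw [norm_mul, norm_mul, norm_mul, Complex.norm_I, mul_one, Complex.norm_intCast,
      Complex.norm_real, Real.norm_eq_abs, abs_of_pos Real.pi_pos, Complex.norm_two]
    gcongr
    exact (abs_apply_le_euclidNorm x j).trans (euclidNorm_le_jnorm x)
  calc ‖(2 * π * Complex.I * (x j : ℂ))‖ * ‖c x‖ ≤ (2 * π * jnorm x) * (K / jnorm x ^ b) :=
        mul_le_mul h1 (hc x) (norm_nonneg _) (by positivity)
    _ = 2 * π * K / jnorm x ^ (b - 1) := by
        rw [Real.rpow_sub_one hj.ne']
        field_simp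

/-- **Weak differentiation commutes with the `L^q` Fourier limit** (Liu–Slade 2024, Lemma A.4 in the
form needed here): if `|c_x| ≤ K⟦x⟧^{-b}` with `b - 1 > d/2`, then `∂ⱼ ĉ = (derivCoeff j c)^` weakly.
[cite: LiuSlade2024, Appendix A, Lemma A.4] -/
theorem hasWeakPartialDeriv_dFT {c : Site d → ℂ} {K b : ℝ} (hc : ∀ x, ‖c x‖ ≤ K / jnorm x ^ b)
    (hb : (d : ℝ) / 2 < b - 1) (j : Fin d) :
    HasWeakPartialDeriv j (dFT c) (dFT (derivCoeff j c)) := by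
  have hb' : (d : ℝ) / 2 < b := by linarith
  have hc' : ∀ x, ‖derivCoeff j c x‖ ≤ 2 * π * K / jnorm x ^ (b - 1) := norm_derivCoeff_le hc j
  have hd0 : (0 : ℝ) ≤ d := Nat.cast_nonneg d
  have hθ : 0 < (d : ℝ) / 2 - (d - b) := by linarith
  have hθ' : 0 < (d : ℝ) / 2 - (d - (b - 1)) := by linarith
  -- `L¹` convergence from `L²` convergence
  have hL1 : ∀ {c₀ : Site d → ℂ} {K₀ b₀ : ℝ}, (∀ x, ‖c₀ x‖ ≤ K₀ / jnorm x ^ b₀) → (d : ℝ) / 2 < b₀ →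
      Tendsto (fun N => eLpNorm (dyadicSum c₀ N - dFT c₀) 1 volume) atTop (𝓝 0) := by
    intro c₀ K₀ b₀ hc₀ hb₀
    have hθ₀ : 0 < (d : ℝ) / 2 - (d - b₀) := by linarith
    have h2 := tendsto_eLpNorm_dFT_sub_dyadicSum hc₀ hb₀ le_rfl hθ₀
    refine tendsto_of_tendsto_of_tendsto_of_le_of_le tendsto_const_nhds h2 (fun _ => bot_le) fun N => ?_
    rw [← eLpNorm_neg, neg_sub]
    exact eLpNorm_le_eLpNorm_of_exponent_le
      (by rw [← ENNReal.ofReal_one]; exact ENNReal.ofReal_le_ofReal one_le_two)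
      ((stronglyMeasurable_dFT c₀).aestronglyMeasurable.sub (continuous_dyadicSum c₀ N).aestronglyMeasurable)
  have hint : ∀ {c₀ : Site d → ℂ} {K₀ b₀ : ℝ}, (∀ x, ‖c₀ x‖ ≤ K₀ / jnorm x ^ b₀) → (d : ℝ) / 2 < b₀ →
      Integrable (dFT c₀) := by
    intro c₀ K₀ b₀ hc₀ hb₀
    have hθ₀ : 0 < (d : ℝ) / 2 - (d - b₀) := by linarith
    have h := memLp_dFT hc₀ hb₀ le_rfl hθ₀
    exact (h.mono_exponent (p := 1) (by rw [← ENNReal.ofReal_one]; exact ENNReal.ofReal_le_ofReal one_le_two)).integrable le_rfl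
  refine hasWeakPartialDeriv_of_tendsto (us := dyadicSum c) (as := dyadicSum (derivCoeff j c))
    (Eventually.of_forall fun N => ?_) (fun N => (continuous_dyadicSum _ N).integrable_unitAddTorus)
    (fun N => (continuous_dyadicSum _ N).integrable_unitAddTorus) (hint hc hb') (hint hc' hb)
    (hL1 hc hb') (hL1 hc' hb)
  rw [← partialDeriv_dyadicSum]
  exact hasWeakPartialDeriv_of_isSmooth (isSmooth_trigPoly _ _) j


/-! ### The torus modulus `ϱ(t) = (Σᵢ ‖tᵢ‖²)^{1/2}` (`|k|/2π` in the coordinate `k = 2πt`) -/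

/-- `ϱ(t) = (Σᵢ ‖tᵢ‖²)^{1/2}`, the Euclidean length of the centred representative of `t`
(the source's `|k|` up to the factor `2π`). [cite: LiuSlade2024, Assumption 1.1 (|k|² for k ∈ 𝕋^d identified with (-π,π]^d)] -/
def tnorm (t : 𝕋 d) : ℝ := Real.sqrt (∑ i, ‖t i‖ ^ 2)

/-- `ϱ(t) ≥ 0`. [folklore] -/
theorem tnorm_nonneg (t : 𝕋 d) : 0 ≤ tnorm t := Real.sqrt_nonneg _

/-- `ϱ(t)² = Σᵢ ‖tᵢ‖²`. [folklore] -/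
theorem tnorm_sq (t : 𝕋 d) : tnorm t ^ 2 = ∑ i, ‖t i‖ ^ 2 :=
  Real.sq_sqrt (Finset.sum_nonneg fun _ _ => sq_nonneg _)

/-- `ϱ` is continuous. [folklore] -/
theorem continuous_tnorm : Continuous (tnorm : (𝕋 d) → ℝ) :=
  Real.continuous_sqrt.comp (continuous_finsetSum _ fun i _ => ((continuous_apply i).norm).pow 2)

/-- The coordinates of the centred representative realise the quotient norms: `‖tᵢ‖ = |reprc t i|`. [folklore] -/
theorem norm_apply_eq_abs_reprc (t : 𝕋 d) (i : Fin d) : ‖t i‖ = |reprc t i| := by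
  have h : t i = ((reprc t i : ℝ) : UnitAddCircle) := by
    conv_lhs => rw [← proj_reprc t]
    rfl
  rw [h, UnitAddCircle.norm_eq, round_eq_zero_iff.2 (reprc_apply_mem_Ico t i)]
  simp

/-- `ϱ(t) = ‖reprc t‖` (Euclidean norm of the centred representative). [folklore] -/
theorem tnorm_eq_norm_reprc (t : 𝕋 d) : tnorm t = ‖reprc t‖ := by
  rw [tnorm, EuclideanSpace.norm_eq]
  congr 1
  refine Finset.sum_congr rfl fun i _ => ?_
  rw [norm_apply_eq_abs_reprc, Real.norm_eq_abs]

/-- `ϱ(t) ≤ √d/2` (each `‖tᵢ‖ ≤ 1/2`). [folklore] -/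
theorem tnorm_le (t : 𝕋 d) : tnorm t ≤ Real.sqrt d / 2 := by
  rw [tnorm]
  calc Real.sqrt (∑ i, ‖t i‖ ^ 2) ≤ Real.sqrt (∑ _i : Fin d, (1 / 2 : ℝ) ^ 2) := by
        refine Real.sqrt_le_sqrt (Finset.sum_le_sum fun i _ => ?_)
        rw [norm_apply_eq_abs_reprc]
        exact pow_le_pow_left₀ (abs_nonneg _) (abs_reprc_apply_le t i) 2
    _ = Real.sqrt d / 2 := by
        rw [Finset.sum_const, Finset.card_univ, Fintype.card_fin, nsmul_eq_mul, Real.sqrt_mul (Nat.cast_nonneg d),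
          Real.sqrt_sq (by norm_num)]
        ring

/-- `ϱ(t) = 0 ↔ t = 0`. [folklore] -/
theorem tnorm_eq_zero_iff (t : 𝕋 d) : tnorm t = 0 ↔ t = 0 := by
  rw [tnorm_eq_norm_reprc, norm_eq_zero]
  constructor
  · intro h
    rw [← proj_reprc t, h, proj_zero]
  · rintro rfl
    have h0 : reprc (proj (0 : EuclideanSpace ℝ (Fin d))) = 0 := reprc_proj_of_norm_lt (by simp)
    rwa [proj_zero] at h0

/-- `ϱ(t) > 0` for `t ≠ 0`. [folklore] -/
theorem tnorm_pos {t : 𝕋 d} (ht : t ≠ 0) : 0 < tnorm t :=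
  lt_of_le_of_ne (tnorm_nonneg t) (fun h => ht ((tnorm_eq_zero_iff t).1 h.symm))

/-- **Integrability of `ϱ^{-s}` on `𝕋^d` for `s < d`** (polar coordinates in the fundamental domain).
[cite: LiuSlade2024, §2.2.2 (proof of Lemma 2.5: |k|^{-a} ∈ L^q(𝕋^d) for aq < d)] -/
theorem integrable_tnorm_rpow_neg (hd : 1 ≤ d) {s : ℝ} (hs : s < d) :
    Integrable (fun t : 𝕋 d => tnorm t ^ (-s)) volume := by
  have hmp := measurePreserving_reprc (d := Fin d)
  have hemb := measurableEmbedding_reprc (d := Fin d)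
  have e : (fun t : 𝕋 d => tnorm t ^ (-s)) = (fun v : EuclideanSpace ℝ (Fin d) => ‖v‖ ^ (-s)) ∘ reprc := by
    funext t; simp [tnorm_eq_norm_reprc]
  rw [e, hmp.integrable_comp_emb hemb]
  -- the centred cube lies in a ball
  have hsub : centredCube (Fin d) ⊆ Metric.ball (0 : EuclideanSpace ℝ (Fin d)) (Real.sqrt d / 2 + 1) := by
    intro v hv
    rw [Metric.mem_ball, dist_zero_right, EuclideanSpace.norm_eq]
    have h1 : ∑ i, ‖v i‖ ^ 2 ≤ ∑ _i : Fin d, (1 / 2 : ℝ) ^ 2 := Finset.sum_le_sum fun i _ => by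
      have h := hv i
      rw [Real.norm_eq_abs]
      refine pow_le_pow_left₀ (abs_nonneg _) (abs_le.2 ⟨h.1, h.2.le⟩) 2
    calc Real.sqrt (∑ i, ‖v i‖ ^ 2) ≤ Real.sqrt (∑ _i : Fin d, (1 / 2 : ℝ) ^ 2) := Real.sqrt_le_sqrt h1
      _ = Real.sqrt d / 2 := by
          rw [Finset.sum_const, Finset.card_univ, Fintype.card_fin, nsmul_eq_mul,
            Real.sqrt_mul (Nat.cast_nonneg d), Real.sqrt_sq (by norm_num)]
          ring
      _ < Real.sqrt d / 2 + 1 := lt_add_one _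
  have hball : IntegrableOn (fun v : EuclideanSpace ℝ (Fin d) => ‖v‖ ^ (-s))
      (Metric.ball 0 (Real.sqrt d / 2 + 1)) volume := by
    refine integrableOn_ball_of_norm_le_rpow (by rw [finrank_euclideanSpace_fin]; exact hd) (C := 1) (α := s)
      (by rw [finrank_euclideanSpace_fin]; exact hs) (Eventually.of_forall fun v => ?_) ?_
    · rw [Real.norm_of_nonneg (Real.rpow_nonneg (norm_nonneg _) _), one_mul]
    · exact (continuous_norm.measurable.pow_const _).aestronglyMeasurable
  exact hball.mono_set hsub

/-- **`ϱ^{-a} ∈ L^p(𝕋^d)` for `ap < d`** (`a ≥ 0`, `1 ≤ p < ∞`). [cite: LiuSlade2024, §2.2.2 (proof of Lemma 2.5)] -/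
theorem memLp_tnorm_rpow_neg (hd : 1 ≤ d) {a p : ℝ} (hp : 1 ≤ p) (hap : a * p < d) :
    MemLp (fun t : 𝕋 d => ((tnorm t ^ (-a) : ℝ) : ℂ)) (ENNReal.ofReal p) volume := by
  have hp0 : 0 < p := by linarith
  have hmeas : AEStronglyMeasurable (fun t : 𝕋 d => ((tnorm t ^ (-a) : ℝ) : ℂ)) volume :=
    (Complex.continuous_ofReal.measurable.comp (continuous_tnorm.measurable.pow_const _)).aestronglyMeasurable
  rw [← integrable_norm_rpow_iff hmeas (by simpa using hp0) ENNReal.ofReal_ne_top, ENNReal.toReal_ofReal hp0.le]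
  refine (integrable_tnorm_rpow_neg hd hap).congr (ae_of_all _ fun t => ?_)
  simp only
  rw [Complex.norm_real, Real.norm_of_nonneg (Real.rpow_nonneg (tnorm_nonneg t) _),
    ← Real.rpow_mul (tnorm_nonneg t)]
  ring_nf

/-! ### Hölder's inequality for finite products, and continuity of products in `L^p` -/

section Holder

variable {ι : Type*}

/-- **Generalised Hölder inequality**: `‖∏ᵢ fᵢ‖_r ≤ ∏ᵢ ‖fᵢ‖_{pᵢ}` with `r⁻¹ = Σᵢ pᵢ⁻¹`. [folklore] -/
theorem eLpNorm_finset_prod_le (s : Finset ι) (f : ι → (𝕋 d) → ℂ) (p : ι → ℝ≥0∞)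
    (hf : ∀ i ∈ s, AEStronglyMeasurable (f i) volume) :
    eLpNorm (fun t => ∏ i ∈ s, f i t) (∑ i ∈ s, (p i)⁻¹)⁻¹ volume ≤ ∏ i ∈ s, eLpNorm (f i) (p i) volume := by
  classical
  induction s using Finset.cons_induction with
  | empty =>
    simp only [Finset.prod_empty, Finset.sum_empty, ENNReal.inv_zero, eLpNorm_exponent_top]
    rw [eLpNormEssSup_const _ (NeZero.ne volume)]
    simp
  | cons a s ha ih =>
    have hf' : ∀ i ∈ s, AEStronglyMeasurable (f i) volume := fun i hi => hf i (Finset.mem_cons_of_mem hi)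
    have hfa : AEStronglyMeasurable (f a) volume := hf a (Finset.mem_cons_self a s)
    have hprod : AEStronglyMeasurable (fun t => ∏ i ∈ s, f i t) volume :=
      Finset.aestronglyMeasurable_fun_prod s hf'
    simp only [Finset.prod_cons, Finset.sum_cons]
    have htriple : ENNReal.HolderTriple (p a) (∑ i ∈ s, (p i)⁻¹)⁻¹ ((p a)⁻¹ + ∑ i ∈ s, (p i)⁻¹)⁻¹ := by
      have h := ENNReal.HolderTriple.of (p a) (∑ i ∈ s, (p i)⁻¹)⁻¹
      rwa [inv_inv] at h
    calc eLpNorm (fun t => f a t * ∏ i ∈ s, f i t) ((p a)⁻¹ + ∑ i ∈ s, (p i)⁻¹)⁻¹ volume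
        ≤ (1 : NNReal) * eLpNorm (f a) (p a) volume * eLpNorm (fun t => ∏ i ∈ s, f i t) (∑ i ∈ s, (p i)⁻¹)⁻¹ volume :=
          eLpNorm_le_eLpNorm_mul_eLpNorm_of_nnnorm hfa hprod (· * ·) 1
            (ae_of_all _ fun t => by simp) (hpqr := htriple)
      _ ≤ eLpNorm (f a) (p a) volume * ∏ i ∈ s, eLpNorm (f i) (p i) volume := by
          rw [ENNReal.coe_one, one_mul]
          gcongr
          exact ih hf'

/-- **Products of `L^{pᵢ}`-convergent sequences converge in `L^r`**, `r⁻¹ = Σᵢ pᵢ⁻¹`. [folklore] -/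
theorem tendsto_eLpNorm_finset_prod_sub (s : Finset ι) (f : ι → ℕ → (𝕋 d) → ℂ) (g : ι → (𝕋 d) → ℂ)
    (p : ι → ℝ≥0∞) (hf : ∀ i ∈ s, ∀ N, AEStronglyMeasurable (f i N) volume)
    (hg : ∀ i ∈ s, AEStronglyMeasurable (g i) volume) (hgp : ∀ i ∈ s, eLpNorm (g i) (p i) volume ≠ ∞)
    (hlim : ∀ i ∈ s, Tendsto (fun N => eLpNorm (f i N - g i) (p i) volume) atTop (𝓝 0)) :
    Tendsto (fun N => eLpNorm (fun t => ∏ i ∈ s, f i N t - ∏ i ∈ s, g i t) (∑ i ∈ s, (p i)⁻¹)⁻¹ volume)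
      atTop (𝓝 0) := by
  classical
  induction s using Finset.cons_induction with
  | empty => simp only [Finset.prod_empty, sub_self, eLpNorm_zero']; exact tendsto_const_nhds
  | cons a s ha ih =>
    have hf' : ∀ i ∈ s, ∀ N, AEStronglyMeasurable (f i N) volume := fun i hi => hf i (Finset.mem_cons_of_mem hi)
    have hg' : ∀ i ∈ s, AEStronglyMeasurable (g i) volume := fun i hi => hg i (Finset.mem_cons_of_mem hi)
    have hgp' : ∀ i ∈ s, eLpNorm (g i) (p i) volume ≠ ∞ := fun i hi => hgp i (Finset.mem_cons_of_mem hi)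
    have hlim' : ∀ i ∈ s, Tendsto (fun N => eLpNorm (f i N - g i) (p i) volume) atTop (𝓝 0) :=
      fun i hi => hlim i (Finset.mem_cons_of_mem hi)
    have IH := ih hf' hg' hgp' hlim'
    have hfa : ∀ N, AEStronglyMeasurable (f a N) volume := hf a (Finset.mem_cons_self a s)
    have hga : AEStronglyMeasurable (g a) volume := hg a (Finset.mem_cons_self a s)
    have hgpa : eLpNorm (g a) (p a) volume ≠ ∞ := hgp a (Finset.mem_cons_self a s)
    have hlima := hlim a (Finset.mem_cons_self a s)
    set q : ℝ≥0∞ := (∑ i ∈ s, (p i)⁻¹)⁻¹ with hq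
    set r : ℝ≥0∞ := ((p a)⁻¹ + ∑ i ∈ s, (p i)⁻¹)⁻¹ with hr
    have htriple : ENNReal.HolderTriple (p a) q r := by
      have h := ENNReal.HolderTriple.of (p a) q
      rwa [hq, inv_inv] at h
    set P : ℕ → (𝕋 d) → ℂ := fun N t => ∏ i ∈ s, f i N t with hP
    set G : (𝕋 d) → ℂ := fun t => ∏ i ∈ s, g i t with hG
    have hPm : ∀ N, AEStronglyMeasurable (P N) volume := fun N =>
      Finset.aestronglyMeasurable_fun_prod s fun i hi => hf' i hi N
    have hGm : AEStronglyMeasurable G volume := Finset.aestronglyMeasurable_fun_prod s hg'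
    have hGq : eLpNorm G q volume ≠ ∞ :=
      ne_top_of_le_ne_top (ENNReal.prod_ne_top fun i hi => hgp' i hi) (eLpNorm_finset_prod_le s g p hg')
    simp only [Finset.prod_cons, Finset.sum_cons]
    -- `f_a P - g_a G = (f_a - g_a) P + g_a (P - G)`
    have hsplit : ∀ N, (fun t => f a N t * P N t - g a t * G t) =
        (fun t => (f a N - g a) t * P N t) + fun t => g a t * (P N - G) t := by
      intro N; funext t; simp only [Pi.add_apply, Pi.sub_apply]; ring
    have hA : ∀ N, eLpNorm (fun t => (f a N - g a) t * P N t) r volume ≤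
        eLpNorm (f a N - g a) (p a) volume * eLpNorm (P N) q volume := by
      intro N
      have h := eLpNorm_le_eLpNorm_mul_eLpNorm_of_nnnorm ((hfa N).sub hga) (hPm N) (· * ·) 1
        (ae_of_all _ fun t => by simp) (hpqr := htriple)
      rw [ENNReal.coe_one, one_mul] at h
      exact h
    have hB : ∀ N, eLpNorm (fun t => g a t * (P N - G) t) r volume ≤
        eLpNorm (g a) (p a) volume * eLpNorm (P N - G) q volume := by
      intro N
      have h := eLpNorm_le_eLpNorm_mul_eLpNorm_of_nnnorm hga ((hPm N).sub hGm) (· * ·) 1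
        (ae_of_all _ fun t => by simp) (hpqr := htriple)
      rw [ENNReal.coe_one, one_mul] at h
      exact h
    have hbound : ∀ N, eLpNorm (fun t => f a N t * P N t - g a t * G t) r volume ≤
        ENNReal.LpAddConst r * (eLpNorm (f a N - g a) (p a) volume * eLpNorm (P N) q volume +
          eLpNorm (g a) (p a) volume * eLpNorm (P N - G) q volume) := by
      intro N
      rw [hsplit N]
      calc eLpNorm ((fun t => (f a N - g a) t * P N t) + fun t => g a t * (P N - G) t) r volume
          ≤ ENNReal.LpAddConst r * (eLpNorm (fun t => (f a N - g a) t * P N t) r volume +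
              eLpNorm (fun t => g a t * (P N - G) t) r volume) :=
            eLpNorm_add_le' (((hfa N).sub hga).mul (hPm N)) (hga.mul ((hPm N).sub hGm)) r
        _ ≤ _ := by
            gcongr
            · exact hA N
            · exact hB N
    -- `‖P_N‖_q ≤ C (‖P_N - G‖_q + ‖G‖_q)` stays bounded
    have hPq : ∀ N, eLpNorm (P N) q volume ≤ ENNReal.LpAddConst q * (eLpNorm (P N - G) q volume + eLpNorm G q volume) := by
      intro N
      have e : P N = (P N - G) + G := by abel
      conv_lhs => rw [e]
      exact eLpNorm_add_le' ((hPm N).sub hGm) hGm q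
    have IH' : Tendsto (fun N => eLpNorm (P N - G) q volume) atTop (𝓝 0) := by
      refine IH.congr fun N => ?_
      congr 1
    have hlimP : Tendsto (fun N => ENNReal.LpAddConst q * (eLpNorm (P N - G) q volume + eLpNorm G q volume)) atTop
        (𝓝 (ENNReal.LpAddConst q * (0 + eLpNorm G q volume))) :=
      ENNReal.Tendsto.const_mul (IH'.add tendsto_const_nhds) (Or.inr (ENNReal.LpAddConst_lt_top q).ne)
    have hfin : ENNReal.LpAddConst q * (0 + eLpNorm G q volume) ≠ ∞ := by
      rw [zero_add]; exact ENNReal.mul_ne_top (ENNReal.LpAddConst_lt_top q).ne hGq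
    -- assemble
    have h1 : Tendsto (fun N => eLpNorm (f a N - g a) (p a) volume *
        (ENNReal.LpAddConst q * (eLpNorm (P N - G) q volume + eLpNorm G q volume))) atTop (𝓝 0) := by
      have h := ENNReal.Tendsto.mul hlima (Or.inr hfin) hlimP (Or.inr ENNReal.zero_ne_top)
      rwa [zero_mul] at h
    have h2 : Tendsto (fun N => eLpNorm (g a) (p a) volume * eLpNorm (P N - G) q volume) atTop (𝓝 0) := by
      have h := ENNReal.Tendsto.const_mul IH' (Or.inr hgpa)
      rwa [mul_zero] at h
    have h3 : Tendsto (fun N => ENNReal.LpAddConst r * (eLpNorm (f a N - g a) (p a) volume *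
        (ENNReal.LpAddConst q * (eLpNorm (P N - G) q volume + eLpNorm G q volume)) +
          eLpNorm (g a) (p a) volume * eLpNorm (P N - G) q volume)) atTop (𝓝 0) := by
      have h := ENNReal.Tendsto.const_mul (h1.add h2) (Or.inr (ENNReal.LpAddConst_lt_top r).ne)
      rwa [add_zero, mul_zero] at h
    refine tendsto_of_tendsto_of_tendsto_of_le_of_le tendsto_const_nhds h3 (fun _ => bot_le) fun N => ?_
    refine (hbound N).trans ?_
    gcongr
    exact hPq N

end Holder


/-! ### Multi-index words and the coefficient families `(2πi x)^w h(x)` -/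

/-- The symbol `(2πi x)^w = Π_{j ∈ w} (2πi x_j)` of the differential monomial `∇^w` (word `w`,
letters = coordinate directions, in the coordinate `t = k/2π`).
[cite: LiuSlade2024, Appendix A, Lemma A.4 (∇^α f̂ = 𝓕[(ix)^α f])] -/
def monoW (w : List (Fin d)) (x : Site d) : ℂ := (w.map fun j => (2 * π * Complex.I * (x j : ℂ))).prod

/-- The coefficient family `x ↦ (2πi x)^w h(x)` of `∇^w ĥ`. [cite: LiuSlade2024, Appendix A, Lemma A.4] -/
def coefW (h : Site d → ℝ) (w : List (Fin d)) (x : Site d) : ℂ := monoW w x * (h x : ℂ)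

/-- `(2πi x)^{[]} = 1`. [folklore] -/
@[simp] theorem monoW_nil (x : Site d) : monoW ([] : List (Fin d)) x = 1 := by simp [monoW]

/-- `(2πi x)^{j :: w} = (2πi xⱼ)(2πi x)^w`. [folklore] -/
theorem monoW_cons (j : Fin d) (w : List (Fin d)) (x : Site d) :
    monoW (j :: w) x = (2 * π * Complex.I * (x j : ℂ)) * monoW w x := by simp [monoW]

/-- The coefficient family of the empty word is `h` itself. [folklore] -/
theorem coefW_nil (h : Site d → ℝ) : coefW h [] = fun x => (h x : ℂ) := by
  funext x; simp [coefW]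

/-- Prepending a letter is the derivative-coefficient operation: `coefW h (j :: w) = derivCoeff j (coefW h w)`. [folklore] -/
theorem coefW_cons (h : Site d → ℝ) (j : Fin d) (w : List (Fin d)) :
    coefW h (j :: w) = derivCoeff j (coefW h w) := by
  funext x
  simp only [coefW, derivCoeff, monoW_cons]
  ring

/-- `|(2πi x)^w| ≤ (2π⟦x⟧)^{|w|}`. [folklore] -/
theorem norm_monoW_le (w : List (Fin d)) (x : Site d) : ‖monoW w x‖ ≤ (2 * π * jnorm x) ^ w.length := by
  induction w with
  | nil => simp
  | cons j w ih =>
    rw [monoW_cons, norm_mul, List.length_cons, pow_succ, mul_comm ((2 * π * jnorm x) ^ w.length)]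
    refine mul_le_mul ?_ ih (norm_nonneg _) (by have := jnorm_pos x; positivity)
    rw [norm_mul, norm_mul, norm_mul, Complex.norm_I, mul_one, Complex.norm_intCast,
      Complex.norm_real, Real.norm_eq_abs, abs_of_pos Real.pi_pos, Complex.norm_two]
    gcongr
    exact (abs_apply_le_euclidNorm x j).trans (euclidNorm_le_jnorm x)

/-- `monoW` only sees the letters with multiplicity: it is invariant under permutations of the word. [folklore] -/
theorem monoW_perm {w w' : List (Fin d)} (h : w.Perm w') (x : Site d) : monoW w x = monoW w' x :=
  (h.map _).prod_eq

/-- `(2πi x)^w` is even or odd according to the parity of `|w|`. [folklore] -/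
theorem monoW_neg (w : List (Fin d)) (x : Site d) : monoW w (-x) = (-1) ^ w.length * monoW w x := by
  induction w with
  | nil => simp
  | cons j w ih =>
    rw [monoW_cons, monoW_cons, ih, List.length_cons, pow_succ]
    simp only [Pi.neg_apply, Int.cast_neg]
    ring

/-- Decay of the coefficient families: `|(2πi x)^w h(x)| ≤ (2π)^{|w|} K ⟦x⟧^{-(s - |w|)}`. [folklore] -/
theorem norm_coefW_le {h : Site d → ℝ} {K s : ℝ} (hh : ∀ x, |h x| ≤ K / jnorm x ^ s)
    (w : List (Fin d)) (x : Site d) :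
    ‖coefW h w x‖ ≤ (2 * π) ^ w.length * K / jnorm x ^ (s - w.length) := by
  have hj := jnorm_pos x
  rw [coefW, norm_mul, Complex.norm_real, Real.norm_eq_abs]
  calc ‖monoW w x‖ * |h x| ≤ (2 * π * jnorm x) ^ w.length * (K / jnorm x ^ s) :=
        mul_le_mul (norm_monoW_le w x) (hh x) (abs_nonneg _) (by positivity)
    _ = (2 * π) ^ w.length * K / jnorm x ^ (s - w.length) := by
        rw [mul_pow, Real.rpow_sub hj, Real.rpow_natCast]
        field_simp

/-- Summability of the coefficient family when `s - |w| > d`. [folklore] -/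
theorem summable_norm_coefW {h : Site d → ℝ} {K s : ℝ} (hh : ∀ x, |h x| ≤ K / jnorm x ^ s)
    (w : List (Fin d)) (hs : (d : ℝ) < s - w.length) : Summable fun x => ‖coefW h w x‖ := by
  refine Summable.of_nonneg_of_le (fun x => norm_nonneg _) (norm_coefW_le hh w)
    (((summable_jnorm_rpow_neg hs).mul_left ((2 * π) ^ w.length * K)).congr fun x => ?_)
  rw [Real.rpow_neg (jnorm_pos x).le, div_eq_mul_inv]

/-- The `ℓ¹` mass of a summable coefficient family: `Σ_x |(2πi x)^w h(x)| ≤ (2π)^{|w|} K Z_{s-|w|}`,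
`Z_a = Σ_x ⟦x⟧^{-a}`. [folklore] -/
theorem tsum_norm_coefW_le {h : Site d → ℝ} {K s : ℝ} (hh : ∀ x, |h x| ≤ K / jnorm x ^ s)
    (w : List (Fin d)) (hs : (d : ℝ) < s - w.length) :
    ∑' x, ‖coefW h w x‖ ≤ (2 * π) ^ w.length * K * ∑' x : Site d, jnorm x ^ (-(s - w.length)) := by
  rw [← tsum_mul_left]
  refine Summable.tsum_le_tsum (fun x => ?_) (summable_norm_coefW hh w hs)
    ((summable_jnorm_rpow_neg hs).mul_left _)
  rw [Real.rpow_neg (jnorm_pos x).le, ← div_eq_mul_inv]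
  exact norm_coefW_le hh w x

/-! ### Representatives, and the bridge to the cube-side transform `latticeFT` -/

/-- `(c k) · x = c (k · x)`. [folklore] -/
theorem kdot_smul_left (c : ℝ) (k : Fin d → ℝ) (x : Site d) : kdot (c • k) x = c * kdot k x := by
  simp [kdot, Finset.mul_sum, mul_assoc]

/-- The character at the class of `y`: `e_x([y]) = exp(2πi y·x)`. [folklore] -/
theorem mFourier_coe_eq_cexp' (x : Site d) (y : Fin d → ℝ) :
    mFourier x (fun i => ((y i : ℝ) : UnitAddCircle)) = Complex.exp (Complex.I * ((2 * π * kdot y x : ℝ) : ℂ)) := by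
  rw [mFourier_coe_eq_cexp, kdot_smul_left]
  congr 1
  push_cast
  ring

/-- A centred representative `y ∈ [-1/2,1/2]^d` of `t`, with `‖tᵢ‖ = |yᵢ|` and `ϱ(t) = |y|`. [folklore] -/
theorem exists_rep (t : 𝕋 d) :
    ∃ y : Fin d → ℝ, (fun i => ((y i : ℝ) : UnitAddCircle)) = t ∧ (∀ i, ‖t i‖ = |y i|) ∧
      tnorm t = knorm y := by
  obtain ⟨y, -, hyt, hn⟩ := exists_rep_unitAddTorus t
  refine ⟨y, hyt, hn, ?_⟩
  rw [tnorm, knorm]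
  congr 1
  exact Finset.sum_congr rfl fun i _ => by rw [hn i, sq_abs]

/-- **Bridge**: at `t = [y]`, the Fourier series of a summable family is the cube-side series
`Σ_x c_x e^{-ik·x}` at `k = -2πy`, i.e. `Σ_x c_x e^{2πi y·x}`. [folklore] -/
theorem dFT_eq_tsum_cexp {c : Site d → ℂ} (hc : Summable fun x => ‖c x‖) (y : Fin d → ℝ) :
    dFT c (fun i => ((y i : ℝ) : UnitAddCircle)) =
      ∑' x, c x * Complex.exp (Complex.I * ((2 * π * kdot y x : ℝ) : ℂ)) := by
  rw [dFT_eq_tsum hc]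
  exact tsum_congr fun x => by rw [mFourier_coe_eq_cexp', mul_comm]

/-- The transform of `coefW h []` is `latticeFourier h` (`= Σ_x h(x) e_x`). [folklore] -/
theorem dFT_coefW_nil {h : Site d → ℝ} (hh : Summable fun x => |h x|) (t : 𝕋 d) :
    dFT (coefW h []) t = latticeFourier h t := by
  rw [coefW_nil, dFT_eq_tsum (by simpa using hh), latticeFourier]
  exact tsum_congr fun x => mul_comm _ _

/-- The transform of `coefW h [j]` is `2πi (x_j h)^`: at `t = [y]` it is `2πi · latticeFT (coordMul j h) (-2πy)`.
[folklore] -/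
theorem dFT_coefW_singleton {h : Site d → ℝ} (hh : Summable fun x => |h x|)
    (h2 : Summable fun x => euclidNorm x ^ 2 * |h x|) (j : Fin d) (y : Fin d → ℝ) :
    dFT (coefW h [j]) (fun i => ((y i : ℝ) : UnitAddCircle)) =
      2 * π * Complex.I * latticeFT (coordMul j h) ((-(2 * π)) • y) := by
  have hs : Summable fun x => ‖coefW h [j] x‖ := by
    refine Summable.of_nonneg_of_le (fun _ => norm_nonneg _) (fun x => ?_)
      ((summable_abs_coordMul hh h2 j).mul_left (2 * π))
    rw [coefW, monoW_cons, monoW_nil, mul_one, norm_mul, norm_mul, norm_mul, norm_mul, Complex.norm_I,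
      mul_one, Complex.norm_intCast, Complex.norm_real, Real.norm_eq_abs, abs_of_pos Real.pi_pos,
      Complex.norm_two, Complex.norm_real, Real.norm_eq_abs, coordMul, abs_mul, mul_assoc]
  rw [dFT_eq_tsum hs, latticeFT, ← tsum_mul_left]
  refine tsum_congr fun x => ?_
  rw [mFourier_coe_eq_cexp, coefW, monoW_cons, monoW_nil, coordMul]
  push_cast
  ring

/-! ### Symmetric families: reality, and the first-derivative bound `|ĥ_j(t)| ≤ 4π² M₂(h) ϱ(t)` -/

/-- **`|∇_j ĥ(t)| ≤ 4π² (Σ_x |x|²|h(x)|) ϱ(t)`** for `ℤ^d`-symmetric `h` (odd symmetrisation in the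
`j`-th coordinate; the source: "If `|γ| = 1`, by Taylor's theorem and symmetry, and since
`Σ|x|²|F(x)|` is finite, we have `|F̂_γ(k)| ≲ |k|`"). [cite: LiuSlade2024, §2.2.2 (proof of Lemma 2.5, bound on F̂_γ/F̂ for |γ| = 1)] -/
theorem norm_dFT_coefW_singleton_le {h : Site d → ℝ} (hs : IsZdSymmetric h) (hh : Summable fun x => |h x|)
    (h2 : Summable fun x => euclidNorm x ^ 2 * |h x|) (j : Fin d) (t : 𝕋 d) :
    ‖dFT (coefW h [j]) t‖ ≤ 4 * π ^ 2 * (∑' x, euclidNorm x ^ 2 * |h x|) * tnorm t := by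
  obtain ⟨y, rfl, hn, htn⟩ := exists_rep t
  rw [dFT_coefW_singleton hh h2 j y, norm_mul, norm_mul, norm_mul, Complex.norm_I, mul_one,
    Complex.norm_real, Real.norm_eq_abs, abs_of_pos Real.pi_pos, Complex.norm_two]
  have hb := norm_latticeFT_coordMul_le hs hh h2 j ((-(2 * π)) • y)
  have hkj : |((-(2 * π)) • y) j| ≤ 2 * π * tnorm (fun i => ((y i : ℝ) : UnitAddCircle)) := by
    rw [htn, Pi.smul_apply, smul_eq_mul, abs_mul, abs_neg, abs_of_pos (by positivity)]
    gcongr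
    exact abs_apply_le_knorm y j
  have hM : 0 ≤ ∑' x, euclidNorm x ^ 2 * |h x| := tsum_nonneg fun x => by positivity
  calc 2 * π * ‖latticeFT (coordMul j h) ((-(2 * π)) • y)‖
      ≤ 2 * π * ((∑' x, euclidNorm x ^ 2 * |h x|) * (2 * π * tnorm (fun i => ((y i : ℝ) : UnitAddCircle)))) := by
        gcongr
        exact hb.trans (mul_le_mul_of_nonneg_left hkj hM)
    _ = 4 * π ^ 2 * (∑' x, euclidNorm x ^ 2 * |h x|) * tnorm (fun i => ((y i : ℝ) : UnitAddCircle)) := by ring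

/-- For an even summable `h` the transform is real: `ĥ(t) = Σ_x h(x) cos(2π y·x)`. [folklore] -/
theorem latticeFourier_eq_ofReal {h : Site d → ℝ} (hh : Summable fun x => |h x|) (he : ∀ x, h (-x) = h x)
    (t : 𝕋 d) : latticeFourier h t = (((latticeFourier h t).re : ℝ) : ℂ) := by
  obtain ⟨y, rfl, -, -⟩ := exists_rep t
  rw [latticeFourier_coe_eq_latticeFT, latticeFT_eq_re_of_even hh he]
  simp

/-- The imaginary part of the transform of an even summable family vanishes. [folklore] -/
theorem latticeFourier_im {h : Site d → ℝ} (hh : Summable fun x => |h x|) (he : ∀ x, h (-x) = h x)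
    (t : 𝕋 d) : (latticeFourier h t).im = 0 := by
  rw [latticeFourier_eq_ofReal hh he t, Complex.ofReal_im]

/-! ### The nearest-neighbour step distribution `D_nn` and `A_μ = δ - μD_nn` -/

/-- `Σ_x D_nn(x) = 1` (`d ≥ 1`). [folklore] -/
theorem tsum_srwStep (hd : 1 ≤ d) : ∑' x, srwStep d x = 1 := by
  have hd' : (d : ℝ) ≠ 0 := by exact_mod_cast (show d ≠ 0 by omega)
  rw [tsum_eq_sum (s := (zdGraph d).neighborFinset 0) (fun y hy => srwStep_of_not_mem hy)]
  have hval : ∀ y ∈ (zdGraph d).neighborFinset 0, srwStep d y = 1 / (2 * d) := fun y hy =>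
    if_pos ((SimpleGraph.mem_neighborFinset _ _ _).1 hy)
  rw [Finset.sum_congr rfl hval, sum_neighborFinset_zdGraph_zero]
  simp only [Finset.sum_const, Finset.card_univ, Fintype.card_fin, nsmul_eq_mul]
  field_simp
  norm_num

/-- `|±eᵢ| = 1`. [folklore] -/
theorem euclidNorm_single (i : Fin d) : euclidNorm (Pi.single i (1 : ℤ) : Site d) = 1 := by
  rw [euclidNorm]
  have h : ∑ j, (((Pi.single i (1 : ℤ) : Site d) j : ℤ) : ℝ) ^ 2 = 1 := by
    rw [Finset.sum_eq_single i]
    · simp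
    · intro j _ hj; simp [Pi.single_eq_of_ne hj]
    · intro h; exact absurd (Finset.mem_univ i) h
  rw [h, Real.sqrt_one]

/-- `Σ_x |x|² D_nn(x) = 1` (`d ≥ 1`). [folklore] -/
theorem tsum_sq_mul_srwStep (hd : 1 ≤ d) : ∑' x, euclidNorm x ^ 2 * srwStep d x = 1 := by
  have hd' : (d : ℝ) ≠ 0 := by exact_mod_cast (show d ≠ 0 by omega)
  rw [tsum_eq_sum (s := (zdGraph d).neighborFinset 0) (fun y hy => by rw [srwStep_of_not_mem hy, mul_zero])]
  have hval : ∀ y ∈ (zdGraph d).neighborFinset 0, euclidNorm y ^ 2 * srwStep d y = euclidNorm y ^ 2 * (1 / (2 * d)) :=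
    fun y hy => by rw [show srwStep d y = 1 / (2 * d) from if_pos ((SimpleGraph.mem_neighborFinset _ _ _).1 hy)]
  rw [Finset.sum_congr rfl hval, sum_neighborFinset_zdGraph_zero]
  simp only [euclidNorm_neg, euclidNorm_single, one_pow, one_mul, Finset.sum_const, Finset.card_univ,
    Fintype.card_fin, nsmul_eq_mul]
  field_simp
  ring

/-- Pointwise bound `|A_μ(x)| ≤ (1 + |μ|) ⟦x⟧^{-s}` for every `s` (`A_μ` lives on `{|x| ≤ 1}`). [folklore] -/
theorem abs_lsA_le (μ s : ℝ) (x : Site d) : |lsA d μ x| ≤ (1 + |μ|) / jnorm x ^ s := by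
  have hj := jnorm_pos x
  by_cases hx : x = 0
  · subst hx
    have h1 : jnorm (0 : Site d) = 1 := by simp [jnorm, euclidNorm]
    have h0 : srwStep d 0 = 0 := if_neg (SimpleGraph.irrefl _)
    rw [h1, Real.one_rpow, div_one, lsA, h0, mul_zero, sub_zero]
    have hδ : |delta0 (0 : Site d)| ≤ 1 := by simp [delta0]
    linarith [abs_nonneg μ]
  · rw [lsA, delta0_of_ne_zero hx, zero_sub, abs_neg, abs_mul]
    by_cases hmem : x ∈ (zdGraph d).neighborFinset 0
    · -- a neighbour of the origin: `⟦x⟧ = 1`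
      have hadj := (SimpleGraph.mem_neighborFinset _ _ _).1 hmem
      obtain ⟨i, h | h⟩ := (zdGraph_adj_iff 0 x).1 hadj
      · have hxn : euclidNorm x = 1 := by rw [h, zero_add, euclidNorm_single]
        have h1 : jnorm x = 1 := by rw [jnorm, hxn, max_self]
        rw [h1, Real.one_rpow, div_one]
        calc |μ| * |srwStep d x| ≤ |μ| * 1 := by
              gcongr
              rw [abs_of_nonneg (srwStep_nonneg d x)]
              unfold srwStep; split_ifs
              · rw [one_div]; refine inv_le_one_of_one_le₀ ?_
                have : (1 : ℝ) ≤ d := by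
                  have : 0 < d := Fin.pos i
                  exact_mod_cast this
                linarith
          _ ≤ 1 + |μ| := by linarith [abs_nonneg μ]
      · have hx' : x = -Pi.single i 1 := eq_neg_of_add_eq_zero_left h.symm
        have hxn : euclidNorm x = 1 := by rw [hx', euclidNorm_neg, euclidNorm_single]
        have h1 : jnorm x = 1 := by rw [jnorm, hxn, max_self]
        rw [h1, Real.one_rpow, div_one]
        calc |μ| * |srwStep d x| ≤ |μ| * 1 := by
              gcongr
              rw [abs_of_nonneg (srwStep_nonneg d x)]
              unfold srwStep; split_ifs
              · rw [one_div]; refine inv_le_one_of_one_le₀ ?_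
                have : (1 : ℝ) ≤ d := by
                  have : 0 < d := Fin.pos i
                  exact_mod_cast this
                linarith
          _ ≤ 1 + |μ| := by linarith [abs_nonneg μ]
    · rw [srwStep_of_not_mem hmem, abs_zero, mul_zero]
      positivity

/-! ### Infrared bounds on the torus: `Re F̂ ≥ K₂ϱ²` and `Re Â_μ ≥ (8μ/d)ϱ²` -/

/-- Under Assumption 1.1, `Re F̂(t) ≥ K₂ ϱ(t)²` (and `Re F̂(0) ≥ 0`). [cite: LiuSlade2024, Assumption 1.1] -/
theorem re_latticeFourier_ge {K₁ K₂ ρ : ℝ} {F : Site d → ℝ} (hF : LS24Assumption d K₁ K₂ ρ F) (t : 𝕋 d) :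
    K₂ * tnorm t ^ 2 ≤ (latticeFourier F t).re := by
  have h := hF.2.2.2 t
  rw [tnorm_sq]
  linarith [hF.2.2.1]

/-- `8s² ≤ 1 - cos(2πs)` for `|s| ≤ 1/2` (Jordan's inequality). [folklore] -/
theorem eight_sq_le_one_sub_cos {s : ℝ} (hs : |s| ≤ 1 / 2) : 8 * s ^ 2 ≤ 1 - Real.cos (2 * π * s) := by
  have hcos : 1 - Real.cos (2 * π * s) = 2 * Real.sin (π * s) ^ 2 := by
    rw [show 2 * π * s = 2 * (π * s) by ring, Real.cos_two_mul, Real.cos_sq']; ring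
  rw [hcos]
  have key : ∀ u : ℝ, 0 ≤ u → u ≤ 1 / 2 → 2 * u ≤ Real.sin (π * u) := by
    intro u hu0 hu1
    have h := Real.mul_le_sin (x := π * u) (by positivity) (by nlinarith [Real.pi_pos])
    calc 2 * u = 2 / π * (π * u) := by field_simp
      _ ≤ Real.sin (π * u) := h
  have hsq : (2 * |s|) ^ 2 ≤ Real.sin (π * s) ^ 2 := by
    rcases le_or_gt 0 s with h0 | h0
    · rw [abs_of_nonneg h0]
      exact pow_le_pow_left₀ (by positivity) (key s h0 (by rwa [abs_of_nonneg h0] at hs)) 2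
    · rw [abs_of_neg h0]
      have h1 := key (-s) (by linarith) (by rwa [abs_of_neg h0] at hs)
      have h2 : Real.sin (π * s) = -Real.sin (π * -s) := by rw [mul_neg, Real.sin_neg, neg_neg]
      rw [h2, neg_sq]
      exact pow_le_pow_left₀ (by linarith) h1 2
  nlinarith [hsq, sq_abs s]

/-- `Â_μ = 1 - μ D̂_nn` on the torus. [cite: LiuSlade2024, §2.1 (Â = 1 - μD̂)] -/
theorem latticeFourier_lsA (μ : ℝ) (t : 𝕋 d) :
    latticeFourier (lsA d μ) t = 1 - μ * latticeFourier (srwStep d) t := by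
  have h1 : Summable fun x : Site d => (delta0 x : ℂ) * mFourier x t := by
    refine summable_of_ne_finset_zero (s := {0}) fun x hx => ?_
    rw [Finset.mem_singleton] at hx
    rw [delta0_of_ne_zero hx]; simp
  have h2 : Summable fun x : Site d => (srwStep d x : ℂ) * mFourier x t := by
    refine summable_of_ne_finset_zero (s := (zdGraph d).neighborFinset 0) fun x hx => ?_
    rw [srwStep_of_not_mem hx]; simp
  have hδ : latticeFourier (delta0 : Site d → ℝ) t = 1 := by
    rw [latticeFourier, tsum_eq_single 0 (fun x hx => by rw [delta0_of_ne_zero hx]; simp)]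
    simp [delta0, mFourier_zero]
  unfold latticeFourier at hδ ⊢
  have e : ∀ x : Site d, ((lsA d μ x : ℝ) : ℂ) * mFourier x t =
      (delta0 x : ℂ) * mFourier x t - μ * ((srwStep d x : ℂ) * mFourier x t) := fun x => by
    rw [lsA]; push_cast; ring
  rw [tsum_congr e, Summable.tsum_sub h1 (h2.mul_left _), tsum_mul_left, hδ]

/-- **`Re Â_μ(t) ≥ (8μ/d) ϱ(t)²`** for `0 ≤ μ ≤ 1` (the infrared bound (1.11) for `A_μ` in the
coordinate `t = k/2π`: `μD̂(0) - μD̂(k) = (μ/d)Σ(1 - cos k_j) ≥ (2μ/π²d)|k|²`).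
[cite: LiuSlade2024, (1.11)] -/
theorem re_latticeFourier_lsA_ge (hd : 1 ≤ d) {μ : ℝ} (hμ0 : 0 ≤ μ) (hμ1 : μ ≤ 1) (t : 𝕋 d) :
    8 * μ / d * tnorm t ^ 2 ≤ (latticeFourier (lsA d μ) t).re := by
  obtain ⟨y, hy, hyt, hn⟩ := exists_rep_unitAddTorus t
  have hd0 : (0 : ℝ) < d := by exact_mod_cast hd
  have htn : tnorm t ^ 2 = ∑ i, y i ^ 2 := by
    rw [tnorm_sq]; exact Finset.sum_congr rfl fun i _ => by rw [hn i, sq_abs]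
  have hD : 1 - (latticeFourier (srwStep d) t).re = dispersion ((-(2 * π)) • y) / d := by
    rw [← hyt, latticeFourier_coe_eq_latticeFT, one_sub_re_latticeFT_srwStep hd]
  have hdisp : 8 * ∑ i, y i ^ 2 ≤ dispersion ((-(2 * π)) • y) := by
    rw [dispersion, Finset.mul_sum]
    refine Finset.sum_le_sum fun i _ => ?_
    have h := eight_sq_le_one_sub_cos (hy i)
    have e : Real.cos (((-(2 * π)) • y) i) = Real.cos (2 * π * y i) := by
      rw [Pi.smul_apply, smul_eq_mul, neg_mul, Real.cos_neg]
    rw [e]; exact h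
  rw [latticeFourier_lsA, Complex.sub_re, Complex.one_re, Complex.re_ofReal_mul]
  have hre : (latticeFourier (srwStep d) t).re = 1 - dispersion ((-(2 * π)) • y) / d := by linarith
  rw [hre, htn]
  have : 8 * μ / d * ∑ i, y i ^ 2 ≤ μ * (dispersion ((-(2 * π)) • y) / d) := by
    rw [show 8 * μ / d * ∑ i, y i ^ 2 = μ * ((8 * ∑ i, y i ^ 2) / d) by ring]
    gcongr
  nlinarith [this, hμ0, hμ1, dispersion_nonneg ((-(2 * π)) • y)]

/-- `Â_μ` is real. [folklore] -/
theorem latticeFourier_lsA_im (μ : ℝ) (t : 𝕋 d) : (latticeFourier (lsA d μ) t).im = 0 :=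
  latticeFourier_im (summable_abs_of_decay (abs_lsA_le μ ((d : ℝ) + 1)) (by linarith))
    (fun x => (isZdSymmetric_lsA μ).neg x) t

/-- The `ℓ¹` mass of the coefficients of `Â_δ`: `Σ_x |(2πi x)^δ A_μ(x)| ≤ (2π)^{|δ|}(1 + |μ|) Z_{d+1}`.
[folklore] -/
theorem tsum_norm_coefW_lsA_le (μ : ℝ) (w : List (Fin d)) :
    ∑' x, ‖coefW (lsA d μ) w x‖ ≤ (2 * π) ^ w.length * (1 + |μ|) * ∑' x : Site d, jnorm x ^ (-((d : ℝ) + 1)) := by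
  have h := tsum_norm_coefW_le (abs_lsA_le μ (w.length + ((d : ℝ) + 1))) w (by linarith)
  have e : (w.length + ((d : ℝ) + 1)) - w.length = (d : ℝ) + 1 := by ring
  rwa [e] at h

/-- The coefficient families of the finitely supported `A_μ` are summable. [folklore] -/
theorem summable_norm_coefW_lsA (μ : ℝ) (w : List (Fin d)) : Summable fun x => ‖coefW (lsA d μ) w x‖ :=
  summable_norm_coefW (abs_lsA_le μ (w.length + ((d : ℝ) + 1))) w (by linarith)

/-! ### Elementary trigonometric Taylor bounds in Hölder form (for Lemma 2.2) -/

/-- `|sin u - u| ≤ 2|u|^{1+θ}` for `0 ≤ θ ≤ 2`. [cite: LiuSlade2024, proof of Lemma 2.2 ("inequalities such as |cos t - 1 + t²/2| ≲ |t|^{2+τ}")] -/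
theorem abs_sin_sub_self_le (u : ℝ) {θ : ℝ} (hθ0 : 0 ≤ θ) (hθ2 : θ ≤ 2) :
    |Real.sin u - u| ≤ 2 * |u| ^ (1 + θ) := by
  -- reduce to `u ≥ 0` by oddness
  wlog hu : 0 ≤ u generalizing u
  · have h := this (-u) (by linarith)
    rw [Real.sin_neg, abs_neg] at h
    calc |Real.sin u - u| = |-Real.sin u - -u| := by rw [← abs_neg]; ring_nf
      _ ≤ 2 * |u| ^ (1 + θ) := h
  rw [abs_of_nonneg hu]
  rcases hu.eq_or_lt with h0 | hpos
  · subst h0; simp [Real.zero_rpow (by linarith : (1 : ℝ) + θ ≠ 0)]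
  have h1 : |Real.sin u - u| ≤ u ^ 3 / 6 := by
    rw [abs_sub_comm, abs_of_nonneg (by linarith [Real.sin_le hpos.le])]
    linarith [Real.sin_gt_sub_cube hpos]
  have h2 : |Real.sin u - u| ≤ 2 * u := by
    calc |Real.sin u - u| ≤ |Real.sin u| + |u| := abs_sub _ _
      _ ≤ |u| + |u| := add_le_add Real.abs_sin_le_abs le_rfl
      _ = 2 * u := by rw [abs_of_nonneg hpos.le]; ring
  rcases le_or_gt u 1 with hle | hgt
  · calc |Real.sin u - u| ≤ u ^ 3 / 6 := h1
      _ ≤ u ^ (3 : ℝ) := by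
          rw [show u ^ (3 : ℝ) = u ^ 3 by exact_mod_cast Real.rpow_natCast u 3]
          linarith [pow_nonneg hpos.le 3]
      _ ≤ u ^ (1 + θ) := Real.rpow_le_rpow_of_exponent_ge hpos hle (by linarith)
      _ ≤ 2 * u ^ (1 + θ) := by linarith [Real.rpow_nonneg hpos.le (1 + θ)]
  · calc |Real.sin u - u| ≤ 2 * u := h2
      _ = 2 * u ^ (1 : ℝ) := by rw [Real.rpow_one]
      _ ≤ 2 * u ^ (1 + θ) :=
          mul_le_mul_of_nonneg_left (Real.rpow_le_rpow_of_exponent_le hgt.le (by linarith)) (by norm_num)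

/-- `|cos u - 1| ≤ 2|u|^θ` for `0 ≤ θ ≤ 2`. [cite: LiuSlade2024, proof of Lemma 2.2] -/
theorem abs_cos_sub_one_le (u : ℝ) {θ : ℝ} (hθ0 : 0 ≤ θ) (hθ2 : θ ≤ 2) :
    |Real.cos u - 1| ≤ 2 * |u| ^ θ := by
  have hc : |Real.cos u - 1| = 1 - Real.cos u := by
    rw [abs_sub_comm, abs_of_nonneg (by linarith [Real.cos_le_one u])]
  rw [hc]
  rcases le_or_gt |u| 1 with hle | hgt
  · rcases (abs_nonneg u).eq_or_lt with h0 | hpos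
    · have : u = 0 := abs_eq_zero.1 h0.symm
      subst this
      rcases hθ0.eq_or_lt with hθ | hθ
      · subst hθ; simp
      · simp [Real.zero_rpow hθ.ne']
    calc 1 - Real.cos u ≤ u ^ 2 / 2 := one_sub_cos_le u
      _ ≤ |u| ^ 2 := by rw [← sq_abs]; linarith [sq_nonneg |u|]
      _ = |u| ^ (2 : ℝ) := by exact_mod_cast (Real.rpow_natCast |u| 2).symm
      _ ≤ |u| ^ θ := Real.rpow_le_rpow_of_exponent_ge hpos hle hθ2
      _ ≤ 2 * |u| ^ θ := by linarith [Real.rpow_nonneg (abs_nonneg u) θ]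
  · calc 1 - Real.cos u ≤ 2 := by linarith [Real.neg_one_le_cos u]
      _ ≤ 2 * |u| ^ θ := by
          have : (1 : ℝ) ≤ |u| ^ θ := Real.one_le_rpow hgt.le hθ0
          linarith

/-- `|sin u| ≤ |u|^θ` for `0 ≤ θ ≤ 1`. [cite: LiuSlade2024, proof of Lemma 2.2] -/
theorem abs_sin_le_rpow (u : ℝ) {θ : ℝ} (hθ0 : 0 ≤ θ) (hθ1 : θ ≤ 1) : |Real.sin u| ≤ |u| ^ θ := by
  rcases le_or_gt |u| 1 with hle | hgt
  · rcases (abs_nonneg u).eq_or_lt with h0 | hpos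
    · have : u = 0 := abs_eq_zero.1 h0.symm
      subst this
      simp [Real.rpow_nonneg]
    calc |Real.sin u| ≤ |u| := Real.abs_sin_le_abs
      _ = |u| ^ (1 : ℝ) := (Real.rpow_one _).symm
      _ ≤ |u| ^ θ := Real.rpow_le_rpow_of_exponent_ge hpos hle hθ1
  · calc |Real.sin u| ≤ 1 := Real.abs_sin_le_one u
      _ ≤ |u| ^ θ := Real.one_le_rpow hgt.le hθ0

/-! ### Symmetrisation of lattice series under `x ↦ -x` -/

/-- A series with odd terms vanishes. [folklore] -/
theorem tsum_eq_zero_of_odd {g : Site d → ℂ} (h : ∀ x, g (-x) = -g x) : ∑' x, g x = 0 := by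
  have h1 : ∑' x, g x = ∑' x, g (-x) := ((Equiv.neg (Site d)).tsum_eq g).symm
  rw [tsum_congr h, tsum_neg] at h1
  have h2 : (2 : ℂ) * ∑' x, g x = 0 := by rw [two_mul]; nth_rw 2 [h1]; ring
  simpa using h2

/-- A real series with odd terms vanishes. [folklore] -/
theorem tsum_eq_zero_of_odd_real {g : Site d → ℝ} (h : ∀ x, g (-x) = -g x) : ∑' x, g x = 0 := by
  have h1 : ∑' x, g x = ∑' x, g (-x) := ((Equiv.neg (Site d)).tsum_eq g).symm
  rw [tsum_congr h, tsum_neg] at h1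
  linarith

/-- **Even symmetrisation**: for real even `a` and odd phases `u(-x) = -u(x)`,
`Σ_x a(x) e^{iu(x)} = Σ_x a(x) cos u(x)`. [folklore] -/
theorem tsum_ofReal_mul_cexp_of_even {a u : Site d → ℝ} (ha : Summable fun x => |a x|)
    (hae : ∀ x, a (-x) = a x) (huo : ∀ x, u (-x) = -u x) :
    ∑' x, (a x : ℂ) * Complex.exp (Complex.I * (u x : ℂ)) = ((∑' x, a x * Real.cos (u x) : ℝ) : ℂ) := by
  have hc : Summable fun x => (a x : ℂ) * (Real.cos (u x) : ℂ) := by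
    refine ha.of_norm_bounded fun x => ?_
    rw [norm_mul, Complex.norm_real, Complex.norm_real, Real.norm_eq_abs, Real.norm_eq_abs]
    exact mul_le_of_le_one_right (abs_nonneg _) (Real.abs_cos_le_one _)
  have hs : Summable fun x => (a x : ℂ) * (Complex.I * (Real.sin (u x) : ℂ)) := by
    refine ha.of_norm_bounded fun x => ?_
    rw [norm_mul, norm_mul, Complex.norm_I, one_mul, Complex.norm_real, Complex.norm_real,
      Real.norm_eq_abs, Real.norm_eq_abs]
    exact mul_le_of_le_one_right (abs_nonneg _) (Real.abs_sin_le_one _)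
  have e : ∀ x, (a x : ℂ) * Complex.exp (Complex.I * (u x : ℂ)) =
      (a x : ℂ) * (Real.cos (u x) : ℂ) + (a x : ℂ) * (Complex.I * (Real.sin (u x) : ℂ)) := by
    intro x
    rw [mul_comm Complex.I, Complex.exp_mul_I, Complex.ofReal_cos, Complex.ofReal_sin]; ring
  rw [tsum_congr e, Summable.tsum_add hc hs]
  have hodd : ∑' x, (a x : ℂ) * (Complex.I * (Real.sin (u x) : ℂ)) = 0 :=
    tsum_eq_zero_of_odd fun x => by rw [hae, huo, Real.sin_neg]; push_cast; ring
  rw [hodd, add_zero, Complex.ofReal_tsum]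
  exact tsum_congr fun x => by push_cast; ring

/-- **Odd symmetrisation**: for real odd `a` and odd phases,
`Σ_x a(x) e^{iu(x)} = i Σ_x a(x) sin u(x)`. [folklore] -/
theorem tsum_ofReal_mul_cexp_of_odd {a u : Site d → ℝ} (ha : Summable fun x => |a x|)
    (hao : ∀ x, a (-x) = -a x) (huo : ∀ x, u (-x) = -u x) :
    ∑' x, (a x : ℂ) * Complex.exp (Complex.I * (u x : ℂ)) =
      Complex.I * ((∑' x, a x * Real.sin (u x) : ℝ) : ℂ) := by
  have hc : Summable fun x => (a x : ℂ) * (Real.cos (u x) : ℂ) := by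
    refine ha.of_norm_bounded fun x => ?_
    rw [norm_mul, Complex.norm_real, Complex.norm_real, Real.norm_eq_abs, Real.norm_eq_abs]
    exact mul_le_of_le_one_right (abs_nonneg _) (Real.abs_cos_le_one _)
  have hs : Summable fun x => (a x : ℂ) * (Complex.I * (Real.sin (u x) : ℂ)) := by
    refine ha.of_norm_bounded fun x => ?_
    rw [norm_mul, norm_mul, Complex.norm_I, one_mul, Complex.norm_real, Complex.norm_real,
      Real.norm_eq_abs, Real.norm_eq_abs]
    exact mul_le_of_le_one_right (abs_nonneg _) (Real.abs_sin_le_one _)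
  have e : ∀ x, (a x : ℂ) * Complex.exp (Complex.I * (u x : ℂ)) =
      (a x : ℂ) * (Real.cos (u x) : ℂ) + (a x : ℂ) * (Complex.I * (Real.sin (u x) : ℂ)) := by
    intro x
    rw [mul_comm Complex.I, Complex.exp_mul_I, Complex.ofReal_cos, Complex.ofReal_sin]; ring
  rw [tsum_congr e, Summable.tsum_add hc hs]
  have hodd : ∑' x, (a x : ℂ) * (Real.cos (u x) : ℂ) = 0 :=
    tsum_eq_zero_of_odd fun x => by rw [hao, huo, Real.cos_neg]; push_cast; ring
  rw [hodd, zero_add, Complex.ofReal_tsum, ← tsum_mul_left]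
  exact tsum_congr fun x => by push_cast; ring

/-! ### Liu–Slade 2024, Lemma 2.2 on the torus: `|Ê_β(t)| ≲ K ϱ(t)^{2+σ-|β|}` for `|β| < 2 + σ`

Throughout: `E` is `ℤ^d`-symmetric with `|E(x)| ≤ K⟦x⟧^{-(d+2+ρ)}` and vanishing zeroth and second
moments, `0 < σ < ρ`, `σ ≤ 2`; `u_x = 2π y·x` for a centred representative `y` of `t`, so that
`|u_x| ≤ 2π ϱ(t)|x|`. -/

section Lemma22

variable {E : Site d → ℝ} {K ρ σ : ℝ}

/-- Preliminaries: summability of the moments used below. [folklore] -/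
theorem summable_moment_of_decay (hE : ∀ x, |E x| ≤ K / jnorm x ^ ((d : ℝ) + 2 + ρ)) {a : ℝ}
    (ha0 : 0 ≤ a) (ha : a < 2 + ρ) : Summable fun x => euclidNorm x ^ a * |E x| :=
  summable_rpow_mul_abs_of_decay hE ha0 (by linarith)

/-- `Σ |x|²|E(x)| < ∞` when `|E(x)| ≤ K⟦x⟧^{-(d+2+ρ)}`, `ρ > 0`. [folklore] -/
theorem summable_sq_moment_of_decay (hE : ∀ x, |E x| ≤ K / jnorm x ^ ((d : ℝ) + 2 + ρ)) (hρ : 0 < ρ) :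
    Summable fun x => euclidNorm x ^ 2 * |E x| := by
  have h := summable_moment_of_decay hE (a := 2) (by norm_num) (by linarith)
  refine h.congr fun x => ?_
  rw [show euclidNorm x ^ (2 : ℝ) = euclidNorm x ^ 2 by exact_mod_cast Real.rpow_natCast (euclidNorm x) 2]

/-- All second moments vanish: `Σ_x xᵢ xⱼ E(x) = 0`. [cite: LiuSlade2024, proof of Lemma 2.2 ("Σ xᵢxⱼE(x) = 0 for i ≠ j … Σ xᵢ²E(x) = 0 for all i")] -/
theorem tsum_apply_mul_apply_mul_eq_zero_of_moments (hEs : IsZdSymmetric E)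
    (hE : ∀ x, |E x| ≤ K / jnorm x ^ ((d : ℝ) + 2 + ρ)) (hρ : 0 < ρ)
    (h2 : ∑' x, euclidNorm x ^ 2 * E x = 0) (i j : Fin d) :
    ∑' x, ((x i : ℤ) : ℝ) * ((x j : ℤ) : ℝ) * E x = 0 := by
  by_cases hij : i = j
  · subst hij
    have h := tsum_sq_apply_mul_eq hEs (summable_sq_moment_of_decay hE hρ) i
    rw [h2, zero_div] at h
    rw [← h]
    exact tsum_congr fun x => by ring
  · exact tsum_apply_mul_apply_mul_eq_zero hEs hij

/-- The linear moment against `y·x` vanishes: `Σ_x (y·x) xⱼ E(x) = 0`. [cite: LiuSlade2024, proof of Lemma 2.2] -/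
theorem tsum_kdot_mul_apply_mul_eq_zero (hEs : IsZdSymmetric E)
    (hE : ∀ x, |E x| ≤ K / jnorm x ^ ((d : ℝ) + 2 + ρ)) (hρ : 0 < ρ)
    (h2 : ∑' x, euclidNorm x ^ 2 * E x = 0) (y : Fin d → ℝ) (j : Fin d) :
    ∑' x, kdot y x * ((x j : ℤ) : ℝ) * E x = 0 := by
  have hs : ∀ i, Summable fun x => y i * (((x i : ℤ) : ℝ) * ((x j : ℤ) : ℝ) * E x) := fun i =>
    (summable_apply_mul_apply_mul (summable_sq_moment_of_decay hE hρ) i j).mul_left _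
  have e : ∀ x, kdot y x * ((x j : ℤ) : ℝ) * E x = ∑ i, y i * (((x i : ℤ) : ℝ) * ((x j : ℤ) : ℝ) * E x) := by
    intro x
    rw [kdot, Finset.sum_mul, Finset.sum_mul]
    exact Finset.sum_congr rfl fun i _ => by ring
  rw [tsum_congr e, Summable.tsum_finsetSum (fun i _ => hs i)]
  refine Finset.sum_eq_zero fun i _ => ?_
  rw [tsum_mul_left, tsum_apply_mul_apply_mul_eq_zero_of_moments hEs hE hρ h2, mul_zero]

/-- The quadratic moment against `(y·x)²` vanishes: `Σ_x (y·x)² E(x) = 0`. [cite: LiuSlade2024, proof of Lemma 2.2] -/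
theorem tsum_kdot_sq_mul_eq_zero (hEs : IsZdSymmetric E)
    (hE : ∀ x, |E x| ≤ K / jnorm x ^ ((d : ℝ) + 2 + ρ)) (hρ : 0 < ρ)
    (h2 : ∑' x, euclidNorm x ^ 2 * E x = 0) (y : Fin d → ℝ) :
    ∑' x, kdot y x ^ 2 * E x = 0 := by
  rw [tsum_kdot_sq_mul hEs (summable_sq_moment_of_decay hE hρ) y, h2, mul_zero]

/-- The phases `u_x = 2π y·x` are odd and `|u_x| ≤ 2πϱ(t)|x|`. [folklore] -/
theorem abs_phase_le {t : 𝕋 d} {y : Fin d → ℝ} (htn : tnorm t = knorm y) (x : Site d) :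
    |2 * π * kdot y x| ≤ 2 * π * tnorm t * euclidNorm x := by
  rw [abs_mul, abs_of_pos (by positivity : (0 : ℝ) < 2 * π), htn]
  calc 2 * π * |kdot y x| ≤ 2 * π * (knorm y * euclidNorm x) :=
        mul_le_mul_of_nonneg_left (abs_kdot_le y x) (by positivity)
    _ = 2 * π * knorm y * euclidNorm x := by ring

/-- `|u|^e ≤ (2πϱ)^e |x|^e` from `|u| ≤ 2πϱ|x|`. [folklore] -/
theorem phase_rpow_le {t : 𝕋 d} {y : Fin d → ℝ} (htn : tnorm t = knorm y) (x : Site d) {e : ℝ} (he : 0 ≤ e) :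
    |2 * π * kdot y x| ^ e ≤ (2 * π * tnorm t) ^ e * euclidNorm x ^ e := by
  rw [← Real.mul_rpow (mul_nonneg (mul_nonneg two_pos.le Real.pi_pos.le) (tnorm_nonneg t)) (euclidNorm_nonneg x)]
  exact Real.rpow_le_rpow (abs_nonneg _) (abs_phase_le htn x) he

/-- **Lemma 2.2, `|β| = 0`**: `|Ê(t)| ≤ (5/2)(2πϱ)^{2+σ} Σ|x|^{2+σ}|E|`. [cite: LiuSlade2024, Lemma 2.2 (case |α| = 0)] -/
theorem lemma22_nil (hEs : IsZdSymmetric E) (hE : ∀ x, |E x| ≤ K / jnorm x ^ ((d : ℝ) + 2 + ρ))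
    (h0 : ∑' x, E x = 0) (h2 : ∑' x, euclidNorm x ^ 2 * E x = 0)
    (hσ0 : 0 < σ) (hσρ : σ < ρ) (hσ2 : σ ≤ 2) (t : 𝕋 d) :
    ‖dFT (coefW E []) t‖ ≤ 5 / 2 * (2 * π * tnorm t) ^ (2 + σ) * ∑' x, euclidNorm x ^ (2 + σ) * |E x| := by
  have hρ : 0 < ρ := hσ0.trans hσρ
  obtain ⟨y, hyt, -, htn⟩ := exists_rep t
  have hEsum : Summable fun x => |E x| := summable_abs_of_decay hE (by linarith)
  have hEσ : Summable fun x => euclidNorm x ^ (2 + σ) * |E x| :=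
    summable_moment_of_decay hE (by linarith) (by linarith)
  set u : Site d → ℝ := fun x => 2 * π * kdot y x with hu
  have huo : ∀ x, u (-x) = -u x := fun x => by simp [hu, Literature.Probability.Percolation.kdot_neg]
  have hsum : Summable fun x => ‖coefW E [] x‖ := by simpa [coefW_nil] using hEsum
  -- pass to the real cosine series
  have hser : dFT (coefW E []) t = ((∑' x, E x * Real.cos (u x) : ℝ) : ℂ) := by
    rw [← hyt, dFT_eq_tsum_cexp hsum]
    simp only [coefW_nil]
    exact tsum_ofReal_mul_cexp_of_even hEsum (fun x => hEs.neg x) huo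
  rw [hser, Complex.norm_real, Real.norm_eq_abs]
  -- subtract the vanishing Taylor polynomial `1 - u²/2`
  have hquad : ∑' x, u x ^ 2 * E x = 0 := by
    have e : ∀ x, u x ^ 2 * E x = (2 * π) ^ 2 * (kdot y x ^ 2 * E x) := fun x => by simp only [hu]; ring
    rw [tsum_congr e, tsum_mul_left, tsum_kdot_sq_mul_eq_zero hEs hE hρ h2 y, mul_zero]
  have hR : ∀ x, |E x * (Real.cos (u x) - 1 + u x ^ 2 / 2)| ≤ 5 / 2 * (2 * π * tnorm t) ^ (2 + σ) * (euclidNorm x ^ (2 + σ) * |E x|) := by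
    intro x
    rw [abs_mul]
    have h1 : |Real.cos (u x) - 1 + u x ^ 2 / 2| ≤ 5 / 2 * |u x| ^ (2 + σ) := by
      rw [show Real.cos (u x) - 1 + u x ^ 2 / 2 = -(1 - Real.cos (u x) - u x ^ 2 / 2) by ring, abs_neg]
      exact abs_one_sub_cos_sub_sq_le (u x) hσ0.le hσ2
    have h2' := phase_rpow_le htn x (by linarith : (0 : ℝ) ≤ 2 + σ)
    calc |E x| * |Real.cos (u x) - 1 + u x ^ 2 / 2| ≤ |E x| * (5 / 2 * ((2 * π * tnorm t) ^ (2 + σ) * euclidNorm x ^ (2 + σ))) :=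
          mul_le_mul_of_nonneg_left (h1.trans (by gcongr)) (abs_nonneg _)
      _ = _ := by ring
  have hRs : Summable fun x => E x * (Real.cos (u x) - 1 + u x ^ 2 / 2) :=
    Summable.of_norm_bounded (hEσ.mul_left _) fun x => by rw [Real.norm_eq_abs]; exact hR x
  have hu2s : Summable fun x => u x ^ 2 * E x := by
    have h := (summable_sq_moment_of_decay hE hρ).mul_left ((2 * π * tnorm t) ^ 2)
    refine Summable.of_norm_bounded h fun x => ?_
    rw [Real.norm_eq_abs, abs_mul, ← mul_assoc]
    refine mul_le_mul ?_ le_rfl (abs_nonneg _) (by positivity)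
    rw [abs_pow, ← mul_pow]
    exact pow_le_pow_left₀ (abs_nonneg _) (abs_phase_le htn x) 2
  have hcs : Summable fun x => E x * Real.cos (u x) :=
    Summable.of_norm_bounded hEsum fun x => by
      rw [Real.norm_eq_abs, abs_mul]; exact mul_le_of_le_one_right (abs_nonneg _) (Real.abs_cos_le_one _)
  have key : ∑' x, E x * Real.cos (u x) = ∑' x, E x * (Real.cos (u x) - 1 + u x ^ 2 / 2) := by
    have e : ∀ x, E x * (Real.cos (u x) - 1 + u x ^ 2 / 2) = E x * Real.cos (u x) - E x + (1 / 2) * (u x ^ 2 * E x) := by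
      intro x; ring
    rw [tsum_congr e, Summable.tsum_add (hcs.sub hEsum.of_abs) (hu2s.mul_left _), Summable.tsum_sub hcs hEsum.of_abs,
      tsum_mul_left, h0, hquad]
    ring
  rw [key]
  calc |∑' x, E x * (Real.cos (u x) - 1 + u x ^ 2 / 2)|
      ≤ ∑' x, |E x * (Real.cos (u x) - 1 + u x ^ 2 / 2)| := by
        have h := norm_tsum_le_tsum_norm hRs.norm
        simpa only [Real.norm_eq_abs] using h
    _ ≤ ∑' x, 5 / 2 * (2 * π * tnorm t) ^ (2 + σ) * (euclidNorm x ^ (2 + σ) * |E x|) :=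
        Summable.tsum_le_tsum hR hRs.abs (hEσ.mul_left _)
    _ = 5 / 2 * (2 * π * tnorm t) ^ (2 + σ) * ∑' x, euclidNorm x ^ (2 + σ) * |E x| := tsum_mul_left

/-- `|x|^p · |x|^e = |x|^{p+e}` for the Euclidean length (`p + e ≠ 0`). [folklore] -/
theorem euclidNorm_pow_mul_rpow (x : Site d) (p : ℕ) {e : ℝ} (hpe : (p : ℝ) + e ≠ 0) :
    euclidNorm x ^ p * euclidNorm x ^ e = euclidNorm x ^ ((p : ℝ) + e) := by
  rw [← Real.rpow_natCast, ← Real.rpow_add' (euclidNorm_nonneg x) hpe]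

/-- **Lemma 2.2, `|β| = 1`**: `|Ê_j(t)| ≤ 4π(2πϱ)^{1+σ} Σ|x|^{2+σ}|E|`. [cite: LiuSlade2024, Lemma 2.2 (case |α| = 1)] -/
theorem lemma22_one (hEs : IsZdSymmetric E) (hE : ∀ x, |E x| ≤ K / jnorm x ^ ((d : ℝ) + 2 + ρ))
    (h2 : ∑' x, euclidNorm x ^ 2 * E x = 0)
    (hσ0 : 0 < σ) (hσρ : σ < ρ) (hσ2 : σ ≤ 2) (j : Fin d) (t : 𝕋 d) :
    ‖dFT (coefW E [j]) t‖ ≤ 4 * π * (2 * π * tnorm t) ^ (1 + σ) * ∑' x, euclidNorm x ^ (2 + σ) * |E x| := by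
  have hρ : 0 < ρ := hσ0.trans hσρ
  obtain ⟨y, hyt, -, htn⟩ := exists_rep t
  have hEsum : Summable fun x => |E x| := summable_abs_of_decay hE (by linarith)
  have hE1 : Summable fun x => euclidNorm x ^ (1 : ℝ) * |E x| := summable_moment_of_decay hE zero_le_one (by linarith)
  have hEσ : Summable fun x => euclidNorm x ^ (2 + σ) * |E x| :=
    summable_moment_of_decay hE (by linarith) (by linarith)
  set u : Site d → ℝ := fun x => 2 * π * kdot y x with hu
  have huo : ∀ x, u (-x) = -u x := fun x => by simp [hu, Literature.Probability.Percolation.kdot_neg]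
  -- the odd real family `a(x) = 2π x_j E(x)`
  set a : Site d → ℝ := fun x => 2 * π * ((x j : ℤ) : ℝ) * E x with ha
  have hao : ∀ x, a (-x) = -a x := fun x => by simp only [ha, hEs.neg x, Pi.neg_apply, Int.cast_neg]; ring
  have habs : ∀ x, |a x| ≤ 2 * π * (euclidNorm x ^ (1 : ℝ) * |E x|) := fun x => by
    rw [ha, abs_mul, abs_mul, abs_of_pos (by positivity : (0 : ℝ) < 2 * π), Real.rpow_one, mul_assoc]
    exact mul_le_mul_of_nonneg_left (mul_le_mul_of_nonneg_right (abs_apply_le_euclidNorm x j) (abs_nonneg _))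
      (by positivity)
  have has : Summable fun x => |a x| :=
    Summable.of_nonneg_of_le (fun x => abs_nonneg _) habs (hE1.mul_left _)
  have hcoef : ∀ x, coefW E [j] x = Complex.I * (a x : ℂ) := fun x => by
    simp only [coefW, monoW_cons, monoW_nil, ha]; push_cast; ring
  have hsum : Summable fun x => ‖coefW E [j] x‖ := by
    refine has.congr fun x => ?_
    rw [hcoef, norm_mul, Complex.norm_I, one_mul, Complex.norm_real, Real.norm_eq_abs]
  -- pass to the real sine series
  have hser : dFT (coefW E [j]) t = -((∑' x, a x * Real.sin (u x) : ℝ) : ℂ) := by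
    rw [← hyt, dFT_eq_tsum_cexp hsum]
    have e : ∀ x, coefW E _ x * Complex.exp (Complex.I * ((2 * π * kdot y x : ℝ) : ℂ)) =
        Complex.I * ((a x : ℂ) * Complex.exp (Complex.I * (u x : ℂ))) := fun x => by rw [hcoef, mul_assoc]
    rw [tsum_congr e, tsum_mul_left, tsum_ofReal_mul_cexp_of_odd has hao huo, ← mul_assoc, Complex.I_mul_I,
      neg_one_mul]
  rw [hser, norm_neg, Complex.norm_real, Real.norm_eq_abs]
  -- subtract the vanishing linear term
  have hlin : ∑' x, a x * u x = 0 := by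
    have e : ∀ x, a x * u x = (2 * π) ^ 2 * (kdot y x * ((x j : ℤ) : ℝ) * E x) := fun x => by
      simp only [ha, hu]; ring
    rw [tsum_congr e, tsum_mul_left, tsum_kdot_mul_apply_mul_eq_zero hEs hE hρ h2 y j, mul_zero]
  have hR : ∀ x, |a x * (Real.sin (u x) - u x)| ≤ 4 * π * (2 * π * tnorm t) ^ (1 + σ) * (euclidNorm x ^ (2 + σ) * |E x|) := by
    intro x
    rw [abs_mul]
    have h1 : |Real.sin (u x) - u x| ≤ 2 * |u x| ^ (1 + σ) := abs_sin_sub_self_le (u x) hσ0.le hσ2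
    have h2' := phase_rpow_le htn x (by linarith : (0 : ℝ) ≤ 1 + σ)
    have h3 : euclidNorm x ^ (1 : ℝ) * euclidNorm x ^ (1 + σ) = euclidNorm x ^ (2 + σ) := by
      rw [← Real.rpow_add' (euclidNorm_nonneg x) (by linarith)]; ring_nf
    calc |a x| * |Real.sin (u x) - u x|
        ≤ (2 * π * (euclidNorm x ^ (1 : ℝ) * |E x|)) * (2 * ((2 * π * tnorm t) ^ (1 + σ) * euclidNorm x ^ (1 + σ))) :=
          mul_le_mul (habs x) (h1.trans (by gcongr)) (abs_nonneg _)
            (by have := euclidNorm_nonneg x; positivity)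
      _ = 4 * π * (2 * π * tnorm t) ^ (1 + σ) * ((euclidNorm x ^ (1 : ℝ) * euclidNorm x ^ (1 + σ)) * |E x|) := by ring
      _ = _ := by rw [h3]
  have hRs : Summable fun x => a x * (Real.sin (u x) - u x) :=
    Summable.of_norm_bounded (hEσ.mul_left _) fun x => by rw [Real.norm_eq_abs]; exact hR x
  have haus : Summable fun x => a x * u x := by
    have h := (summable_sq_moment_of_decay hE hρ).mul_left (2 * π * (2 * π * tnorm t))
    refine Summable.of_norm_bounded h fun x => ?_
    rw [Real.norm_eq_abs, abs_mul]
    calc |a x| * |u x| ≤ (2 * π * (euclidNorm x ^ (1 : ℝ) * |E x|)) * (2 * π * tnorm t * euclidNorm x) :=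
          mul_le_mul (habs x) (abs_phase_le htn x) (abs_nonneg _)
            (by have := euclidNorm_nonneg x; positivity)
      _ = 2 * π * (2 * π * tnorm t) * (euclidNorm x ^ 2 * |E x|) := by rw [Real.rpow_one]; ring
  have hss : Summable fun x => a x * Real.sin (u x) :=
    Summable.of_norm_bounded has fun x => by
      rw [Real.norm_eq_abs, abs_mul]; exact mul_le_of_le_one_right (abs_nonneg _) (Real.abs_sin_le_one _)
  have key : ∑' x, a x * Real.sin (u x) = ∑' x, a x * (Real.sin (u x) - u x) := by
    have e : ∀ x, a x * (Real.sin (u x) - u x) = a x * Real.sin (u x) - a x * u x := fun x => by ring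
    rw [tsum_congr e, Summable.tsum_sub hss haus, hlin, sub_zero]
  rw [key]
  calc |∑' x, a x * (Real.sin (u x) - u x)|
      ≤ ∑' x, |a x * (Real.sin (u x) - u x)| := by
        have h := norm_tsum_le_tsum_norm hRs.norm
        simpa only [Real.norm_eq_abs] using h
    _ ≤ ∑' x, 4 * π * (2 * π * tnorm t) ^ (1 + σ) * (euclidNorm x ^ (2 + σ) * |E x|) :=
        Summable.tsum_le_tsum hR hRs.abs (hEσ.mul_left _)
    _ = 4 * π * (2 * π * tnorm t) ^ (1 + σ) * ∑' x, euclidNorm x ^ (2 + σ) * |E x| := tsum_mul_left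

/-- **Lemma 2.2, `|β| = 2`**: `|Ê_{jl}(t)| ≤ 8π²(2πϱ)^{σ} Σ|x|^{2+σ}|E|`. [cite: LiuSlade2024, Lemma 2.2 (case |α| = 2)] -/
theorem lemma22_two (hEs : IsZdSymmetric E) (hE : ∀ x, |E x| ≤ K / jnorm x ^ ((d : ℝ) + 2 + ρ))
    (h2 : ∑' x, euclidNorm x ^ 2 * E x = 0)
    (hσ0 : 0 < σ) (hσρ : σ < ρ) (hσ2 : σ ≤ 2) (j l : Fin d) (t : 𝕋 d) :
    ‖dFT (coefW E [j, l]) t‖ ≤ 8 * π ^ 2 * (2 * π * tnorm t) ^ σ * ∑' x, euclidNorm x ^ (2 + σ) * |E x| := by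
  have hρ : 0 < ρ := hσ0.trans hσρ
  obtain ⟨y, hyt, -, htn⟩ := exists_rep t
  have hE2 : Summable fun x => euclidNorm x ^ 2 * |E x| := summable_sq_moment_of_decay hE hρ
  have hEσ : Summable fun x => euclidNorm x ^ (2 + σ) * |E x| :=
    summable_moment_of_decay hE (by linarith) (by linarith)
  set u : Site d → ℝ := fun x => 2 * π * kdot y x with hu
  have huo : ∀ x, u (-x) = -u x := fun x => by simp [hu, Literature.Probability.Percolation.kdot_neg]
  -- the even real family `a(x) = 4π² x_j x_l E(x)`
  set a : Site d → ℝ := fun x => 4 * π ^ 2 * (((x j : ℤ) : ℝ) * ((x l : ℤ) : ℝ) * E x) with ha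
  have hae : ∀ x, a (-x) = a x := fun x => by simp only [ha, hEs.neg x, Pi.neg_apply, Int.cast_neg]; ring
  have habs : ∀ x, |a x| ≤ 4 * π ^ 2 * (euclidNorm x ^ 2 * |E x|) := fun x => by
    rw [ha, abs_mul, abs_of_pos (by positivity : (0 : ℝ) < 4 * π ^ 2), abs_mul]
    exact mul_le_mul_of_nonneg_left (mul_le_mul_of_nonneg_right (abs_apply_mul_apply_le x j l) (abs_nonneg _))
      (by positivity)
  have has : Summable fun x => |a x| :=
    Summable.of_nonneg_of_le (fun x => abs_nonneg _) habs (hE2.mul_left _)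
  have hcoef : ∀ x, coefW E [j, l] x = -(a x : ℂ) := fun x => by
    simp only [coefW, monoW_cons, monoW_nil, ha]; push_cast
    have hI : Complex.I ^ 2 = -1 := Complex.I_sq
    linear_combination (4 * π ^ 2 * ((x j : ℂ) * (x l : ℂ) * (E x : ℂ))) * hI
  have hsum : Summable fun x => ‖coefW E [j, l] x‖ := by
    refine has.congr fun x => ?_
    rw [hcoef, norm_neg, Complex.norm_real, Real.norm_eq_abs]
  -- pass to the real cosine series
  have hser : dFT (coefW E [j, l]) t = -((∑' x, a x * Real.cos (u x) : ℝ) : ℂ) := by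
    rw [← hyt, dFT_eq_tsum_cexp hsum]
    simp only [hcoef, neg_mul]
    rw [tsum_neg]
    rw [show (fun x => (a x : ℂ) * Complex.exp (Complex.I * ((2 * π * kdot y x : ℝ) : ℂ))) =
      fun x => (a x : ℂ) * Complex.exp (Complex.I * (u x : ℂ)) from rfl,
      tsum_ofReal_mul_cexp_of_even has hae huo]
  rw [hser, norm_neg, Complex.norm_real, Real.norm_eq_abs]
  -- subtract the vanishing constant term
  have hconst : ∑' x, a x = 0 := by
    simp only [ha]
    rw [tsum_mul_left, tsum_apply_mul_apply_mul_eq_zero_of_moments hEs hE hρ h2 j l, mul_zero]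
  have hR : ∀ x, |a x * (Real.cos (u x) - 1)| ≤ 8 * π ^ 2 * (2 * π * tnorm t) ^ σ * (euclidNorm x ^ (2 + σ) * |E x|) := by
    intro x
    rw [abs_mul]
    have h1 : |Real.cos (u x) - 1| ≤ 2 * |u x| ^ σ := abs_cos_sub_one_le (u x) hσ0.le hσ2
    have h2' := phase_rpow_le htn x hσ0.le
    have h3 : euclidNorm x ^ 2 * euclidNorm x ^ σ = euclidNorm x ^ (2 + σ) := by
      rw [euclidNorm_pow_mul_rpow x 2 (by push_cast; linarith)]; push_cast; ring_nf
    calc |a x| * |Real.cos (u x) - 1|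
        ≤ (4 * π ^ 2 * (euclidNorm x ^ 2 * |E x|)) * (2 * ((2 * π * tnorm t) ^ σ * euclidNorm x ^ σ)) :=
          mul_le_mul (habs x) (h1.trans (by gcongr)) (abs_nonneg _) (by positivity)
      _ = 8 * π ^ 2 * (2 * π * tnorm t) ^ σ * ((euclidNorm x ^ 2 * euclidNorm x ^ σ) * |E x|) := by ring
      _ = _ := by rw [h3]
  have hRs : Summable fun x => a x * (Real.cos (u x) - 1) :=
    Summable.of_norm_bounded (hEσ.mul_left _) fun x => by rw [Real.norm_eq_abs]; exact hR x
  have hcs : Summable fun x => a x * Real.cos (u x) :=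
    Summable.of_norm_bounded has fun x => by
      rw [Real.norm_eq_abs, abs_mul]; exact mul_le_of_le_one_right (abs_nonneg _) (Real.abs_cos_le_one _)
  have key : ∑' x, a x * Real.cos (u x) = ∑' x, a x * (Real.cos (u x) - 1) := by
    have e : ∀ x, a x * (Real.cos (u x) - 1) = a x * Real.cos (u x) - a x := fun x => by ring
    rw [tsum_congr e, Summable.tsum_sub hcs has.of_abs, hconst, sub_zero]
  rw [key]
  calc |∑' x, a x * (Real.cos (u x) - 1)|
      ≤ ∑' x, |a x * (Real.cos (u x) - 1)| := by
        have h := norm_tsum_le_tsum_norm hRs.norm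
        simpa only [Real.norm_eq_abs] using h
    _ ≤ ∑' x, 8 * π ^ 2 * (2 * π * tnorm t) ^ σ * (euclidNorm x ^ (2 + σ) * |E x|) :=
        Summable.tsum_le_tsum hR hRs.abs (hEσ.mul_left _)
    _ = 8 * π ^ 2 * (2 * π * tnorm t) ^ σ * ∑' x, euclidNorm x ^ (2 + σ) * |E x| := tsum_mul_left

/-- `|xⱼ xₗ xₘ| ≤ |x|³`. [folklore] -/
theorem abs_apply_mul_apply_mul_apply_le (x : Site d) (j l m : Fin d) :
    |((x j : ℤ) : ℝ) * ((x l : ℤ) : ℝ) * ((x m : ℤ) : ℝ)| ≤ euclidNorm x ^ 3 := by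
  rw [abs_mul, pow_succ]
  exact mul_le_mul (abs_apply_mul_apply_le x j l) (abs_apply_le_euclidNorm x m) (abs_nonneg _) (by positivity)

/-- **Lemma 2.2, `|β| = 3`** (only when `σ > 1`): `|Ê_{jlm}(t)| ≤ 8π³(2πϱ)^{σ-1} Σ|x|^{2+σ}|E|`.
[cite: LiuSlade2024, Lemma 2.2 (case |α| = 3, "can only occur if σ ∈ (1,2]")] -/
theorem lemma22_three (hEs : IsZdSymmetric E) (hE : ∀ x, |E x| ≤ K / jnorm x ^ ((d : ℝ) + 2 + ρ))
    (hσ1 : 1 ≤ σ) (hσρ : σ < ρ) (hσ2 : σ ≤ 2) (j l m : Fin d) (t : 𝕋 d) :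
    ‖dFT (coefW E [j, l, m]) t‖ ≤ 8 * π ^ 3 * (2 * π * tnorm t) ^ (σ - 1) * ∑' x, euclidNorm x ^ (2 + σ) * |E x| := by
  obtain ⟨y, hyt, -, htn⟩ := exists_rep t
  have hE3 : Summable fun x => euclidNorm x ^ (3 : ℝ) * |E x| :=
    summable_moment_of_decay hE (by norm_num) (by linarith)
  have hEσ : Summable fun x => euclidNorm x ^ (2 + σ) * |E x| :=
    summable_moment_of_decay hE (by linarith) (by linarith)
  set u : Site d → ℝ := fun x => 2 * π * kdot y x with hu
  have huo : ∀ x, u (-x) = -u x := fun x => by simp [hu, Literature.Probability.Percolation.kdot_neg]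
  -- the odd real family `a(x) = -8π³ x_j x_l x_m E(x)`
  set a : Site d → ℝ := fun x => -(8 * π ^ 3) * (((x j : ℤ) : ℝ) * ((x l : ℤ) : ℝ) * ((x m : ℤ) : ℝ) * E x) with ha
  have hao : ∀ x, a (-x) = -a x := fun x => by simp only [ha, hEs.neg x, Pi.neg_apply, Int.cast_neg]; ring
  have habs : ∀ x, |a x| ≤ 8 * π ^ 3 * (euclidNorm x ^ (3 : ℝ) * |E x|) := fun x => by
    rw [ha, abs_mul, abs_neg, abs_of_pos (by positivity : (0 : ℝ) < 8 * π ^ 3), abs_mul,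
      show euclidNorm x ^ (3 : ℝ) = euclidNorm x ^ 3 by exact_mod_cast Real.rpow_natCast (euclidNorm x) 3]
    exact mul_le_mul_of_nonneg_left
      (mul_le_mul_of_nonneg_right (abs_apply_mul_apply_mul_apply_le x j l m) (abs_nonneg _)) (by positivity)
  have has : Summable fun x => |a x| :=
    Summable.of_nonneg_of_le (fun x => abs_nonneg _) habs (hE3.mul_left _)
  have hcoef : ∀ x, coefW E [j, l, m] x = Complex.I * (a x : ℂ) := fun x => by
    simp only [coefW, monoW_cons, monoW_nil, ha]; push_cast
    have hI : Complex.I ^ 2 = -1 := Complex.I_sq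
    linear_combination (8 * π ^ 3 * Complex.I * ((x j : ℂ) * (x l : ℂ) * (x m : ℂ) * (E x : ℂ))) * hI
  have hsum : Summable fun x => ‖coefW E [j, l, m] x‖ := by
    refine has.congr fun x => ?_
    rw [hcoef, norm_mul, Complex.norm_I, one_mul, Complex.norm_real, Real.norm_eq_abs]
  -- pass to the real sine series
  have hser : dFT (coefW E [j, l, m]) t = -((∑' x, a x * Real.sin (u x) : ℝ) : ℂ) := by
    rw [← hyt, dFT_eq_tsum_cexp hsum]
    have e : ∀ x, coefW E _ x * Complex.exp (Complex.I * ((2 * π * kdot y x : ℝ) : ℂ)) =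
        Complex.I * ((a x : ℂ) * Complex.exp (Complex.I * (u x : ℂ))) := fun x => by rw [hcoef, mul_assoc]
    rw [tsum_congr e, tsum_mul_left, tsum_ofReal_mul_cexp_of_odd has hao huo, ← mul_assoc, Complex.I_mul_I,
      neg_one_mul]
  rw [hser, norm_neg, Complex.norm_real, Real.norm_eq_abs]
  have hR : ∀ x, |a x * Real.sin (u x)| ≤ 8 * π ^ 3 * (2 * π * tnorm t) ^ (σ - 1) * (euclidNorm x ^ (2 + σ) * |E x|) := by
    intro x
    rw [abs_mul]
    have h1 : |Real.sin (u x)| ≤ |u x| ^ (σ - 1) := abs_sin_le_rpow (u x) (by linarith) (by linarith)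
    have h2' := phase_rpow_le htn x (by linarith : (0 : ℝ) ≤ σ - 1)
    have h3 : euclidNorm x ^ (3 : ℝ) * euclidNorm x ^ (σ - 1) = euclidNorm x ^ (2 + σ) := by
      rw [← Real.rpow_add' (euclidNorm_nonneg x) (by linarith)]; ring_nf
    calc |a x| * |Real.sin (u x)|
        ≤ (8 * π ^ 3 * (euclidNorm x ^ (3 : ℝ) * |E x|)) * ((2 * π * tnorm t) ^ (σ - 1) * euclidNorm x ^ (σ - 1)) :=
          mul_le_mul (habs x) (h1.trans h2') (abs_nonneg _)
            (by have := euclidNorm_nonneg x; positivity)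
      _ = 8 * π ^ 3 * (2 * π * tnorm t) ^ (σ - 1) * ((euclidNorm x ^ (3 : ℝ) * euclidNorm x ^ (σ - 1)) * |E x|) := by ring
      _ = _ := by rw [h3]
  have hRs : Summable fun x => a x * Real.sin (u x) :=
    Summable.of_norm_bounded (hEσ.mul_left _) fun x => by rw [Real.norm_eq_abs]; exact hR x
  calc |∑' x, a x * Real.sin (u x)|
      ≤ ∑' x, |a x * Real.sin (u x)| := by
        have h := norm_tsum_le_tsum_norm hRs.norm
        simpa only [Real.norm_eq_abs] using h
    _ ≤ ∑' x, 8 * π ^ 3 * (2 * π * tnorm t) ^ (σ - 1) * (euclidNorm x ^ (2 + σ) * |E x|) :=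
        Summable.tsum_le_tsum hR hRs.abs (hEσ.mul_left _)
    _ = 8 * π ^ 3 * (2 * π * tnorm t) ^ (σ - 1) * ∑' x, euclidNorm x ^ (2 + σ) * |E x| := tsum_mul_left

/-- The `(2+σ)`-moment against the decay: `Σ|x|^{2+σ}|E| ≤ K Σ⟦x⟧^{-(d+ρ-σ)}`. [cite: LiuSlade2024, proof of Lemma 2.2 (last display: Σ_{x≠0} |x|^{2+σ}/|x|^{d+2+ρ} converges since σ < ρ)] -/
theorem moment_le_of_decay (hE : ∀ x, |E x| ≤ K / jnorm x ^ ((d : ℝ) + 2 + ρ)) (hσ0 : 0 < σ) (hσρ : σ < ρ) :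
    ∑' x, euclidNorm x ^ (2 + σ) * |E x| ≤ K * ∑' x : Site d, jnorm x ^ (-((d : ℝ) + ρ - σ)) := by
  have hK : 0 ≤ K := by
    have h := (abs_nonneg _).trans (hE 0)
    simpa [jnorm, euclidNorm] using h
  rw [← tsum_mul_left]
  refine Summable.tsum_le_tsum (fun x => ?_) (summable_moment_of_decay hE (by linarith) (by linarith))
    ((summable_jnorm_rpow_neg (by linarith)).mul_left K)
  have hj := jnorm_pos x
  calc euclidNorm x ^ (2 + σ) * |E x| ≤ jnorm x ^ (2 + σ) * (K / jnorm x ^ ((d : ℝ) + 2 + ρ)) :=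
        mul_le_mul (euclidNorm_rpow_le_jnorm_rpow x (by linarith)) (hE x) (abs_nonneg _) (Real.rpow_nonneg hj.le _)
    _ = K * jnorm x ^ (-((d : ℝ) + ρ - σ)) := by
        rw [Real.rpow_neg hj.le, show (d : ℝ) + ρ - σ = ((d : ℝ) + 2 + ρ) - (2 + σ) by ring, Real.rpow_sub hj]
        field_simp

/-- Powers of `2π` up to the fourth: `(2π)^e ≤ 16π⁴` for `0 ≤ e ≤ 4`. [folklore] -/
theorem two_pi_rpow_le {e : ℝ} (he4 : e ≤ 4) : (2 * π) ^ e ≤ 16 * π ^ 4 := by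
  have h1 : (1 : ℝ) ≤ 2 * π := by linarith [Real.pi_gt_three]
  calc (2 * π) ^ e ≤ (2 * π) ^ (4 : ℝ) := Real.rpow_le_rpow_of_exponent_le h1 he4
    _ = 16 * π ^ 4 := by
        rw [show ((4 : ℝ)) = ((4 : ℕ) : ℝ) by norm_num, Real.rpow_natCast]; ring

/-- **Liu–Slade 2024, Lemma 2.2 (torus form).** For a `ℤ^d`-symmetric `E` with
`|E(x)| ≤ K⟦x⟧^{-(d+2+ρ)}` and vanishing zeroth and second moments, `0 < σ < ρ`, `σ ≤ 2`, and a
word `β` with `|β| < 2 + σ`: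
`|Ê_β(t)| ≤ 128π⁷ (Σ_x |x|^{2+σ}|E(x)|) ϱ(t)^{2+σ-|β|}` (the source's `|Ê_α(k)| ≤ cK|k|^{2+σ-|α|}`
in the coordinate `t = k/2π`, the constant made explicit). [cite: LiuSlade2024, Lemma 2.2] -/
theorem lemma22 (hEs : IsZdSymmetric E) (hE : ∀ x, |E x| ≤ K / jnorm x ^ ((d : ℝ) + 2 + ρ))
    (h0 : ∑' x, E x = 0) (h2 : ∑' x, euclidNorm x ^ 2 * E x = 0)
    (hσ0 : 0 < σ) (hσρ : σ < ρ) (hσ2 : σ ≤ 2) {β : List (Fin d)} (hβ : (β.length : ℝ) < 2 + σ) (t : 𝕋 d) :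
    ‖dFT (coefW E β) t‖ ≤
      128 * π ^ 7 * (∑' x, euclidNorm x ^ (2 + σ) * |E x|) * tnorm t ^ (2 + σ - β.length) := by
  set M := ∑' x, euclidNorm x ^ (2 + σ) * |E x| with hM
  have hM0 : 0 ≤ M := tsum_nonneg fun x => mul_nonneg (Real.rpow_nonneg (euclidNorm_nonneg x) _) (abs_nonneg _)
  have hπ1 : (1 : ℝ) ≤ π := by linarith [Real.pi_gt_three]
  have hπ3 : (1 : ℝ) ≤ π ^ 3 := one_le_pow₀ hπ1
  have htn := tnorm_nonneg t
  -- split `(2πϱ)^e = (2π)^e ϱ^e` and bound `c (2π)^e ≤ 128π⁷` for `c ≤ 8π³`, `e ≤ 4`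
  have hbound : ∀ {c e : ℝ}, 0 ≤ c → c ≤ 8 * π ^ 3 → 0 ≤ e → e ≤ 4 →
      c * (2 * π * tnorm t) ^ e * M ≤ 128 * π ^ 7 * M * tnorm t ^ e := by
    intro c e hc0 hc he0 he4
    rw [Real.mul_rpow (by positivity : (0 : ℝ) ≤ 2 * π) htn]
    have h := two_pi_rpow_le he4
    calc c * ((2 * π) ^ e * tnorm t ^ e) * M = (c * (2 * π) ^ e) * (M * tnorm t ^ e) := by ring
      _ ≤ (8 * π ^ 3 * (16 * π ^ 4)) * (M * tnorm t ^ e) :=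
          mul_le_mul_of_nonneg_right (mul_le_mul hc h (Real.rpow_nonneg (by positivity) e) (by positivity))
            (mul_nonneg hM0 (Real.rpow_nonneg htn e))
      _ = 128 * π ^ 7 * M * tnorm t ^ e := by ring
  have hππ3 : π ≤ π ^ 3 := le_self_pow₀ hπ1 (by norm_num)
  have hπ2π3 : π ^ 2 ≤ π ^ 3 := pow_le_pow_right₀ hπ1 (by norm_num)
  match β, hβ with
  | [], _ =>
    have h := lemma22_nil hEs hE h0 h2 hσ0 hσρ hσ2 t
    simp only [List.length_nil, Nat.cast_zero, sub_zero]
    exact h.trans (hbound (by norm_num) (by linarith) (by linarith) (by linarith))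
  | [j], _ =>
    have h := lemma22_one hEs hE h2 hσ0 hσρ hσ2 j t
    rw [show (2 : ℝ) + σ - (([j] : List (Fin d)).length : ℕ) = 1 + σ by norm_num; ring]
    exact h.trans (hbound (by positivity) (by linarith [Real.pi_pos]) (by linarith) (by linarith))
  | [j, l], _ =>
    have h := lemma22_two hEs hE h2 hσ0 hσρ hσ2 j l t
    rw [show (2 : ℝ) + σ - (([j, l] : List (Fin d)).length : ℕ) = σ by norm_num]
    exact h.trans (hbound (by positivity) (by linarith) hσ0.le (by linarith))
  | [j, l, m], hβ =>
    have hσ1 : 1 ≤ σ := by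
      simp only [List.length_cons, List.length_nil] at hβ; push_cast at hβ; linarith
    have h := lemma22_three hEs hE hσ1 hσρ hσ2 j l m t
    rw [show (2 : ℝ) + σ - (([j, l, m] : List (Fin d)).length : ℕ) = σ - 1 by norm_num; ring]
    exact h.trans (hbound (by positivity) le_rfl (by linarith) (by linarith))
  | _ :: _ :: _ :: _ :: w, hβ =>
    exfalso
    simp only [List.length_cons] at hβ; push_cast at hβ
    have : (0 : ℝ) ≤ w.length := Nat.cast_nonneg _
    linarith

end Lemma22

/-! ### (1.10): the infrared bound forces `F'' ≥ dK₂/(2π²)` -/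

section Fpp

variable {K₁ K₂ ρ : ℝ} {F : Site d → ℝ}

/-- Summability consequences of the decay in Assumption 1.1. [folklore] -/
theorem LS24Assumption.summable_abs (hF : LS24Assumption d K₁ K₂ ρ F) (hρ : 0 < ρ) :
    Summable fun x => |F x| :=
  summable_abs_of_decay hF.2.1 (by linarith)

/-- Under Assumption 1.1 the second moment `Σ|x|²|F(x)|` is finite ("(1.9) implies that `F` has finite second moment"). [cite: LiuSlade2024, §1.1 (after (1.10))] -/
theorem LS24Assumption.summable_sq_mul_abs (hF : LS24Assumption d K₁ K₂ ρ F) (hρ : 0 < ρ) :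
    Summable fun x => euclidNorm x ^ 2 * |F x| :=
  summable_sq_moment_of_decay hF.2.1 hρ

/-- The norm on `ℝ/ℤ` of a small real: `‖s‖ = |s|` for `|s| ≤ 1/2`. [folklore] -/
theorem norm_coe_unitAddCircle {s : ℝ} (hs : |s| ≤ 1 / 2) : ‖((s : ℝ) : UnitAddCircle)‖ = |s| :=
  (AddCircle.norm_coe_eq_abs_iff (p := (1 : ℝ)) one_ne_zero).2 (by simpa using hs)

/-- The infrared bound along the `j`-th axis: `Σ_x F(x)(1 - cos(2πs xⱼ)) ≤ -K₂ s²` for `|s| ≤ 1/2`.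
[cite: LiuSlade2024, Assumption 1.1 (infrared bound) and (1.10)] -/
theorem tsum_mul_one_sub_cos_axis_le (hF : LS24Assumption d K₁ K₂ ρ F) (hρ : 0 < ρ) (j : Fin d) {s : ℝ}
    (hs : |s| ≤ 1 / 2) :
    ∑' x, F x * (1 - Real.cos (2 * π * s * ((x j : ℤ) : ℝ))) ≤ -(K₂ * s ^ 2) := by
  have hsum := LS24Assumption.summable_abs hF hρ
  set y : Fin d → ℝ := Pi.single j s with hy
  set t : 𝕋 d := fun i => ((y i : ℝ) : UnitAddCircle) with ht
  -- `Σ ‖tᵢ‖² = s²`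
  have hnorm : ∑ i, ‖t i‖ ^ 2 = s ^ 2 := by
    rw [Finset.sum_eq_single j]
    · simp only [ht, hy, Pi.single_eq_same]; rw [norm_coe_unitAddCircle hs, sq_abs]
    · intro i _ hij
      simp [ht, hy, Pi.single_eq_of_ne hij]
    · intro h; exact absurd (Finset.mem_univ j) h
  -- `Re F̂(t) - Re F̂(0) = Σ F (cos - 1)`
  have hre : (latticeFourier F t).re = ∑' x, F x * Real.cos (2 * π * s * ((x j : ℤ) : ℝ)) := by
    rw [ht, latticeFourier_coe_eq_latticeFT, re_latticeFT hsum]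
    refine tsum_congr fun x => ?_
    rw [kdot_smul_left, hy, kdot_single, ← Real.cos_neg]
    ring_nf
  have hre0 : (latticeFourier F 0).re = ∑' x, F x := by
    rw [latticeFourier_zero, Complex.ofReal_re]
  have hcos : Summable fun x => F x * Real.cos (2 * π * s * ((x j : ℤ) : ℝ)) :=
    Summable.of_norm_bounded hsum fun x => by
      rw [Real.norm_eq_abs, abs_mul]; exact mul_le_of_le_one_right (abs_nonneg _) (Real.abs_cos_le_one _)
  have h := hF.2.2.2 t
  rw [hnorm, hre, hre0] at h
  have e : ∀ x, F x * (1 - Real.cos (2 * π * s * ((x j : ℤ) : ℝ))) = F x - F x * Real.cos (2 * π * s * ((x j : ℤ) : ℝ)) :=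
    fun x => by ring
  rw [tsum_congr e, Summable.tsum_sub hsum.of_abs hcos]
  linarith

/-- **(1.10) in the coordinate `t = k/2π`: `F'' ≥ dK₂/(2π²)`.** From the axis infrared bound divided by
`s²` and the limit `s ↓ 0` (Tannery / dominated convergence, dominated by `2π²xⱼ²|F(x)|`), using
`Σ_x xⱼ²F(x) = d⁻¹Σ_x|x|²F(x)` (symmetry). [cite: LiuSlade2024, (1.10) ("By Taylor's Theorem and Assumption 1.1, F'' = -Σ|x|²F(x) ∈ [2dK₂, ∞)")] -/
theorem ls24Fpp_ge_of_assumption (hd : 1 ≤ d) (hF : LS24Assumption d K₁ K₂ ρ F) (hρ : 0 < ρ) :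
    d * K₂ / (2 * π ^ 2) ≤ ls24Fpp F := by
  have hsum := LS24Assumption.summable_abs hF hρ
  have h2 := LS24Assumption.summable_sq_mul_abs hF hρ
  set j : Fin d := ⟨0, hd⟩ with hj
  have hd0 : (0 : ℝ) < d := by exact_mod_cast hd
  -- the functions `G(s) = Σ F(x)(1 - cos(2πs xⱼ))/s²` and their termwise limit
  set f : ℝ → Site d → ℝ := fun s x => F x * (1 - Real.cos (2 * π * s * ((x j : ℤ) : ℝ))) / s ^ 2 with hf
  set g : Site d → ℝ := fun x => 2 * π ^ 2 * (((x j : ℤ) : ℝ) ^ 2 * F x) with hg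
  set bound : Site d → ℝ := fun x => 2 * π ^ 2 * (euclidNorm x ^ 2 * |F x|) with hb
  have hbs : Summable bound := h2.mul_left _
  -- termwise convergence: `(1 - cos(cs))/s² → c²/2`
  have hlim : ∀ x, Tendsto (fun s => f s x) (𝓝[>] 0) (𝓝 (g x)) := by
    intro x
    set c : ℝ := 2 * π * ((x j : ℤ) : ℝ) with hc
    have key : ∀ s : ℝ, 0 < s → |f s x - g x| ≤ (5 / 2 * |F x| * c ^ 4) * s ^ 2 := by
      intro s hs0
      have hs2 : 0 < s ^ 2 := by positivity
      have e : f s x - g x = F x * ((1 - Real.cos (c * s) - (c * s) ^ 2 / 2) / s ^ 2) := by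
        simp only [hf, hg, hc]; field_simp
      rw [e, abs_mul, abs_div, abs_of_pos hs2]
      have hT := abs_one_sub_cos_sub_sq_le (c * s) (θ := 2) (by norm_num) le_rfl
      have h4 : |c * s| ^ ((2 : ℝ) + 2) = c ^ 4 * s ^ 4 := by
        rw [show (2 : ℝ) + 2 = ((4 : ℕ) : ℝ) by norm_num, Real.rpow_natCast, abs_mul, mul_pow, pow_abs, pow_abs,
          abs_of_nonneg (by positivity : (0 : ℝ) ≤ c ^ 4), abs_of_nonneg (by positivity : (0 : ℝ) ≤ s ^ 4)]
      rw [h4] at hT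
      have hs42 : s ^ 4 / s ^ 2 = s ^ 2 := by
        rw [show (4 : ℕ) = 2 + 2 from rfl, pow_add, mul_div_cancel_right₀ _ (ne_of_gt hs2)]
      calc |F x| * (|1 - Real.cos (c * s) - (c * s) ^ 2 / 2| / s ^ 2) ≤ |F x| * ((5 / 2 * (c ^ 4 * s ^ 4)) / s ^ 2) := by
            gcongr
        _ = 5 / 2 * |F x| * c ^ 4 * (s ^ 4 / s ^ 2) := by ring
        _ = 5 / 2 * |F x| * c ^ 4 * s ^ 2 := by rw [hs42]
    have hsq : Tendsto (fun s : ℝ => (5 / 2 * |F x| * c ^ 4) * s ^ 2) (𝓝[>] 0) (𝓝 0) := by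
      have h : Tendsto (fun s : ℝ => (5 / 2 * |F x| * c ^ 4) * s ^ 2) (𝓝 0) (𝓝 ((5 / 2 * |F x| * c ^ 4) * 0 ^ 2)) :=
        ((continuous_const.mul (continuous_pow 2)).tendsto 0)
      rw [zero_pow two_ne_zero, mul_zero] at h
      exact h.mono_left nhdsWithin_le_nhds
    refine tendsto_iff_norm_sub_tendsto_zero.2 (squeeze_zero' (Eventually.of_forall fun s => norm_nonneg _) ?_ hsq)
    filter_upwards [self_mem_nhdsWithin] with s hs
    rw [Real.norm_eq_abs]
    exact key s hs
  -- domination `|f s x| ≤ 2π² xⱼ² |F x| ≤ bound x`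
  have hdom : ∀ᶠ s in 𝓝[>] (0 : ℝ), ∀ x, ‖f s x‖ ≤ bound x := by
    filter_upwards [self_mem_nhdsWithin] with s hs x
    have hs0 : 0 < s := hs
    rw [Real.norm_eq_abs, hf, hb]
    simp only
    rw [abs_div, abs_mul, abs_of_pos (pow_pos hs0 2), div_le_iff₀ (pow_pos hs0 2)]
    have h1 : |1 - Real.cos (2 * π * s * ((x j : ℤ) : ℝ))| ≤ (2 * π * s * ((x j : ℤ) : ℝ)) ^ 2 / 2 := by
      rw [abs_of_nonneg (by linarith [Real.cos_le_one (2 * π * s * ((x j : ℤ) : ℝ))])]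
      exact one_sub_cos_le _
    have hxj : ((x j : ℤ) : ℝ) ^ 2 ≤ euclidNorm x ^ 2 := by
      rw [← sq_abs]; exact pow_le_pow_left₀ (abs_nonneg _) (abs_apply_le_euclidNorm x j) 2
    calc |F x| * |1 - Real.cos (2 * π * s * ((x j : ℤ) : ℝ))| ≤ |F x| * ((2 * π * s * ((x j : ℤ) : ℝ)) ^ 2 / 2) :=
          mul_le_mul_of_nonneg_left h1 (abs_nonneg _)
      _ = 2 * π ^ 2 * (((x j : ℤ) : ℝ) ^ 2 * |F x|) * s ^ 2 := by ring
      _ ≤ 2 * π ^ 2 * (euclidNorm x ^ 2 * |F x|) * s ^ 2 := by gcongr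
  have hT := tendsto_tsum_of_dominated_convergence hbs hlim hdom
  -- the bound `G(s) ≤ -K₂` for `0 < s ≤ 1/2`
  have hG : ∀ᶠ s in 𝓝[>] (0 : ℝ), (fun s => ∑' x, f s x) s ≤ -K₂ := by
    have hmem : Set.Ioc (0 : ℝ) (1 / 2) ∈ 𝓝[>] (0 : ℝ) := Ioc_mem_nhdsGT (by norm_num)
    filter_upwards [hmem] with s hs
    have hs0 : 0 < s := hs.1
    have habs : |s| ≤ 1 / 2 := by rw [abs_of_pos hs0]; exact hs.2
    have h := tsum_mul_one_sub_cos_axis_le hF hρ j habs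
    simp only [hf]
    rw [show (fun x => F x * (1 - Real.cos (2 * π * s * ((x j : ℤ) : ℝ))) / s ^ 2) =
      fun x => (s ^ 2)⁻¹ * (F x * (1 - Real.cos (2 * π * s * ((x j : ℤ) : ℝ)))) by funext x; ring, tsum_mul_left]
    rw [inv_mul_le_iff₀ (pow_pos hs0 2)]
    linarith
  have hle : ∑' x, g x ≤ -K₂ := le_of_tendsto hT hG
  -- `Σ g = 2π² Σ xⱼ² F = -(2π²/d) F''`
  have hgsum : ∑' x, g x = 2 * π ^ 2 * ((∑' x, euclidNorm x ^ 2 * F x) / d) := by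
    simp only [hg]
    rw [tsum_mul_left, tsum_sq_apply_mul_eq hF.1 h2 j]
  rw [hgsum] at hle
  rw [ls24Fpp]
  rw [div_le_iff₀ (by positivity)]
  have : 2 * π ^ 2 * (∑' x, euclidNorm x ^ 2 * F x) ≤ -K₂ * d := by
    have h := mul_le_mul_of_nonneg_right hle hd0.le
    rwa [show 2 * π ^ 2 * ((∑' x, euclidNorm x ^ 2 * F x) / d) * d = 2 * π ^ 2 * ∑' x, euclidNorm x ^ 2 * F x by
      field_simp] at h
  linarith

end Fpp

/-! ### The constants `λ, μ` of (1.12) and the function `E = A_μ - λF` of §2.1 -/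

section Params

variable {K₁ K₂ ρ : ℝ} {F : Site d → ℝ}

/-- `E = E_{λ,μ} = A_μ - λF` (§2.1), for the constants `λ = ls24Lambda F`, `μ = ls24Mu F` of (1.12).
[cite: LiuSlade2024, §2.1 (E_{λ,μ} = A_μ - λF)] -/
def ls24E (F : Site d → ℝ) (x : Site d) : ℝ := lsA d (ls24Mu F) x - ls24Lambda F * F x

/-- `Σ_x F(x) = Re F̂(0) ≥ 0`. [cite: LiuSlade2024, Assumption 1.1 (F̂(0) ≥ 0)] -/
theorem tsum_nonneg_of_assumption (hF : LS24Assumption d K₁ K₂ ρ F) : 0 ≤ ∑' x, F x := by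
  have h := hF.2.2.1
  rwa [latticeFourier_zero, Complex.ofReal_re] at h

/-- `Σ_x F(x) ≤ K₁ Z_{d+2+ρ}`. [folklore] -/
theorem tsum_le_of_assumption (hF : LS24Assumption d K₁ K₂ ρ F) (hρ : 0 < ρ) :
    ∑' x, F x ≤ K₁ * ∑' x : Site d, jnorm x ^ (-((d : ℝ) + 2 + ρ)) := by
  rw [← tsum_mul_left]
  refine Summable.tsum_le_tsum (fun x => ?_) (LS24Assumption.summable_abs hF hρ).of_abs
    ((summable_jnorm_rpow_neg (by linarith)).mul_left K₁)
  calc F x ≤ |F x| := le_abs_self _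
    _ ≤ K₁ / jnorm x ^ ((d : ℝ) + 2 + ρ) := hF.2.1 x
    _ = K₁ * jnorm x ^ (-((d : ℝ) + 2 + ρ)) := by rw [Real.rpow_neg (jnorm_pos x).le, div_eq_mul_inv]

/-- `F'' ≤ Σ|x|²|F| ≤ K₁ Z_{d+ρ}`. [folklore] -/
theorem ls24Fpp_le (hF : LS24Assumption d K₁ K₂ ρ F) (hρ : 0 < ρ) :
    ls24Fpp F ≤ K₁ * ∑' x : Site d, jnorm x ^ (-((d : ℝ) + ρ)) := by
  have h2 := LS24Assumption.summable_sq_mul_abs hF hρ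
  rw [ls24Fpp]
  have h1 : -∑' x, euclidNorm x ^ 2 * F x ≤ ∑' x, euclidNorm x ^ 2 * |F x| := by
    rw [← tsum_neg]
    refine Summable.tsum_le_tsum (fun x => ?_) ?_ h2
    · rw [← mul_neg]; exact mul_le_mul_of_nonneg_left (neg_le_abs _) (sq_nonneg _)
    · exact (Summable.of_norm_bounded h2 fun x => by
        rw [Real.norm_eq_abs, abs_mul, abs_of_nonneg (sq_nonneg _)]).neg
  refine h1.trans ?_
  rw [← tsum_mul_left]
  refine Summable.tsum_le_tsum (fun x => ?_) h2 ((summable_jnorm_rpow_neg (by linarith)).mul_left K₁)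
  have hj := jnorm_pos x
  calc euclidNorm x ^ 2 * |F x| ≤ jnorm x ^ 2 * (K₁ / jnorm x ^ ((d : ℝ) + 2 + ρ)) :=
        mul_le_mul (pow_le_pow_left₀ (euclidNorm_nonneg x) (euclidNorm_le_jnorm x) 2) (hF.2.1 x) (abs_nonneg _)
          (by positivity)
    _ = K₁ * jnorm x ^ (-((d : ℝ) + ρ)) := by
        rw [Real.rpow_neg hj.le, show (d : ℝ) + ρ = ((d : ℝ) + 2 + ρ) - 2 by ring, Real.rpow_sub hj,
          Real.rpow_two]
        field_simp

/-- `λ (Σ F + F'') = 1`, `λ > 0`, `λ ≤ 2π²/(dK₂)`. [cite: LiuSlade2024, (1.12) ("By hypothesis, λ > 0")] -/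
theorem ls24Lambda_pos_and_le (hd : 1 ≤ d) (hF : LS24Assumption d K₁ K₂ ρ F) (hρ : 0 < ρ) (hK₂ : 0 < K₂) :
    0 < ls24Lambda F ∧ ls24Lambda F ≤ 2 * π ^ 2 / (d * K₂) ∧
      ls24Lambda F * ((∑' x, F x) + ls24Fpp F) = 1 := by
  have hd0 : (0 : ℝ) < d := by exact_mod_cast hd
  have hm : d * K₂ / (2 * π ^ 2) ≤ ls24Fpp F := ls24Fpp_ge_of_assumption hd hF hρ
  have hm0 : 0 < d * K₂ / (2 * π ^ 2) := by positivity
  have hS0 := tsum_nonneg_of_assumption hF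
  have hpos : 0 < (∑' x, F x) + ls24Fpp F := by linarith
  refine ⟨by rw [ls24Lambda]; exact inv_pos.2 hpos, ?_, by rw [ls24Lambda, inv_mul_cancel₀ hpos.ne']⟩
  rw [ls24Lambda]
  calc ((∑' x, F x) + ls24Fpp F)⁻¹ ≤ (d * K₂ / (2 * π ^ 2))⁻¹ := by
        refine (inv_le_inv₀ hpos hm0).2 (by linarith)
    _ = 2 * π ^ 2 / (d * K₂) := by rw [inv_div]

/-- `μ = λF''`, `0 < μ ≤ 1`, and `μ ≥ (dK₂/2π²)/(K₁(Z₁+Z₂))`-type lower bound: precisely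
`μ (Σ F + F'') = F''`. [cite: LiuSlade2024, (1.12) ("so μ ≤ 1 … in fact μ ∈ (0,1]")] -/
theorem ls24Mu_eq (hd : 1 ≤ d) (hF : LS24Assumption d K₁ K₂ ρ F) (hρ : 0 < ρ) (hK₂ : 0 < K₂) :
    ls24Mu F = ls24Lambda F * ls24Fpp F := by
  obtain ⟨-, -, h1⟩ := ls24Lambda_pos_and_le hd hF hρ hK₂
  rw [ls24Mu]
  linarith [h1]

/-- `0 < μ ≤ 1` for the constant `μ` of (1.12) ("we show in Lemma 2.1 that `μ ∈ (0, 1]`"). [cite: LiuSlade2024, §1.1 (after (1.12)) and Lemma 2.1] -/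
theorem ls24Mu_pos_le_one (hd : 1 ≤ d) (hF : LS24Assumption d K₁ K₂ ρ F) (hρ : 0 < ρ) (hK₂ : 0 < K₂) :
    0 < ls24Mu F ∧ ls24Mu F ≤ 1 := by
  obtain ⟨hl0, -, -⟩ := ls24Lambda_pos_and_le hd hF hρ hK₂
  have hd0 : (0 : ℝ) < d := by exact_mod_cast hd
  have hm : d * K₂ / (2 * π ^ 2) ≤ ls24Fpp F := ls24Fpp_ge_of_assumption hd hF hρ
  have hm0 : 0 < d * K₂ / (2 * π ^ 2) := by positivity
  constructor
  · rw [ls24Mu_eq hd hF hρ hK₂]; exact mul_pos hl0 (by linarith)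
  · rw [ls24Mu]
    have := tsum_nonneg_of_assumption hF
    nlinarith

/-- Lower bound on `μ`: `μ ≥ (dK₂/(2π²)) / (K₁ (Z₁ + Z₂))` in the form `dK₂/(2π²) ≤ μ K₁ (Z₁ + Z₂)`. [folklore] -/
theorem ls24Mu_ge (hd : 1 ≤ d) (hF : LS24Assumption d K₁ K₂ ρ F) (hρ : 0 < ρ) (hK₂ : 0 < K₂) :
    d * K₂ / (2 * π ^ 2) ≤ ls24Mu F * (K₁ * (∑' x : Site d, jnorm x ^ (-((d : ℝ) + 2 + ρ)) +
      ∑' x : Site d, jnorm x ^ (-((d : ℝ) + ρ)))) := by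
  obtain ⟨hl0, -, h1⟩ := ls24Lambda_pos_and_le hd hF hρ hK₂
  have hm : d * K₂ / (2 * π ^ 2) ≤ ls24Fpp F := ls24Fpp_ge_of_assumption hd hF hρ
  have hS := tsum_le_of_assumption hF hρ
  have hP := ls24Fpp_le hF hρ
  have hS0 := tsum_nonneg_of_assumption hF
  have hμ0 := (ls24Mu_pos_le_one hd hF hρ hK₂).1
  -- `μ (ΣF + F'') = F''` and `ΣF + F'' ≤ K₁(Z₁+Z₂)`
  have hkey : ls24Mu F * ((∑' x, F x) + ls24Fpp F) = ls24Fpp F := by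
    rw [ls24Mu_eq hd hF hρ hK₂, mul_assoc, mul_comm (ls24Fpp F), ← mul_assoc, h1, one_mul]
  calc d * K₂ / (2 * π ^ 2) ≤ ls24Fpp F := hm
    _ = ls24Mu F * ((∑' x, F x) + ls24Fpp F) := hkey.symm
    _ ≤ _ := by
        refine mul_le_mul_of_nonneg_left ?_ hμ0.le
        rw [mul_add]; exact add_le_add hS hP

/-- `E` is `ℤ^d`-symmetric. [cite: LiuSlade2024, Lemma 2.2 (hypothesis "E is ℤ^d-symmetric")] -/
theorem isZdSymmetric_ls24E (hFs : IsZdSymmetric F) : IsZdSymmetric (ls24E F) := fun σ' ε x => by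
  simp only [ls24E, isZdSymmetric_lsA (ls24Mu F) σ' ε x, hFs σ' ε x]

/-- Decay of `E`: `|E(x)| ≤ (1 + |μ| + |λ|K) ⟦x⟧^{-s}` whenever `|F(x)| ≤ K⟦x⟧^{-s}`.
[cite: LiuSlade2024, §2.2.2 ("E = A - λF has the same |x|^{-(d+2+ρ)} decay as F")] -/
theorem abs_ls24E_le {K s : ℝ} (hdec : ∀ x, |F x| ≤ K / jnorm x ^ s) (x : Site d) :
    |ls24E F x| ≤ (1 + |ls24Mu F| + |ls24Lambda F| * K) / jnorm x ^ s := by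
  have hj := Real.rpow_pos_of_pos (jnorm_pos x) s
  rw [ls24E]
  calc |lsA d (ls24Mu F) x - ls24Lambda F * F x| ≤ |lsA d (ls24Mu F) x| + |ls24Lambda F * F x| := abs_sub _ _
    _ ≤ (1 + |ls24Mu F|) / jnorm x ^ s + |ls24Lambda F| * (K / jnorm x ^ s) := by
        rw [abs_mul]
        exact add_le_add (abs_lsA_le _ _ x) (mul_le_mul_of_nonneg_left (hdec x) (abs_nonneg _))
    _ = (1 + |ls24Mu F| + |ls24Lambda F| * K) / jnorm x ^ s := by
        rw [← mul_div_assoc, ← add_div]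

/-- The zeroth moment of `E` vanishes: `Σ_x E(x) = (1 - μ) - λΣF = 0`.
[cite: LiuSlade2024, (2.4) (Σ_x E_{λ,μ}(x) = 0)] -/
theorem tsum_ls24E (hd : 1 ≤ d) (hsum : Summable fun x => |F x|) : ∑' x, ls24E F x = 0 := by
  have hA : Summable fun x => lsA d (ls24Mu F) x :=
    (summable_abs_of_decay (abs_lsA_le (ls24Mu F) ((d : ℝ) + 1)) (by linarith)).of_abs
  have hδ : ∑' x : Site d, delta0 x = 1 := by
    rw [tsum_eq_single 0 (fun x hx => delta0_of_ne_zero hx)]; simp [delta0]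
  have hAsum : ∑' x, lsA d (ls24Mu F) x = 1 - ls24Mu F := by
    simp only [lsA]
    rw [Summable.tsum_sub summable_abs_delta0.of_abs (summable_abs_srwStep.of_abs.mul_left _), tsum_mul_left,
      hδ, tsum_srwStep hd, mul_one]
  simp only [ls24E]
  rw [Summable.tsum_sub hA (hsum.of_abs.mul_left _), tsum_mul_left, hAsum, ls24Mu]
  ring

/-- `μ = λF''` as soon as `Σ F + F'' ≠ 0` (pure algebra of (1.12)). [cite: LiuSlade2024, (1.12)] -/
theorem ls24Mu_eq_of_ne (hne : (∑' x, F x) + ls24Fpp F ≠ 0) : ls24Mu F = ls24Lambda F * ls24Fpp F := by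
  have h1 : ls24Lambda F * ((∑' x, F x) + ls24Fpp F) = 1 := by rw [ls24Lambda, inv_mul_cancel₀ hne]
  rw [ls24Mu]
  linarith [h1]

/-- The second moment of `E` vanishes: `Σ_x |x|²E(x) = -μ + λF'' = 0` (whenever `Σ F + F'' ≠ 0`).
[cite: LiuSlade2024, (2.4) (Σ_x |x|²E_{λ,μ}(x) = 0)] -/
theorem tsum_sq_mul_ls24E (hd : 1 ≤ d) (h2 : Summable fun x => euclidNorm x ^ 2 * |F x|)
    (hne : (∑' x, F x) + ls24Fpp F ≠ 0) :
    ∑' x, euclidNorm x ^ 2 * ls24E F x = 0 := by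
  have hF2 : Summable fun x => euclidNorm x ^ 2 * F x :=
    Summable.of_norm_bounded h2 fun x => by rw [Real.norm_eq_abs, abs_mul, abs_of_nonneg (sq_nonneg _)]
  have hδ2 : ∀ x : Site d, euclidNorm x ^ 2 * delta0 x = 0 := fun x => by
    by_cases hx : x = 0
    · subst hx; simp [euclidNorm]
    · rw [delta0_of_ne_zero hx, mul_zero]
  have hD2 : Summable fun x => euclidNorm x ^ 2 * srwStep d x :=
    summable_of_ne_finset_zero (s := (zdGraph d).neighborFinset 0) fun x hx => by rw [srwStep_of_not_mem hx, mul_zero]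
  have e : ∀ x, euclidNorm x ^ 2 * ls24E F x =
      -(ls24Mu F * (euclidNorm x ^ 2 * srwStep d x)) - ls24Lambda F * (euclidNorm x ^ 2 * F x) := by
    intro x; rw [ls24E, lsA]
    have := hδ2 x
    linear_combination this
  rw [tsum_congr e, Summable.tsum_sub (hD2.mul_left _).neg (hF2.mul_left _), tsum_neg, tsum_mul_left,
    tsum_mul_left, tsum_sq_mul_srwStep hd, mul_one, ls24Mu_eq_of_ne hne, ls24Fpp]
  ring

end Params

/-! ### Convergence tools in `L^p`: dominated convergence, and the generic factor package -/

section FactorPackage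

/-- Points of `𝕋^d` (`d ≥ 1`) are Haar-null. [folklore] -/
theorem measure_singleton_torus (hd : 1 ≤ d) (t : 𝕋 d) : volume ({t} : Set (𝕋 d)) = 0 := by
  haveI : Nonempty (Fin d) := ⟨⟨0, hd⟩⟩
  haveI : NullSingletonClass (volume : Measure UnitAddCircle) :=
    ⟨fun x => by rw [← Metric.closedBall_zero (x := x), AddCircle.volume_closedBall]; simp⟩
  exact measure_singleton t

/-- Almost every point of `𝕋^d` is nonzero, i.e. has `ϱ(t) > 0`. [folklore] -/
theorem ae_tnorm_pos (hd : 1 ≤ d) : ∀ᵐ t : 𝕋 d ∂volume, 0 < tnorm t := by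
  have h : ∀ᵐ t : 𝕋 d ∂volume, t ≠ 0 := by
    rw [ae_iff]
    simp only [ne_eq, not_not, Set.setOf_eq_eq_singleton]
    exact measure_singleton_torus hd 0
  filter_upwards [h] with t ht using tnorm_pos ht

/-- **Dominated convergence in `L^p`**: `‖u_N‖_p → 0` if `u_N → 0` a.e. and `|u_N| ≤ |G|` a.e. eventually
with `G ∈ L^p` (`0 < p < ∞`). [folklore] -/
theorem tendsto_eLpNorm_of_dominated {u : ℕ → (𝕋 d) → ℂ} {G : (𝕋 d) → ℂ} {p : ℝ≥0∞} (hp0 : p ≠ 0)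
    (hpt : p ≠ ∞) (hu : ∀ N, AEStronglyMeasurable (u N) volume) (hG : MemLp G p volume)
    (hdom : ∀ᶠ N in atTop, ∀ᵐ t ∂volume, ‖u N t‖ ≤ ‖G t‖)
    (hlim : ∀ᵐ t ∂volume, Tendsto (fun N => u N t) atTop (𝓝 0)) :
    Tendsto (fun N => eLpNorm (u N) p volume) atTop (𝓝 0) := by
  set q := p.toReal with hq
  have hq0 : 0 < q := ENNReal.toReal_pos hp0 hpt
  have hlin : Tendsto (fun N => ∫⁻ t, ‖u N t‖ₑ ^ q) atTop (𝓝 (∫⁻ _t : 𝕋 d, (0 : ℝ≥0∞))) := by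
    refine tendsto_lintegral_filter_of_dominated_convergence' (fun t => ‖G t‖ₑ ^ q)
      (Eventually.of_forall fun N => ((hu N).enorm.pow_const q)) ?_ ?_ ?_
    · filter_upwards [hdom] with N hN
      filter_upwards [hN] with t ht
      refine ENNReal.rpow_le_rpow ?_ hq0.le
      rw [← ofReal_norm, ← ofReal_norm]
      exact ENNReal.ofReal_le_ofReal ht
    · exact (lintegral_rpow_enorm_lt_top_of_eLpNorm_lt_top hp0 hpt hG.eLpNorm_lt_top).ne
    · filter_upwards [hlim] with t ht
      have h := (continuous_enorm.tendsto (0 : ℂ)).comp ht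
      rw [enorm_zero] at h
      have h2 := h.ennrpow_const q
      rwa [ENNReal.zero_rpow_of_pos hq0] at h2
  rw [lintegral_zero] at hlin
  have h3 := hlin.ennrpow_const (1 / q)
  rw [ENNReal.zero_rpow_of_pos (by positivity)] at h3
  refine h3.congr fun N => ?_
  rw [eLpNorm_eq_lintegral_rpow_enorm_toReal hp0 hpt]

/-- The exponent `1/s` as an extended real, `s ↦ (ofReal s)⁻¹` (`s ≤ 0 ↦ ∞`). [folklore] -/
abbrev pinv (s : ℝ) : ℝ≥0∞ := (ENNReal.ofReal s)⁻¹

/-- `(1/s₁, 1/s₂, 1/(s₁+s₂))` is a Hölder triple of exponents. [folklore] -/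
theorem pinv_holderTriple {s₁ s₂ : ℝ} (h₁ : 0 ≤ s₁) (h₂ : 0 ≤ s₂) :
    ENNReal.HolderTriple (pinv s₁) (pinv s₂) (pinv (s₁ + s₂)) := by
  have h := ENNReal.HolderTriple.of (pinv s₁) (pinv s₂)
  rwa [pinv, pinv, inv_inv, inv_inv, ← ENNReal.ofReal_add h₁ h₂] at h

/-- `s ↦ 1/s` is antitone on exponents. [folklore] -/
theorem pinv_antitone {s s' : ℝ} (h : s ≤ s') : pinv s' ≤ pinv s :=
  ENNReal.inv_le_inv.2 (ENNReal.ofReal_le_ofReal h)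

/-- `1 ≤ 1/s` for `s ≤ 1`. [folklore] -/
theorem one_le_pinv {s : ℝ} (h : s ≤ 1) : 1 ≤ pinv s := by
  rw [pinv, ENNReal.le_inv_iff_mul_le, one_mul]
  exact ENNReal.ofReal_le_one.2 h

/-- `1/s < ∞` for `s > 0`. [folklore] -/
theorem pinv_ne_top {s : ℝ} (h : 0 < s) : pinv s ≠ ∞ :=
  ENNReal.inv_ne_top.2 (by simpa using h)

/-- `1/s ≠ 0`. [folklore] -/
theorem pinv_ne_zero (s : ℝ) : pinv s ≠ 0 := ENNReal.inv_ne_zero.2 ENNReal.ofReal_ne_top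

/-- The singular weight `ϱ^{-a}` lies in `L^{1/s₂}` for `a < d s₂`, `0 < s₂ ≤ 1`. [cite: LiuSlade2024, §2.2.2 (proof of Lemma 2.5)] -/
theorem memLp_tnorm_weight (hd : 1 ≤ d) {a s₂ : ℝ} (hs₂0 : 0 < s₂) (hs₂1 : s₂ ≤ 1) (has : a < d * s₂) :
    MemLp (fun t : 𝕋 d => ((tnorm t ^ (-a) : ℝ) : ℂ)) (pinv s₂) volume := by
  have h1 : 1 ≤ 1 / s₂ := by rw [le_div_iff₀ hs₂0]; linarith
  have h2 : a * (1 / s₂) < d := by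
    rw [mul_one_div, div_lt_iff₀ hs₂0]; linarith
  have h := memLp_tnorm_rpow_neg hd (a := a) (p := 1 / s₂) h1 h2
  rwa [one_div, ENNReal.ofReal_inv_of_pos hs₂0] at h

/-- **The generic factor package.** A factor `num · wgt` with numerator in `L^{1/s₁}` (approximated
in that norm) and a weight dominated by `Cϱ^{-a} ∈ L^{1/s₂}` (approximated a.e. under the same
domination) is in `L^{1/s}` for `s ≥ s₁ + s₂`, with the explicit Hölder bound, and its
approximants converge in `L^{1/s}`. [cite: LiuSlade2024, §2.2.1–§2.2.2 (Hölder's inequality with Lemma 2.5)] -/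
theorem factor_package (hd : 1 ≤ d) {num wgt : (𝕋 d) → ℂ} {numN wgtN : ℕ → (𝕋 d) → ℂ}
    {s₁ s₂ s a C : ℝ} (hs₁ : 0 ≤ s₁) (hs₂0 : 0 < s₂) (hs₂1 : s₂ ≤ 1) (has : a < d * s₂)
    (hs : s₁ + s₂ ≤ s) (hC : 0 ≤ C)
    (hnum : AEStronglyMeasurable num volume) (hnumN : ∀ N, AEStronglyMeasurable (numN N) volume)
    (hnum_fin : eLpNorm num (pinv s₁) volume < ∞)
    (hnum_lim : Tendsto (fun N => eLpNorm (numN N - num) (pinv s₁) volume) atTop (𝓝 0))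
    (hwgt : AEStronglyMeasurable wgt volume) (hwgtN : ∀ N, AEStronglyMeasurable (wgtN N) volume)
    (hwgt_le : ∀ᵐ t ∂volume, ‖wgt t‖ ≤ C * tnorm t ^ (-a))
    (hwgtN_le : ∀ᶠ N in atTop, ∀ᵐ t ∂volume, ‖wgtN N t‖ ≤ C * tnorm t ^ (-a))
    (hwgt_lim : ∀ᵐ t ∂volume, Tendsto (fun N => wgtN N t) atTop (𝓝 (wgt t))) :
    eLpNorm (fun t => num t * wgt t) (pinv s) volume ≤
        eLpNorm num (pinv s₁) volume * (ENNReal.ofReal C *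
          eLpNorm (fun t : 𝕋 d => ((tnorm t ^ (-a) : ℝ) : ℂ)) (pinv s₂) volume) ∧
      eLpNorm (fun t : 𝕋 d => ((tnorm t ^ (-a) : ℝ) : ℂ)) (pinv s₂) volume < ∞ ∧
      Tendsto (fun N => eLpNorm (fun t => numN N t * wgtN N t - num t * wgt t) (pinv s) volume) atTop (𝓝 0) := by
  set W : (𝕋 d) → ℂ := fun t => ((tnorm t ^ (-a) : ℝ) : ℂ) with hW
  have hWp : MemLp W (pinv s₂) volume := memLp_tnorm_weight hd hs₂0 hs₂1 has
  have hWm : AEStronglyMeasurable W volume := hWp.1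
  have hWn : ∀ t, ‖W t‖ = tnorm t ^ (-a) := fun t => by
    rw [hW]; simp only; rw [Complex.norm_real, Real.norm_of_nonneg (Real.rpow_nonneg (tnorm_nonneg t) _)]
  haveI hT := pinv_holderTriple hs₁ hs₂0.le
  set r := pinv (s₁ + s₂) with hr
  have hmono : ∀ {f : (𝕋 d) → ℂ}, AEStronglyMeasurable f volume →
      eLpNorm f (pinv s) volume ≤ eLpNorm f r volume := fun hf =>
    eLpNorm_le_eLpNorm_of_exponent_le (pinv_antitone hs) hf
  -- weights against `C • W`
  have hCW : ∀ {w : (𝕋 d) → ℂ}, (∀ᵐ t ∂volume, ‖w t‖ ≤ C * tnorm t ^ (-a)) →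
      eLpNorm w (pinv s₂) volume ≤ ENNReal.ofReal C * eLpNorm W (pinv s₂) volume := by
    intro w hw
    calc eLpNorm w (pinv s₂) volume ≤ eLpNorm ((C : ℂ) • W) (pinv s₂) volume := by
          refine eLpNorm_mono_ae ?_
          filter_upwards [hw] with t ht
          rw [Pi.smul_apply, smul_eq_mul, norm_mul, Complex.norm_real, Real.norm_of_nonneg hC, hWn]
          exact ht
      _ ≤ ‖(C : ℂ)‖ₑ * eLpNorm W (pinv s₂) volume := eLpNorm_const_smul_le
      _ = ENNReal.ofReal C * eLpNorm W (pinv s₂) volume := by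
          rw [← ofReal_norm, Complex.norm_real, Real.norm_of_nonneg hC]
  -- Hölder
  have hH : ∀ {f g : (𝕋 d) → ℂ}, AEStronglyMeasurable f volume → AEStronglyMeasurable g volume →
      eLpNorm (fun t => f t * g t) r volume ≤ eLpNorm f (pinv s₁) volume * eLpNorm g (pinv s₂) volume := by
    intro f g hf hg
    have h := eLpNorm_le_eLpNorm_mul_eLpNorm_of_nnnorm hf hg (· * ·) 1 (ae_of_all _ fun t => by simp) (hpqr := hT)
    rw [ENNReal.coe_one, one_mul] at h
    exact h
  refine ⟨?_, hWp.eLpNorm_lt_top, ?_⟩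
  · calc eLpNorm (fun t => num t * wgt t) (pinv s) volume ≤ eLpNorm (fun t => num t * wgt t) r volume :=
          hmono (hnum.mul hwgt)
      _ ≤ eLpNorm num (pinv s₁) volume * eLpNorm wgt (pinv s₂) volume := hH hnum hwgt
      _ ≤ _ := by gcongr; exact hCW hwgt_le
  · -- `numN wgtN - num wgt = (numN - num) wgtN + num (wgtN - wgt)`
    have hsplit : ∀ N, (fun t => numN N t * wgtN N t - num t * wgt t) =
        (fun t => (numN N - num) t * wgtN N t) + fun t => num t * (wgtN N - wgt) t := by
      intro N; funext t; simp only [Pi.add_apply, Pi.sub_apply]; ring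
    -- first term
    have h1 : Tendsto (fun N => eLpNorm (fun t => (numN N - num) t * wgtN N t) r volume) atTop (𝓝 0) := by
      have hb : ∀ᶠ N in atTop, eLpNorm (fun t => (numN N - num) t * wgtN N t) r volume ≤
          eLpNorm (numN N - num) (pinv s₁) volume * (ENNReal.ofReal C * eLpNorm W (pinv s₂) volume) := by
        filter_upwards [hwgtN_le] with N hN
        exact (hH ((hnumN N).sub hnum) (hwgtN N)).trans (by gcongr; exact hCW hN)
      have hl : Tendsto (fun N => eLpNorm (numN N - num) (pinv s₁) volume *
          (ENNReal.ofReal C * eLpNorm W (pinv s₂) volume)) atTop (𝓝 0) := by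
        have h := ENNReal.Tendsto.mul_const (b := ENNReal.ofReal C * eLpNorm W (pinv s₂) volume) hnum_lim
          (Or.inr (ENNReal.mul_ne_top ENNReal.ofReal_ne_top hWp.eLpNorm_lt_top.ne))
        rwa [zero_mul] at h
      exact tendsto_of_tendsto_of_tendsto_of_le_of_le' tendsto_const_nhds hl
        (Eventually.of_forall fun _ => bot_le) hb
    -- second term: dominated convergence with majorant `num · 2C ϱ^{-a}`
    have h2 : Tendsto (fun N => eLpNorm (fun t => num t * (wgtN N - wgt) t) r volume) atTop (𝓝 0) := by
      have hs12 : 0 < s₁ + s₂ := by linarith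
      have hnumMem : MemLp num (pinv s₁) volume := ⟨hnum, hnum_fin⟩
      have hW2 : MemLp (fun t => ((2 * C : ℝ) : ℂ) * W t) (pinv s₂) volume := hWp.const_mul _
      have hG : MemLp (fun t => num t * (((2 * C : ℝ) : ℂ) * W t)) r volume :=
        MemLp.mul' hW2 hnumMem (hpqr := by
          have h := pinv_holderTriple hs₂0.le hs₁
          rwa [add_comm] at h)
      refine tendsto_eLpNorm_of_dominated (pinv_ne_zero _) (pinv_ne_top hs12)
        (fun N => hnum.mul ((hwgtN N).sub hwgt)) hG ?_ ?_
      · filter_upwards [hwgtN_le] with N hN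
        filter_upwards [hN, hwgt_le] with t ht ht'
        rw [norm_mul, norm_mul, norm_mul, Complex.norm_real, Real.norm_of_nonneg (by positivity), hWn]
        refine mul_le_mul_of_nonneg_left ?_ (norm_nonneg _)
        calc ‖(wgtN N - wgt) t‖ ≤ ‖wgtN N t‖ + ‖wgt t‖ := norm_sub_le _ _
          _ ≤ C * tnorm t ^ (-a) + C * tnorm t ^ (-a) := add_le_add ht ht'
          _ = 2 * C * tnorm t ^ (-a) := by ring
      · filter_upwards [hwgt_lim] with t ht
        have h := (ht.sub_const (wgt t)).const_mul (num t)
        rw [sub_self, mul_zero] at h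
        exact h
    have h12 : Tendsto (fun N => ENNReal.LpAddConst r * (eLpNorm (fun t => (numN N - num) t * wgtN N t) r volume +
        eLpNorm (fun t => num t * (wgtN N - wgt) t) r volume)) atTop (𝓝 0) := by
      have h := ENNReal.Tendsto.const_mul (h1.add h2) (Or.inr (ENNReal.LpAddConst_lt_top r).ne)
      rwa [add_zero, mul_zero] at h
    refine tendsto_of_tendsto_of_tendsto_of_le_of_le tendsto_const_nhds h12 (fun _ => bot_le) fun N => ?_
    calc eLpNorm (fun t => numN N t * wgtN N t - num t * wgt t) (pinv s) volume
        ≤ eLpNorm (fun t => numN N t * wgtN N t - num t * wgt t) r volume :=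
          hmono (((hnumN N).mul (hwgtN N)).sub (hnum.mul hwgt))
      _ ≤ _ := by
          rw [hsplit N]
          exact eLpNorm_add_le' (((hnumN N).sub hnum).mul (hwgtN N)) (hnum.mul ((hwgtN N).sub hwgt)) r

end FactorPackage

end LiuSlade2024Prop24

end Literature.Barriers.CriticalPhenomena.SpreadOutIsing

end
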